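import Mathlib
import Literature.AlgebraicGeometry.Resolution.LocalBlowup
import Literature.AlgebraicGeometry.Resolution.TranscendenceDefect
import Literature.AlgebraicGeometry.Resolution.ResolutionOfSingularities
import Literature.AlgebraicGeometry.Resolution.ResolutionLU
import Literature.AlgebraicGeometry.Resolution.ArithmeticalThreefolds
import Literature.AlgebraicGeometry.Resolution.MonomializationAlongValuation
import Literature.AlgebraicGeometry.Resolution.RsopMonomialIdeals
import Literature.AlgebraicGeometry.Resolution.QuadraticTransformsRegular
import Literature.RingTheory.KrullDimension.AffineDimension
import Literature.RingTheory.KrullDimension.LocalizationDimension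
import Literature.FieldTheory.Separability.PDegreeSeparablyGenerated
import Summits.ResolutionOfSingularities.ResolutionOfSingularities.Theorems.RadicialJungCleanModelsLens5GradedBasis
import Summits.ResolutionOfSingularities.ResolutionOfSingularities.Theorems.RadicialJungCleanModelsLens5ImmediateValuesDegree
import Summits.ResolutionOfSingularities.ResolutionOfSingularities.Theorems.RadicialJungCleanModelsLens5ImmediateValuesMain
import Summits.ResolutionOfSingularities.ResolutionOfSingularities.Theorems.RadicialJungCleanModelsCleanLU3ArcPackage
import Literature.AlgebraicGeometry.Resolution.AffineDomainEquidim
import Literature.AlgebraicGeometry.Resolution.ExcellentRingsFieldProofs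
import Literature.AlgebraicGeometry.Resolution.ExcellentRingsEssFiniteType
import Literature.AlgebraicGeometry.Resolution.LocalBlowupModels
import Summits.ResolutionOfSingularities.ResolutionOfSingularities.Theorems.RadicialJungCleanModelsCleanLU3Defectless
import HarnessLib

/-!
# Crux `DescentPerfectToAll` (stmt-ResolutionOfSingularities-0549) — lens 5 «transfer from the solved sibling», g10:
# THE T-SLICE ASSEMBLY — `CleanLU3DefectPRankTwoAt p` from F-02 (`CossartPiltant2019LU3`) + F-32 (CJS, `hEmb`),
# with a KERNEL-CHECKED COMPOSITION; rev 7: ALL FOUR NAMED PORT OBLIGATIONS PROVED — the lattice half of PORT 3,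
# `port_toricChart_lattice`, is PROVED (sorry-free, axioms {propext, Classical.choice, Quot.sound}) in the COMPANION workfile
# `Cruxes/DescentPerfectToAll/Lens5_PRankTwoLattice.lean` (rev 1, commit cdb420791787) with a BYTE-IDENTICAL statement, and is the one `sorry` kept HERE only
# because crux workfiles cannot import one another on the farm and the inlined proof exceeds the workfile size limit.

ASSEMBLY workfile (res-B-lens-5 g10, 2026-08-29; rev 2: `port_toricChart` recipe — class (C) `hne` from (P2); rev 3: PORT 1 `port_gradedData` PROVED; rev 4: PORT 4
`port_regularParameter` PROVED (memo §13, with the regularity-criterion + chart-surjection kit copied WITH proofs; `dim P` pinned by the surjection, no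
Zariski lemma needed); rev 5: PORT 2 `port_monomialModel` PROVED (memo §2; the TWIST-MODEL kit `Lens5_TwistModel.lean` rev 3 carried verbatim WITH proofs, F-32
called on `xR = g · ∏_f c_f d_f`, the `K`-side re-model `range R' = locAtCentre A₂ O`, and the `d = 3` pinning isolated as ✓ `centre_closed_and_dim_three_of_pow_mem`)
— ONE port obligation remained: `port_toricChart` (S3); rev 6: PORT 3 SPLIT into 3-I (`port_toricChart_ind`, (IND) with integer exponents — PROVED), 3-R
(`port_toricChart_read`, the multiplicative reading `z^C x^{a₀} y^{b₀} = α^· β^· ∏ u_j^{d_j}` of a lattice identity — PROVED) and 3-L (`port_toricChart_lattice`, the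
exponent-level toric chart = the ✓ lattice lemmas read through the value group — OPEN), with `port_toricChart` itself PROVED from the three (kernel-checked glue)
— so the ONE remaining obligation of the T-slice was `port_toricChart_lattice`; rev 7: PORT 3-L PROVED in the companion `Lens5_PRankTwoLattice.lean`
(split (3-L-a) monomial weights, (3-L-b) the exponent lattice `L = pℤ³ + ℤeA + ℤeB` with a `Fin 3`-basis, (3-L-c) abstract lattice-chart lemmas over the
✓ `toric_lemma_classB/C` + `exists_two_level_reading` of `Lens5_UnimodularRefinement.lean` rev 9 — the class (C) `hne` is AUTOMATIC, no (P2) counting —,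
(3-L-d) two-level data of a proper coarsening; kits UR9 + R1A carried verbatim with proofs; statement byte-identical to the one below), so that the two
files together leave NO `sorry` in the T-slice: `cleanLU3DefectPRankTwoAt_of_cossartPiltant2019 : CossartPiltant2019 → hEmb(F-32) → CleanLU3DefectPRankTwoAt p`
(checked sorry-free as ONE file locally on the farm — rc 0, 0 sorries, axioms {propext, Classical.choice, Quot.sound} — before the size split).
OURS · CANDIDATE · counted 0.  Nothing here proves resolution in characteristic `p`;
no crux, registered stub or named fact is proved here; this is NOT a registered skeleton (no `skeleton check`; the slot line of 0549 is
untouched) and it does not conclude the crux — it concludes the census slice `CleanLU3DefectPRankTwoAt p` (THEOREM T of memo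
`CLASSBC-prank2-toric-lens5-g9.md`) of the customer's research stub `stub_cleanLU3DefectNonDiscrete` (`Cruxes/CleanModels/Lines/Sketch.lean`
rev 24 :219; crux stmt-15917, reached from 0549 through `Lines/via_clean_models.lean`).

PURPOSE.  Memo §14 (PORT MAP) lists what the port of THEOREM T still has to write: «(S)-plumbing only».  This file turns that list into a
kernel-checked dependency graph: the slice follows — `theorem cleanLU3DefectPRankTwoAt_of_portStubs`, SORRY-FREE — from exactly four
named statements `port_gradedData` (§1), `port_monomialModel` (§2), `port_toricChart` (§3) and `port_regularParameter` (§13 = §4′), each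
stated over tree declarations only (Mathlib + built `Literature` modules), each carrying its proof recipe (the ✓ kit lemmas of
`Cruxes/DescentPerfectToAll/Lens5_*.lean` / the PORTED `Theorems/RadicialJungCleanModelsLens5*.lean` it is assembled from) and a size.
The `port_*` theorems are the ONLY `sorry`s of this file (census-neutral: they are consumed here and nowhere else); rev 7: `port_gradedData`,
`port_monomialModel`, `port_regularParameter`, `port_toricChart` (from 3-I + 3-L + 3-R) are PROVED here and 3-L `port_toricChart_lattice` in the companion
`Lens5_PRankTwoLattice.lean` (the single `sorry` of THIS file is its placeholder, statement byte-identical): the T-slice is a theorem modulo F-02 + F-32,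
exactly as THEOREM P (class (A), ✓ `cleanLU3DefectArc_of_discrete`) is.

DESIGN (why these four cuts).  Every intermediate object is pushed to the `K`-side and typed by tree declarations: the twist-field model is
delivered as `locAtCentre A₂.toSubring O` for a finitely generated `A₂ ⊆ O ∩ K^p(g₀)` (not as F-32's abstract `R'`; the re-modelling
`range R' = locAtCentre (A'[uu]) O` is part of `port_monomialModel`, and it is what pins F-32's `d` to `3`); units are carried as elements
`ε : K` with `ε ∈ locAtCentre … ∧ O.valuation ε = 1`; exponents are `Fin 3 → ℤ` (Laurent throughout — F-32 monomialises numerators AND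
denominators, so no `p`-th-root extraction (memo §2 (MON)) is needed: the graded coefficients `m_{a,ab} ∈ K^p(g₀)` are monomialised
directly); the toric chart is stated multiplicatively in `K` with the unit factors `α^i β^j` (`x^p = α z^A`, `y^p = β z^B`) that the
«monomial map» `μ : Λ′ → K^×` picks up, and WITH THE KERNEL CLAUSE (a value-zero monomial has zero coordinates on the value-positive chart
vectors) — see the note at `port_toricChart`: the ✓ lattice lemmas `toric_lemma_classB/C` have this in hand (`exists_kernel_adapted_basis`'s
`hind`) but their rev-8 statements do not export it; rev 9 of `Lens5_UnimodularRefinement.lean` (g10) adds the conjunct.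

WHAT IS KERNEL-CHECKED HERE (no sorry): PORT 1 `port_gradedData` (rev 3), PORT 2 `port_monomialModel` (rev 5: the twist field `k(S) = K^p(g₀)`
for perfect `k`, its F-02 model, F-32 on `xR = g · ∏_f c_f d_f`, the `K`-side re-model `range R' = locAtCentre (A'[uu]) O = locAtCentre A₂ O`,
`d = 3` by the closed centre on `A₂ ⊇ t^p`, and the Laurent factorisation `f = c_f / d_f = ε · z^e` of every `f ∈ F`), PORT 3's `K`-side (rev 6:
`port_toricChart_ind` = (IND) `p·C + a·eA + b·eB = 0 ⇒ p ∣ a, b`, `port_toricChart_read` = the reading of lattice coordinates as a Laurent identity with unit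
factors `α^{ia} β^{ib}`, and `port_toricChart` from 3-I + 3-L + 3-R) and PORT 4 `port_regularParameter` (rev 4: the chart algebra
`A'' = k[gens A₂, u, u_{≥ρ}⁻¹, t]`, `dim S = 3` by the arc package, `𝔪_T S ⊆ 𝔞 := (u_{<ρ})`, the normal form `x · w^N ∈ T[u]` on `A''`,
the surjection `κ_T[U]_𝔫 ↠ S⧸𝔞`, the criterion `regular_of_regular_quotient`, and the lift `ψ ∈ T[u_{≥ρ}] ⊆ M` of a regular parameter),
the currency (census §1–§2 verbatim), the exit lemma `cleanLUConcl_of_parameter` (census §8 verbatim,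
with proof), (PB0) `exponents_eq_zero_of_valuation_eq_one` (census, with proof), the small valuation/`zpow` helpers, and the composition
`cleanLU3DefectPRankTwoAt_of_portStubs` / `cleanLU3DefectPRankTwoAt_of_cossartPiltant2019` — i.e. that the four port statements AS TYPED
really give the slice (the data flow of memo §1 → §2 → §3 → §13 → §5, including the piece bookkeeping `a = Σ ν·u^d`, the `(PB0)` placement
of the value-zero chart vectors in `M`, and the unit bookkeeping `α^{i} β^{j} ∈ T^×`).
Resolution of singularities in positive characteristic is NOT proved; rung B of the ladder lives in `dim ≥ 4`.
-/

noncomputable section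

set_option linter.dupNamespace false
set_option linter.unusedVariables false

open IsLocalRing
open Literature.AlgebraicGeometry.Resolution
open Summit.ResolutionOfSingularities.ResolutionOfSingularities.Theorems.RadicialJung.CleanModels.Lens5.GradedBasis
open Summit.ResolutionOfSingularities.ResolutionOfSingularities.Theorems.RadicialJung.CleanModels.Lens5.ImmediateValues

/-! ## KIT: the TWIST MODEL (`Cruxes/DescentPerfectToAll/Lens5_TwistModel.lean` rev 3 405bacf54ae2, §§ verbatim WITH proofs — a Cruxes
workfile is not importable on the farm, so its namespace block is carried here unchanged; used by PORT 2) -/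

namespace Summit.ResolutionOfSingularities.ResolutionOfSingularities.Cruxes.DescentPerfectToAll.CpSibling.TwistModel

variable {k : Type} [Field k] {K : Type} [Field K] [Algebra k K]

/-! ## The affine model `k[S]` of the subfield `k(S)` -/

/-- Membership in the `k`-subalgebra of `↥k(S)` generated by the pull-back of `S` is membership of the underlying element in `k[S] ⊆ K`. -/
theorem mem_adjoin_preimage_iff (S : Set K) (x : IntermediateField.adjoin k S) :
    x ∈ Algebra.adjoin k ((Subtype.val : IntermediateField.adjoin k S → K) ⁻¹' S) ↔ (x : K) ∈ Algebra.adjoin k S := by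
  have himg : ((IntermediateField.adjoin k S).val : IntermediateField.adjoin k S → K) ''
      ((Subtype.val : IntermediateField.adjoin k S → K) ⁻¹' S) = S := by
    have : ((IntermediateField.adjoin k S).val : IntermediateField.adjoin k S → K) =
        (Subtype.val : IntermediateField.adjoin k S → K) := rfl
    rw [this, Set.image_preimage_eq_iff]
    rintro s hs
    exact ⟨⟨s, IntermediateField.subset_adjoin k S hs⟩, rfl⟩
  have hmap : Subalgebra.map (IntermediateField.adjoin k S).val
      (Algebra.adjoin k ((Subtype.val : IntermediateField.adjoin k S → K) ⁻¹' S)) = Algebra.adjoin k S := by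
    rw [AlgHom.map_adjoin, himg]
  constructor
  · intro hx
    rw [← hmap]
    exact Subalgebra.mem_map.mpr ⟨x, hx, rfl⟩
  · intro hx
    rw [← hmap] at hx
    obtain ⟨y, hy, hyx⟩ := Subalgebra.mem_map.mp hx
    have hyx' : y = x := Subtype.ext (by simpa using hyx)
    exact hyx' ▸ hy

/-- `k[S] ⊆ O ∩ k(S)` when `S ⊆ O` and `k ⊆ O`. -/
theorem adjoin_preimage_le_comap (O : ValuationSubring K) (hk : ∀ c : k, algebraMap k K c ∈ O) (S : Set K)
    (hSO : ∀ s ∈ S, s ∈ O) :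
    (Algebra.adjoin k ((Subtype.val : IntermediateField.adjoin k S → K) ⁻¹' S)).toSubring ≤
      (O.comap (algebraMap (IntermediateField.adjoin k S) K)).toSubring := by
  intro x hx
  rw [Subalgebra.mem_toSubring] at hx
  change x ∈ O.comap (algebraMap (IntermediateField.adjoin k S) K)
  rw [ValuationSubring.mem_comap]
  induction hx using Algebra.adjoin_induction with
  | mem x hx => exact hSO _ hx
  | algebraMap r =>
      rw [← IsScalarTower.algebraMap_apply]
      exact hk r
  | add x y _ _ hx hy => rw [map_add]; exact O.add_mem _ _ hx hy
  | mul x y _ _ hx hy => rw [map_mul]; exact O.mul_mem _ _ hx hy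

/-- `Frac k[S] = k(S)` (inside `↥k(S)`). -/
theorem isFractionRing_adjoin_preimage (S : Set K) :
    IsFractionRing (Algebra.adjoin k ((Subtype.val : IntermediateField.adjoin k S → K) ⁻¹' S))
      (IntermediateField.adjoin k S) := by
  refine IsFractionRing.of_field _ _ (fun z => ?_)
  obtain ⟨r, hr, s, hs, hz⟩ := IntermediateField.mem_adjoin_iff_div.mp z.2
  have hrM : r ∈ IntermediateField.adjoin k S := IntermediateField.algebra_adjoin_le_adjoin k S hr
  have hsM : s ∈ IntermediateField.adjoin k S := IntermediateField.algebra_adjoin_le_adjoin k S hs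
  refine ⟨⟨⟨r, hrM⟩, (mem_adjoin_preimage_iff S _).mpr hr⟩, ⟨⟨s, hsM⟩, (mem_adjoin_preimage_iff S _).mpr hs⟩, ?_⟩
  apply Subtype.ext
  simpa using hz

/-- `dim k[S] ≤ dim A` for a finite `S ⊆ K = Frac A`, `A` an affine `k`-domain (both dimensions are transcendence degrees over `k`,
and `trdeg_k k[S] ≤ trdeg_k K = trdeg_k A`). -/
theorem ringKrullDim_adjoin_preimage_le (A : Subalgebra k K) (hfg : A.FG) [IsFractionRing A K] {d : ℕ}
    (hdim : ringKrullDim A ≤ d) (S : Set K) (hSfin : S.Finite) :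
    ringKrullDim (Algebra.adjoin k ((Subtype.val : IntermediateField.adjoin k S → K) ⁻¹' S)) ≤ d := by
  have hBfg : (Algebra.adjoin k ((Subtype.val : IntermediateField.adjoin k S → K) ⁻¹' S)).FG := by
    refine Subalgebra.fg_def.mpr ⟨_, hSfin.preimage Subtype.val_injective.injOn, rfl⟩
  haveI : Algebra.FiniteType k (Algebra.adjoin k ((Subtype.val : IntermediateField.adjoin k S → K) ⁻¹' S)) :=
    (Algebra.adjoin k ((Subtype.val : IntermediateField.adjoin k S → K) ⁻¹' S)).fg_iff_finiteType.mp hBfg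
  haveI : Algebra.FiniteType k A := A.fg_iff_finiteType.mp hfg
  obtain ⟨s, hsB, htrB⟩ := Literature.RingTheory.KrullDimension.exists_ringKrullDim_eq_and_trdeg_eq k
    (Algebra.adjoin k ((Subtype.val : IntermediateField.adjoin k S → K) ⁻¹' S))
  obtain ⟨n, hnA, htrA⟩ := Literature.RingTheory.KrullDimension.exists_ringKrullDim_eq_and_trdeg_eq k A
  haveI : FaithfulSMul k A := (faithfulSMul_iff_algebraMap_injective k A).mpr (algebraMap k A).injective
  haveI : FaithfulSMul A K := (faithfulSMul_iff_algebraMap_injective A K).mpr (IsFractionRing.injective A K)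
  haveI : Algebra.IsAlgebraic A K := IsLocalization.isAlgebraic K (nonZeroDivisors A)
  have htrK : Algebra.trdeg k K = (n : Cardinal) := by
    rw [← trdeg_add_eq k A (A := K), trdeg_eq_zero (R := A) (A := K), add_zero, htrA]
  -- `trdeg_k B ≤ trdeg_k K` along the injective `k`-algebra map `B → M → K`
  have hf : Function.Injective ((IsScalarTower.toAlgHom k (IntermediateField.adjoin k S) K).comp
      (Algebra.adjoin k ((Subtype.val : IntermediateField.adjoin k S → K) ⁻¹' S)).val) := by
    intro x y hxy
    apply Subtype.ext
    apply Subtype.ext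
    simpa using hxy
  have hle : Algebra.trdeg k (Algebra.adjoin k ((Subtype.val : IntermediateField.adjoin k S → K) ⁻¹' S)) ≤
      Algebra.trdeg k K := trdeg_le_of_injective _ hf
  rw [htrB, htrK] at hle
  have hsn : s ≤ n := by exact_mod_cast hle
  have hnd : n ≤ d := by
    rw [hnA] at hdim
    exact_mod_cast hdim
  rw [hsB]
  exact_mod_cast hsn.trans hnd

/-- **§2 INPUT 1 (the M-side regular model).**  Local uniformization in dimension `≤ 3` over `k` (F-02 via `.lu3`), an affine model
`A ⊆ O` of `K` of dimension `≤ 3`, and a finite set `S ⊆ O` produce a finitely generated `A' ⊇ k[S]` inside `O ∩ k(S)` whose localisation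
at the centre of the restricted valuation ring `O ∩ k(S)` is regular.  For THEOREM T take `S := {a_i^p} ∪ {g₀}` (`a_i` generators of `A`,
`g₀ ∈ A`), so that `k(S) = k·K^p(g₀)` (`adjoin_twist_toSubfield_eq`). -/
theorem exists_regular_model_subfield (hLU : LocalUniformization3 k) (O : ValuationSubring K) (A : Subalgebra k K)
    (hAO : A.toSubring ≤ O.toSubring) (hfg : A.FG) (hfr : IsFractionRing A K) (hdim : ringKrullDim A ≤ 3)
    (S : Set K) (hSfin : S.Finite) (hSO : ∀ s ∈ S, s ∈ O) :
    ∃ (A' : Subalgebra k (IntermediateField.adjoin k S))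
      (h : A'.toSubring ≤ (O.comap (algebraMap (IntermediateField.adjoin k S) K)).toSubring),
      Algebra.adjoin k ((Subtype.val : IntermediateField.adjoin k S → K) ⁻¹' S) ≤ A' ∧ A'.FG ∧
        IsRegularLocalRing (Localization.AtPrime
          (centreIdeal A' (O.comap (algebraMap (IntermediateField.adjoin k S) K)) h)) := by
  haveI := hfr
  have hk : ∀ c : k, algebraMap k K c ∈ O := fun c => hAO (A.algebraMap_mem c)
  have hBO := adjoin_preimage_le_comap O hk S hSO
  have hBfg : (Algebra.adjoin k ((Subtype.val : IntermediateField.adjoin k S → K) ⁻¹' S)).FG :=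
    Subalgebra.fg_def.mpr ⟨_, hSfin.preimage Subtype.val_injective.injOn, rfl⟩
  have hBfr := isFractionRing_adjoin_preimage (k := k) S
  have hBdim := ringKrullDim_adjoin_preimage_le A hfg (d := 3) (by exact_mod_cast hdim) S hSfin
  exact hLU (IntermediateField.adjoin k S) (O.comap (algebraMap (IntermediateField.adjoin k S) K)) _ hBO hBfg hBfr
    (by exact_mod_cast hBdim)

/-! ## Identification of the twist field `k(t^p ∪ {g₀}) = k·K^p(g₀)` -/

/-- `a ∈ k[t] ⇒ a^p ∈ k[t^p]` in characteristic `p`. -/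
theorem pow_mem_adjoin_image_pow (p : ℕ) [Fact p.Prime] [CharP K p] (t : Set K) {a : K} (ha : a ∈ Algebra.adjoin k t) :
    a ^ p ∈ Algebra.adjoin k ((fun x : K => x ^ p) '' t) := by
  induction ha using Algebra.adjoin_induction with
  | mem x hx => exact Algebra.subset_adjoin ⟨x, hx, rfl⟩
  | algebraMap r =>
      rw [← map_pow]
      exact Subalgebra.algebraMap_mem _ _
  | add x y _ _ hx hy => rw [add_pow_char]; exact add_mem hx hy
  | mul x y _ _ hx hy => rw [mul_pow]; exact mul_mem hx hy

/-- `K^p ⊆ k(S)` as soon as `S ⊇ t^p` for a generating set `t` of an affine model `A` with `Frac A = K`. -/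
theorem pow_mem_intermediateField_adjoin (p : ℕ) [Fact p.Prime] [CharP K p] (A : Subalgebra k K) [IsFractionRing A K]
    (t : Set K) (ht : Algebra.adjoin k t = A) (S : Set K) (hS : (fun x : K => x ^ p) '' t ⊆ S) (z : K) :
    z ^ p ∈ IntermediateField.adjoin k S := by
  obtain ⟨a, b, hb, rfl⟩ := IsFractionRing.div_surjective (A := A) z
  have hle : Algebra.adjoin k ((fun x : K => x ^ p) '' t) ≤ (IntermediateField.adjoin k S).toSubalgebra :=
    (Algebra.adjoin_mono hS).trans (IntermediateField.algebra_adjoin_le_adjoin k S)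
  have ha' : ((a : K)) ^ p ∈ IntermediateField.adjoin k S := hle (pow_mem_adjoin_image_pow p t (by rw [ht]; exact a.2))
  have hb' : ((b : K)) ^ p ∈ IntermediateField.adjoin k S := hle (pow_mem_adjoin_image_pow p t (by rw [ht]; exact b.2))
  rw [show algebraMap A K a / algebraMap A K b = (a : K) / (b : K) from rfl, div_pow]
  exact div_mem ha' hb'

/-- The twist field of THEOREM T′: `k(t^p ∪ {g₀})` has underlying subfield `Subfield.closure (range (algebraMap k K) ∪ range (frobenius K p) ∪ {g₀})`
(`= k·K^p(g₀)`). -/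
theorem adjoin_twist_toSubfield_eq (p : ℕ) [Fact p.Prime] [CharP K p] (A : Subalgebra k K) [IsFractionRing A K]
    (t : Set K) (ht : Algebra.adjoin k t = A) (g₀ : K) :
    (IntermediateField.adjoin k ((fun x : K => x ^ p) '' t ∪ {g₀})).toSubfield =
      Subfield.closure (Set.range (algebraMap k K) ∪ Set.range (frobenius K p) ∪ {g₀}) := by
  rw [IntermediateField.adjoin_toSubfield]
  apply le_antisymm
  · apply Subfield.closure_le.mpr
    rintro x (hx | hx | hx)
    · exact Subfield.subset_closure (Or.inl (Or.inl hx))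
    · obtain ⟨y, hy, rfl⟩ := hx
      exact Subfield.subset_closure (Or.inl (Or.inr ⟨y, rfl⟩))
    · exact Subfield.subset_closure (Or.inr hx)
  · apply Subfield.closure_le.mpr
    rintro x ((hx | hx) | hx)
    · exact Subfield.subset_closure (Or.inl hx)
    · obtain ⟨z, rfl⟩ := hx
      have := pow_mem_intermediateField_adjoin p A t ht ((fun x : K => x ^ p) '' t ∪ {g₀}) Set.subset_union_left z
      rw [frobenius_def]
      exact this
    · exact Subfield.subset_closure (Or.inr (Or.inr hx))

/-- The twist field of THEOREM T: over a PERFECT ground field, `k(t^p ∪ {g₀})` has underlying subfield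
`Subfield.closure (range (frobenius K p) ∪ {g₀}) = K^p(g₀)`. -/
theorem adjoin_twist_toSubfield_eq_of_perfectField (p : ℕ) [Fact p.Prime] [CharP K p] [CharP k p] [PerfectField k]
    (A : Subalgebra k K) [IsFractionRing A K] (t : Set K) (ht : Algebra.adjoin k t = A) (g₀ : K) :
    (IntermediateField.adjoin k ((fun x : K => x ^ p) '' t ∪ {g₀})).toSubfield =
      Subfield.closure (Set.range (frobenius K p) ∪ {g₀}) := by
  rw [adjoin_twist_toSubfield_eq p A t ht g₀]
  apply le_antisymm
  · apply Subfield.closure_le.mpr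
    rintro x ((hx | hx) | hx)
    · obtain ⟨c, rfl⟩ := hx
      obtain ⟨c', hc'⟩ := surjective_frobenius k p c
      refine Subfield.subset_closure (Or.inl ⟨algebraMap k K c', ?_⟩)
      rw [frobenius_def, ← map_pow, ← frobenius_def, hc']
    · exact Subfield.subset_closure (Or.inl hx)
    · exact Subfield.subset_closure (Or.inr hx)
  · exact Subfield.closure_mono (Set.union_subset_union_left _ Set.subset_union_right)

/-! ## (rev 2) The side obligations of F-32 for the M-side model `T := A'_{centre}`: closed centre, excellence, dimension 3 -/

/-- Units of a restricted valuation ring `O ∩ M` are the elements that are units of `O`. -/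
theorem isUnit_comap_iff (O : ValuationSubring K) (M : IntermediateField k K) (y : O.comap (algebraMap M K)) :
    IsUnit y ↔ IsUnit (⟨algebraMap M K y, y.2⟩ : O) := by
  rw [isUnit_iff_exists_inv, isUnit_iff_exists_inv]
  constructor
  · rintro ⟨b, hb⟩
    refine ⟨⟨algebraMap M K b, b.2⟩, Subtype.ext ?_⟩
    have := congrArg (fun z : O.comap (algebraMap M K) => algebraMap M K (z : M)) hb
    simpa using this
  · rintro ⟨b, hb⟩
    have hb' : algebraMap M K (y : M) * (b : K) = 1 := by
      have := congrArg (fun z : O => (z : K)) hb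
      simpa using this
    have hy0 : (y : M) ≠ 0 := by
      intro h0
      rw [h0, map_zero, zero_mul] at hb'
      exact zero_ne_one hb'
    have hbinv : (b : K) = algebraMap M K ((y : M)⁻¹) := by
      rw [map_inv₀]
      exact eq_inv_of_mul_eq_one_right hb'
    have hyinv : (y : M)⁻¹ ∈ O.comap (algebraMap M K) := by
      rw [ValuationSubring.mem_comap, ← hbinv]
      exact b.2
    refine ⟨⟨(y : M)⁻¹, hyinv⟩, Subtype.ext ?_⟩
    change (y : M) * (y : M)⁻¹ = 1
    exact mul_inv_cancel₀ hy0

/-- The maximal ideal of `O ∩ M` is the trace of the maximal ideal of `O`. -/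
theorem mem_maximalIdeal_comap_iff (O : ValuationSubring K) (M : IntermediateField k K) (y : O.comap (algebraMap M K)) :
    y ∈ IsLocalRing.maximalIdeal (O.comap (algebraMap M K)) ↔
      (⟨algebraMap M K y, y.2⟩ : O) ∈ IsLocalRing.maximalIdeal O := by
  rw [IsLocalRing.mem_maximalIdeal, IsLocalRing.mem_maximalIdeal, mem_nonunits_iff, mem_nonunits_iff, isUnit_comap_iff]

/-- **Closed centre on the M-side model.**  If the centre of `O` is closed on every subring `T ⊆ O` containing the affine model
`A = k[t]` of `K` (the customer's hypothesis (hzd)), and `A' ⊆ O ∩ M` is a `k`-subalgebra of a subfield `M ⊆ K` containing a `p`-th power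
(`p > 0`) of every generator `a ∈ t`, then the centre of `O ∩ M` on `A'` is a maximal ideal.  (The subring `A'[t] ⊆ O` of `K` contains
`A` and is integral over `A'`; maximality descends along integral extensions.) -/
theorem centreIdeal_isMaximal_of_pow_generators (O : ValuationSubring K) (A : Subalgebra k K) (hAO : A.toSubring ≤ O.toSubring)
    (t : Set K) (ht : Algebra.adjoin k t = A)
    (hzd : ∀ (T : Subring K) (hT : T ≤ O.toSubring), A.toSubring ≤ T → (subringCentre T O hT).IsMaximal)
    (M : IntermediateField k K) (A' : Subalgebra k M) (h : A'.toSubring ≤ (O.comap (algebraMap M K)).toSubring)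
    {p : ℕ} (hp : 0 < p) (htA' : ∀ a ∈ t, ∃ y ∈ A', algebraMap M K y = a ^ p) :
    (centreIdeal A' (O.comap (algebraMap M K)) h).IsMaximal := by
  have hk : ∀ c : k, algebraMap k K c ∈ O := fun c => hAO (A.algebraMap_mem c)
  -- `f : M → K`, `B := f(A') ⊆ O`
  set f : M →ₐ[k] K := IsScalarTower.toAlgHom k M K with hf_def
  have hf : Function.Injective f := (algebraMap M K).injective
  set B : Subalgebra k K := A'.map f with hB_def
  have hBO : B.toSubring ≤ O.toSubring := by
    intro x hx
    obtain ⟨y, hy, rfl⟩ := Subalgebra.mem_map.mp hx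
    exact (ValuationSubring.mem_comap.mp (h hy))
  -- `C := k[B ∪ t] = A'[t] ⊆ O`, contains `A`
  set C : Subalgebra k K := Algebra.adjoin k ((B : Set K) ∪ t) with hC_def
  have hCO : C.toSubring ≤ O.toSubring := by
    intro x hx
    rw [Subalgebra.mem_toSubring] at hx
    change x ∈ O
    induction hx using Algebra.adjoin_induction with
    | mem x hx =>
        rcases hx with hx | hx
        · exact hBO hx
        · exact hAO (by rw [← ht]; exact Algebra.subset_adjoin hx)
    | algebraMap r => exact hk r
    | add x y _ _ hx hy => exact O.add_mem _ _ hx hy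
    | mul x y _ _ hx hy => exact O.mul_mem _ _ hx hy
  have hAC : A ≤ C := by
    rw [← ht]
    exact Algebra.adjoin_mono Set.subset_union_right
  have hBC : B ≤ C := fun x hx => Algebra.subset_adjoin (Or.inl hx)
  have hmaxC : (subringCentre C.toSubring O hCO).IsMaximal := hzd C.toSubring hCO hAC
  -- `C` is integral over `B`
  letI algBC : Algebra B C := (Subalgebra.inclusion hBC).toRingHom.toAlgebra
  have halgBC : ∀ b : B, (algebraMap B C b : K) = (b : K) := fun b => rfl
  haveI : Algebra.IsIntegral B C := by
    constructor
    intro x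
    let g : C →ₐ[B] K :=
      { toRingHom := C.val.toRingHom
        commutes' := fun b => rfl }
    have hg : Function.Injective g := Subtype.val_injective
    rw [← isIntegral_algHom_iff g hg]
    change IsIntegral B (x : K)
    have hCle : C ≤ (integralClosure B K).restrictScalars k := by
      apply Algebra.adjoin_le
      rintro a (ha | ha)
      · change IsIntegral B a
        exact isIntegral_algebraMap (R := B) (x := ⟨a, ha⟩)
      · change IsIntegral B a
        obtain ⟨y, hy, hya⟩ := htA' a ha
        apply IsIntegral.of_pow hp
        rw [← hya]
        have hmem : algebraMap M K y ∈ B := Subalgebra.mem_map.mpr ⟨y, hy, rfl⟩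
        exact isIntegral_algebraMap (R := B) (x := ⟨algebraMap M K y, hmem⟩)
    exact hCle x.2
  have hmaxB' : ((subringCentre C.toSubring O hCO).comap (algebraMap B C)).IsMaximal :=
    Ideal.isMaximal_comap_of_isIntegral_of_isMaximal _
  have hcentreB : (subringCentre C.toSubring O hCO).comap (algebraMap B C) = centreIdeal B O hBO := by
    ext b
    rw [Ideal.mem_comap, mem_subringCentre_iff]
    change O.valuation (b : K) < 1 ↔ b ∈ centreIdeal B O hBO
    rw [centreIdeal, Ideal.mem_comap, ValuationSubring.valuation_lt_one_iff]
    rfl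
  have hmaxB : (centreIdeal B O hBO).IsMaximal := hcentreB ▸ hmaxB'
  -- transport along `A' ≃ B`
  set e : A' ≃ₐ[k] B := A'.equivMapOfInjective f hf with he_def
  have hcentre : centreIdeal A' (O.comap (algebraMap M K)) h = (centreIdeal B O hBO).comap e.toRingEquiv.toRingHom := by
    ext y
    rw [centreIdeal, Ideal.mem_comap, mem_maximalIdeal_comap_iff, Ideal.mem_comap, centreIdeal, Ideal.mem_comap,
      ValuationSubring.valuation_lt_one_iff, ValuationSubring.valuation_lt_one_iff]
    have hey : ((e y : B) : K) = algebraMap M K (y : M) := by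
      rw [he_def, Subalgebra.coe_equivMapOfInjective_apply]
      rfl
    change O.valuation (algebraMap M K (y : M)) < 1 ↔ O.valuation ((e y : B) : K) < 1
    rw [hey]
  rw [hcentre]
  exact Ideal.comap_isMaximal_of_surjective _ e.surjective

/-- **Excellence of the M-side model** `T := A'_{centre}`: a local ring essentially of finite type over a field. -/
theorem isExcellentRing_localization_centre (M : IntermediateField k K) (O' : ValuationSubring M) (A' : Subalgebra k M)
    (h : A'.toSubring ≤ O'.toSubring) (hfg : A'.FG) :
    IsExcellentRing (Localization.AtPrime (centreIdeal A' O' h)) := by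
  haveI : Algebra.FiniteType k A' := A'.fg_iff_finiteType.mp hfg
  exact isExcellentRing_localization_atPrime (isExcellentRing_of_field k) (centreIdeal A' O' h)

/-- `K` is algebraic over a subfield containing all `p`-th powers (`p > 0`). -/
theorem isAlgebraic_of_pow_mem (M : IntermediateField k K) {p : ℕ} (hp : 0 < p) (hM : ∀ z : K, z ^ p ∈ M) :
    Algebra.IsAlgebraic M K := by
  constructor
  intro z
  apply IsIntegral.isAlgebraic
  apply IsIntegral.of_pow hp
  exact isIntegral_algebraMap (R := M) (x := ⟨z ^ p, hM z⟩)

/-- **Dimension of the M-side affine model**: a finitely generated `A' ⊇ k[S]` inside `M = k(S)`, with `K` algebraic over `M`, has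
`dim A' = dim A` (both are `trdeg_k K`). -/
theorem ringKrullDim_eq_of_adjoin_le (A : Subalgebra k K) (hAfg : A.FG) [IsFractionRing A K]
    (S : Set K) (halg : Algebra.IsAlgebraic (IntermediateField.adjoin k S) K)
    (A' : Subalgebra k (IntermediateField.adjoin k S))
    (hSA' : Algebra.adjoin k ((Subtype.val : IntermediateField.adjoin k S → K) ⁻¹' S) ≤ A') (hA'fg : A'.FG) :
    ringKrullDim A' = ringKrullDim A := by
  haveI : Algebra.FiniteType k A' := A'.fg_iff_finiteType.mp hA'fg
  haveI : Algebra.FiniteType k A := A.fg_iff_finiteType.mp hAfg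
  -- `Frac A' = k(S)`
  haveI hfr' : IsFractionRing A' (IntermediateField.adjoin k S) := by
    refine IsFractionRing.of_field _ _ (fun z => ?_)
    obtain ⟨r, hr, s, hs, hz⟩ := IntermediateField.mem_adjoin_iff_div.mp z.2
    have hrM : r ∈ IntermediateField.adjoin k S := IntermediateField.algebra_adjoin_le_adjoin k S hr
    have hsM : s ∈ IntermediateField.adjoin k S := IntermediateField.algebra_adjoin_le_adjoin k S hs
    refine ⟨⟨⟨r, hrM⟩, hSA' ((mem_adjoin_preimage_iff S _).mpr hr)⟩, ⟨⟨s, hsM⟩, hSA' ((mem_adjoin_preimage_iff S _).mpr hs)⟩, ?_⟩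
    apply Subtype.ext
    simpa using hz
  obtain ⟨s, hsA', htrA'⟩ := Literature.RingTheory.KrullDimension.exists_ringKrullDim_eq_and_trdeg_eq k A'
  obtain ⟨n, hnA, htrA⟩ := Literature.RingTheory.KrullDimension.exists_ringKrullDim_eq_and_trdeg_eq k A
  haveI : FaithfulSMul k A := (faithfulSMul_iff_algebraMap_injective k A).mpr (algebraMap k A).injective
  haveI : FaithfulSMul A K := (faithfulSMul_iff_algebraMap_injective A K).mpr (IsFractionRing.injective A K)
  haveI : Algebra.IsAlgebraic A K := IsLocalization.isAlgebraic K (nonZeroDivisors A)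
  haveI : FaithfulSMul k A' := (faithfulSMul_iff_algebraMap_injective k A').mpr (algebraMap k A').injective
  haveI : FaithfulSMul A' (IntermediateField.adjoin k S) :=
    (faithfulSMul_iff_algebraMap_injective A' _).mpr (IsFractionRing.injective A' (IntermediateField.adjoin k S))
  haveI : Algebra.IsAlgebraic A' (IntermediateField.adjoin k S) :=
    IsLocalization.isAlgebraic (IntermediateField.adjoin k S) (nonZeroDivisors A')
  haveI : FaithfulSMul (IntermediateField.adjoin k S) K :=
    (faithfulSMul_iff_algebraMap_injective _ K).mpr (algebraMap (IntermediateField.adjoin k S) K).injective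
  haveI := halg
  have htrK : Algebra.trdeg k K = (n : Cardinal) := by
    rw [← trdeg_add_eq k A (A := K), trdeg_eq_zero (R := A) (A := K), add_zero, htrA]
  have htrM : Algebra.trdeg k (IntermediateField.adjoin k S) = (n : Cardinal) := by
    rw [← htrK, ← trdeg_add_eq k (IntermediateField.adjoin k S) (A := K),
      trdeg_eq_zero (R := IntermediateField.adjoin k S) (A := K), add_zero]
  have htrA'' : Algebra.trdeg k A' = (n : Cardinal) := by
    rw [← htrM, ← trdeg_add_eq k A' (A := IntermediateField.adjoin k S),
      trdeg_eq_zero (R := A') (A := IntermediateField.adjoin k S), add_zero]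
  rw [htrA'] at htrA''
  have hsn : s = n := by exact_mod_cast htrA''
  rw [hsA', hnA, hsn]

/-- **The three side obligations of F-32 for the M-side model, assembled** (memo §2 INPUT 2 / §12): for `S ⊇ t^p` finite, `A = k[t]` an
affine model of `K` of dimension `3` with (hzd), and `A' ⊇ k[S]` the output of `exists_regular_model_subfield`: the centre of `O ∩ k(S)`
on `A'` is CLOSED, `T := A'_{centre}` is EXCELLENT and `dim T = 3`. -/
theorem model_side_obligations (p : ℕ) [Fact p.Prime] [CharP K p] (O : ValuationSubring K) (A : Subalgebra k K)
    (hAO : A.toSubring ≤ O.toSubring) (hAfg : A.FG) [IsFractionRing A K] (hdim : ringKrullDim A = 3)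
    (t : Set K) (ht : Algebra.adjoin k t = A)
    (hzd : ∀ (T : Subring K) (hT : T ≤ O.toSubring), A.toSubring ≤ T → (subringCentre T O hT).IsMaximal)
    (S : Set K) (htS : (fun x : K => x ^ p) '' t ⊆ S)
    (A' : Subalgebra k (IntermediateField.adjoin k S))
    (h : A'.toSubring ≤ (O.comap (algebraMap (IntermediateField.adjoin k S) K)).toSubring)
    (hSA' : Algebra.adjoin k ((Subtype.val : IntermediateField.adjoin k S → K) ⁻¹' S) ≤ A') (hA'fg : A'.FG) :
    (centreIdeal A' (O.comap (algebraMap (IntermediateField.adjoin k S) K)) h).IsMaximal ∧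
      IsExcellentRing (Localization.AtPrime (centreIdeal A' (O.comap (algebraMap (IntermediateField.adjoin k S) K)) h)) ∧
      ringKrullDim (Localization.AtPrime (centreIdeal A' (O.comap (algebraMap (IntermediateField.adjoin k S) K)) h)) = 3 := by
  have hp : 0 < p := (Fact.out : p.Prime).pos
  have htA' : ∀ a ∈ t, ∃ y ∈ A', algebraMap (IntermediateField.adjoin k S) K y = a ^ p := by
    intro a ha
    have haS : a ^ p ∈ S := htS ⟨a, ha, rfl⟩
    refine ⟨⟨a ^ p, IntermediateField.subset_adjoin k S haS⟩, hSA' (Algebra.subset_adjoin haS), rfl⟩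
  have hmax := centreIdeal_isMaximal_of_pow_generators O A hAO t ht hzd (IntermediateField.adjoin k S) A' h hp htA'
  refine ⟨hmax, isExcellentRing_localization_centre _ _ A' h hA'fg, ?_⟩
  haveI := hmax
  haveI : Algebra.FiniteType k A' := A'.fg_iff_finiteType.mp hA'fg
  have halg : Algebra.IsAlgebraic (IntermediateField.adjoin k S) K :=
    isAlgebraic_of_pow_mem _ hp (pow_mem_intermediateField_adjoin p A t ht S htS)
  rw [ringKrullDim_localization_atPrime_eq_of_isMaximal k (centreIdeal A' _ h),
    ringKrullDim_eq_of_adjoin_le A hAfg S halg A' hSA' hA'fg, hdim]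

/-! ## (rev 3) §2 in the PORT's convention: `R := locAtCentre A'.toSubring (O ∩ M) ⊆ ↥M`, `K := ↥M`, `E := K`, `O_E := O`

THEOREM P's port (`Theorems/RadicialJungCleanModelsCleanLU3Defectless.lean` :156–:195) calls F-32
`exists_localRing_monomial_of_embeddedResolution hEmb (R := S) (K := K) (E := K) Subtype.val_injective hexcS hdim3 O hRO hRm xR …` with
`S = locAtCentre A.toSubring O`.  For the T-slice the call is the same with `R := locAtCentre A'.toSubring (O.comap (algebraMap M K))`
(a subring of `↥M`, `M = k(S) = k·K^p(g₀)`), `K := ↥M`, `E := K`, `O_E := O`, under the composite algebra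
`letI : Algebra R K := ((algebraMap M K).comp R.subtype).toAlgebra` (scalar tower by `rfl`).  The theorems below deliver EVERY remaining
hypothesis of that call from the customer's data: regularity, excellence, dimension `3`, `hRO`, `hRm` (`locAtCentre_port_inputs`), packaged with
INPUT 1 in `exists_twist_model` (one statement: customer hypotheses + F-02·`.lu3` ⟹ the M-side model with all F-32 inputs); plus the two
bookkeeping facts the port meets first: `dim A = 3` from the stub's `dim A ≤ 3 ∧ dim A_centre = 3`, and `g₀` versus `g₀⁻¹` (one of them lies
in `O`; both generate the same field over `K^p`). -/

/-- `centreIdeal A' O' h` (Subalgebra form, `LocalUniformization.lean`) IS `subringCentre A'.toSubring O' h` (Subring form, `LocalBlowup.lean`). -/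
theorem centreIdeal_eq_subringCentre (M : IntermediateField k K) (O' : ValuationSubring M) (A' : Subalgebra k M)
    (h : A'.toSubring ≤ O'.toSubring) : centreIdeal A' O' h = subringCentre A'.toSubring O' h := rfl

/-- The restricted valuation ring `O ∩ M` measures values in `K`: for `y ∈ O ∩ M`, `v_{O∩M}(y) < 1 ↔ v_O(y) < 1`. -/
theorem valuation_comap_lt_one_iff (O : ValuationSubring K) (M : IntermediateField k K) (y : M)
    (hy : y ∈ O.comap (algebraMap M K)) :
    (O.comap (algebraMap M K)).valuation y < 1 ↔ O.valuation (algebraMap M K y) < 1 := by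
  have h1 := ValuationSubring.valuation_lt_one_iff (O.comap (algebraMap M K)) ⟨y, hy⟩
  have h2 := ValuationSubring.valuation_lt_one_iff O ⟨algebraMap M K y, ValuationSubring.mem_comap.mp hy⟩
  have h3 := mem_maximalIdeal_comap_iff O M ⟨y, hy⟩
  rw [← h1, h3, h2]

/-- `dim A = 3` from the stub's `dim A ≤ 3` and `dim (locAtCentre A O) = 3` (a localisation does not raise the dimension). -/
theorem ringKrullDim_eq_three_of_locAtCentre (O : ValuationSubring K) (A : Subalgebra k K) (hAO : A.toSubring ≤ O.toSubring)
    (hle : ringKrullDim A ≤ 3) (h3 : ringKrullDim (locAtCentre A.toSubring O) = 3) : ringKrullDim A = 3 := by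
  haveI := isLocalization_locAtCentre hAO
  refine le_antisymm hle ?_
  rw [← h3]
  exact Literature.RingTheory.KrullDimension.ringKrullDim_le_of_isLocalization
    (subringCentre A.toSubring O hAO).primeCompl (locAtCentre A.toSubring O)

/-- One of `g₀`, `g₀⁻¹` lies in `O`, and both generate the same field over any subfield data: `F(X ∪ {g⁻¹}) = F(X ∪ {g})` as subfields. -/
theorem subfield_closure_union_inv_eq (X : Set K) (g : K) : Subfield.closure (X ∪ {g⁻¹}) = Subfield.closure (X ∪ {g}) := by
  refine le_antisymm (Subfield.closure_le.mpr ?_) (Subfield.closure_le.mpr ?_)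
  · rintro x (hx | hx)
    · exact Subfield.subset_closure (Or.inl hx)
    · rw [Set.mem_singleton_iff.mp hx]
      exact inv_mem (Subfield.subset_closure (Or.inr rfl))
  · rintro x (hx | hx)
    · exact Subfield.subset_closure (Or.inl hx)
    · rw [Set.mem_singleton_iff.mp hx]
      have hg : g⁻¹ ∈ Subfield.closure (X ∪ {g⁻¹}) := Subfield.subset_closure (Or.inr rfl)
      simpa using inv_mem hg

theorem mem_or_inv_mem_valuationSubring (O : ValuationSubring K) (g₀ : K) : ∃ g₁ : K, g₁ ∈ O ∧ (g₁ = g₀ ∨ g₁ = g₀⁻¹) := by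
  rcases O.mem_or_inv_mem g₀ with h | h
  · exact ⟨g₀, h, Or.inl rfl⟩
  · exact ⟨g₀⁻¹, h, Or.inr rfl⟩

/-- **The F-32 inputs for the M-side model in the port's convention.**  For `A' ⊆ O ∩ M` finitely generated over `k` of dimension `3` whose
centre is closed and whose localisation at the centre is regular: `R := locAtCentre A'.toSubring (O ∩ M)` is a REGULAR local ring, EXCELLENT,
of dimension `3`, contained in `O` and DOMINATED by `O` (`r ∈ 𝔪_R ↔ v_O(r) < 1`, values read in `K`). -/
theorem locAtCentre_port_inputs (O : ValuationSubring K) (M : IntermediateField k K) (A' : Subalgebra k M)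
    (h : A'.toSubring ≤ (O.comap (algebraMap M K)).toSubring) (hA'fg : A'.FG)
    (hmax : (centreIdeal A' (O.comap (algebraMap M K)) h).IsMaximal)
    (hreg : IsRegularLocalRing (Localization.AtPrime (centreIdeal A' (O.comap (algebraMap M K)) h)))
    (hdimA' : ringKrullDim A' = 3) :
    ∃ _ : IsRegularLocalRing (locAtCentre A'.toSubring (O.comap (algebraMap M K))),
      IsExcellentRing (locAtCentre A'.toSubring (O.comap (algebraMap M K))) ∧
      ringKrullDim (locAtCentre A'.toSubring (O.comap (algebraMap M K))) = 3 ∧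
      (∀ r : locAtCentre A'.toSubring (O.comap (algebraMap M K)), algebraMap M K (r : M) ∈ O) ∧
      (∀ r : locAtCentre A'.toSubring (O.comap (algebraMap M K)),
        r ∈ IsLocalRing.maximalIdeal (locAtCentre A'.toSubring (O.comap (algebraMap M K))) ↔
          O.valuation (algebraMap M K (r : M)) < 1) := by
  have hreg' : IsRegularLocalRing (locAtCentre A'.toSubring (O.comap (algebraMap M K))) :=
    (isRegularLocalRing_locAtCentre_iff h).mpr hreg
  haveI := hreg'
  haveI := isLocalization_locAtCentre h
  haveI : Algebra.FiniteType k A' := A'.fg_iff_finiteType.mp hA'fg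
  have hexcA' : IsExcellentRing A' := isExcellentRing_of_finiteType_field k A'
  have hexc : IsExcellentRing (locAtCentre A'.toSubring (O.comap (algebraMap M K))) :=
    IsExcellentRing.of_isLocalization (A := A'.toSubring) (B := locAtCentre A'.toSubring (O.comap (algebraMap M K)))
      (subringCentre A'.toSubring (O.comap (algebraMap M K)) h).primeCompl hexcA'
  have hdim : ringKrullDim (locAtCentre A'.toSubring (O.comap (algebraMap M K))) = 3 := by
    rw [← ringKrullDim_eq_of_ringEquiv (locAtCentreEquiv h).toRingEquiv]
    haveI := hmax
    change ringKrullDim (Localization.AtPrime (centreIdeal A' (O.comap (algebraMap M K)) h)) = 3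
    rw [ringKrullDim_localization_atPrime_eq_of_isMaximal k (centreIdeal A' (O.comap (algebraMap M K)) h), hdimA']
  refine ⟨hreg', hexc, hdim, fun r => ValuationSubring.mem_comap.mp (locAtCentre_le h r.2), fun r => ?_⟩
  rw [mem_maximalIdeal_locAtCentre_iff h r]
  exact valuation_comap_lt_one_iff O M (r : M) (locAtCentre_le h r.2)

/-- **§2 of THEOREM T, assembled in the port's convention.**  Customer data — an affine model `A = k[t] ⊆ O` of `K` (`t` finite,
`Frac A = K`, `dim A = 3`; use `ringKrullDim_eq_three_of_locAtCentre`), the closed-centre hypothesis (hzd), an element `g₁ ∈ O` (`g₀` or `g₀⁻¹`,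
`mem_or_inv_mem_valuationSubring`) — together with F-02 via `.lu3` (`hLU : LocalUniformization3 k`) give, on the twist field `M := k(t^p ∪ {g₁})`
(`= k·K^p(g₀)` as a subfield: `adjoin_twist_toSubfield_eq` + `subfield_closure_union_inv_eq`; `= K^p(g₀)` for perfect `k`), a finitely generated
`A' ⊇ k[t^p, g₁]` inside `O ∩ M` such that `R := locAtCentre A'.toSubring (O ∩ M)` satisfies every hypothesis of F-32
`exists_localRing_monomial_of_embeddedResolution` with `K := ↥M`, `E := K`, `O_E := O`: regular local, excellent, `dim R = 3`, `R ⊆ O`, dominated. -/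
theorem exists_twist_model (p : ℕ) [Fact p.Prime] [CharP K p] (hLU : LocalUniformization3 k) (O : ValuationSubring K)
    (A : Subalgebra k K) (hAO : A.toSubring ≤ O.toSubring) (hAfg : A.FG) [IsFractionRing A K] (hdimA : ringKrullDim A = 3)
    (t : Finset K) (ht : Algebra.adjoin k (t : Set K) = A)
    (hzd : ∀ (T : Subring K) (hT : T ≤ O.toSubring), A.toSubring ≤ T → (subringCentre T O hT).IsMaximal)
    (g₁ : K) (hg₁ : g₁ ∈ O) (S : Set K) (hS : S = (fun x : K => x ^ p) '' (t : Set K) ∪ {g₁}) :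
    ∃ (A' : Subalgebra k (IntermediateField.adjoin k S)),
      A'.toSubring ≤ (O.comap (algebraMap (IntermediateField.adjoin k S) K)).toSubring ∧
      Algebra.adjoin k ((Subtype.val : IntermediateField.adjoin k S → K) ⁻¹' S) ≤ A' ∧ A'.FG ∧
      ∃ _ : IsRegularLocalRing (locAtCentre A'.toSubring (O.comap (algebraMap (IntermediateField.adjoin k S) K))),
        IsExcellentRing (locAtCentre A'.toSubring (O.comap (algebraMap (IntermediateField.adjoin k S) K))) ∧
        ringKrullDim (locAtCentre A'.toSubring (O.comap (algebraMap (IntermediateField.adjoin k S) K))) = 3 ∧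
        (∀ r : locAtCentre A'.toSubring (O.comap (algebraMap (IntermediateField.adjoin k S) K)),
          algebraMap (IntermediateField.adjoin k S) K (r : IntermediateField.adjoin k S) ∈ O) ∧
        (∀ r : locAtCentre A'.toSubring (O.comap (algebraMap (IntermediateField.adjoin k S) K)),
          r ∈ IsLocalRing.maximalIdeal _ ↔ O.valuation (algebraMap (IntermediateField.adjoin k S) K (r : IntermediateField.adjoin k S)) < 1) := by
  have hSfin : S.Finite := by
    rw [hS]
    exact ((t.finite_toSet).image _).union (Set.finite_singleton _)
  have hSO : ∀ s ∈ S, s ∈ O := by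
    intro s hs
    rw [hS] at hs
    rcases hs with ⟨a, ha, rfl⟩ | hs
    · have haA : a ∈ A := by rw [← ht]; exact Algebra.subset_adjoin ha
      exact (pow_mem (hAO haA) p : a ^ p ∈ O.toSubring)
    · rw [Set.mem_singleton_iff.mp hs]; exact hg₁
  have htS : (fun x : K => x ^ p) '' (t : Set K) ⊆ S := by rw [hS]; exact Set.subset_union_left
  obtain ⟨A', h, hSA', hA'fg, hreg⟩ := exists_regular_model_subfield hLU O A hAO hAfg inferInstance hdimA.le S hSfin hSO
  obtain ⟨hmax, -, -⟩ := model_side_obligations p O A hAO hAfg hdimA (t : Set K) ht hzd S htS A' h hSA' hA'fg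
  have hp : 0 < p := (Fact.out : p.Prime).pos
  have halg : Algebra.IsAlgebraic (IntermediateField.adjoin k S) K :=
    isAlgebraic_of_pow_mem _ hp (pow_mem_intermediateField_adjoin p A (t : Set K) ht S htS)
  have hdimA' : ringKrullDim A' = 3 := by rw [ringKrullDim_eq_of_adjoin_le A hAfg S halg A' hSA' hA'fg, hdimA]
  exact ⟨A', h, hSA', hA'fg, locAtCentre_port_inputs O _ A' h hA'fg hmax hreg hdimA'⟩

/-! ## (rev 3) THE F-32 CALL ITSELF on the M-side model (instance plumbing de-risked)

Under the composite algebra `R → ↥M → K` (supplied by the port as `letI : Algebra R K := ((algebraMap M K).comp R.subtype).toAlgebra` with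
`IsScalarTower R M K` by `IsScalarTower.of_algebraMap_eq fun _ => rfl`; taken here as instance hypotheses, so the statement stays def-free)
the F-32 entry `exists_localRing_monomial_of_embeddedResolution` applies VERBATIM with `K := ↥M`, `E := K`, `O_E := O` to any
`0 ≠ x_R ∈ 𝔪_R` of `R := locAtCentre A'.toSubring (O ∩ M)`: this is §2 INPUT 2 of THEOREM T (the element to monomialise, `x^p y^p ∏ τσ`,
comes from §1 and lies in `M`).  Universe `0` throughout (`Scheme.{0}` in `hEmb`, as in THEOREM P's port). -/

section F32Call

open AlgebraicGeometry CategoryTheory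

/-- **F-32 on the twist field.**  [cite: CossartJannsenSaito2020, Cor. 1.5, p. 7] (hypothesis `hEmb`, F-78 shape) -/
theorem monomialise_on_twist_model
    (hEmb : ∀ (Z : Scheme.{0}) [IsIntegral Z] [IsNoetherian Z], Scheme.IsRegular Z →
      Scheme.IsExcellent Z → ∀ (X : Set Z), IsClosed X → X ≠ Set.univ → topologicalKrullDim X ≤ 2 →
        ∃ (Z' : Scheme.{0}) (π : Z' ⟶ Z), IsProper π ∧ Function.Surjective π.base ∧
          (∃ U : Z.Opens, (U : Set Z) = Xᶜ ∧ IsIso (π ∣_ U)) ∧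
          IsStrictNormalCrossingsDivisor Z' (π.base ⁻¹' X))
    (O : ValuationSubring K) (M : IntermediateField k K) (A' : Subalgebra k M)
    (h : A'.toSubring ≤ (O.comap (algebraMap M K)).toSubring) (hA'fg : A'.FG)
    (hmax : (centreIdeal A' (O.comap (algebraMap M K)) h).IsMaximal)
    (hreg : IsRegularLocalRing (Localization.AtPrime (centreIdeal A' (O.comap (algebraMap M K)) h)))
    (hdimA' : ringKrullDim A' = 3)
    [Algebra (locAtCentre A'.toSubring (O.comap (algebraMap M K))) K]
    [IsScalarTower (locAtCentre A'.toSubring (O.comap (algebraMap M K))) M K]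
    (xR : locAtCentre A'.toSubring (O.comap (algebraMap M K))) (hxR0 : xR ≠ 0)
    (hxRm : O.valuation (algebraMap M K (xR : M)) < 1) :
    ∃ uu : Finset K, ((uu : Set K) ⊆ Set.range (algebraMap M K)) ∧
      (∀ y ∈ Algebra.adjoin (locAtCentre A'.toSubring (O.comap (algebraMap M K))) (uu : Set K), y ∈ O) ∧
      ∃ (R' : Type) (_ : CommRing R') (_ : IsRegularLocalRing R') (_ : Algebra R' K),
        Function.Injective (algebraMap R' K) ∧ (∀ r : R', algebraMap R' K r ∈ O) ∧
        (∀ r : R', r ∈ IsLocalRing.maximalIdeal R' ↔ O.valuation (algebraMap R' K r) < 1) ∧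
        (∀ y ∈ Algebra.adjoin (locAtCentre A'.toSubring (O.comap (algebraMap M K))) (uu : Set K),
          y ∈ Set.range (algebraMap R' K)) ∧
        (∀ r : R', ∃ τ σ : K, τ ∈ Algebra.adjoin (locAtCentre A'.toSubring (O.comap (algebraMap M K))) (uu : Set K) ∧
          σ ∈ Algebra.adjoin (locAtCentre A'.toSubring (O.comap (algebraMap M K))) (uu : Set K) ∧
          O.valuation σ = 1 ∧ algebraMap R' K r * σ = τ) ∧
        ∃ (d : ℕ) (z : Fin d → R') (α : Fin d → ℕ) (u : R'), IsUnit u ∧ ringKrullDim R' = d ∧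
          Ideal.span (Set.range z) = IsLocalRing.maximalIdeal R' ∧
          algebraMap (locAtCentre A'.toSubring (O.comap (algebraMap M K))) K xR = algebraMap R' K (u * ∏ i, z i ^ α i) := by
  obtain ⟨hreg', hexc, hdim, hRO, hRm⟩ := locAtCentre_port_inputs O M A' h hA'fg hmax hreg hdimA'
  haveI := hreg'
  have halg : ∀ r : locAtCentre A'.toSubring (O.comap (algebraMap M K)),
      algebraMap (locAtCentre A'.toSubring (O.comap (algebraMap M K))) K r = algebraMap M K (r : M) := fun r =>
    IsScalarTower.algebraMap_apply (locAtCentre A'.toSubring (O.comap (algebraMap M K))) M K r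
  have hRO' : ∀ r : locAtCentre A'.toSubring (O.comap (algebraMap M K)),
      algebraMap (locAtCentre A'.toSubring (O.comap (algebraMap M K))) K r ∈ O := fun r => by rw [halg]; exact hRO r
  have hRm' : ∀ r : locAtCentre A'.toSubring (O.comap (algebraMap M K)),
      r ∈ IsLocalRing.maximalIdeal _ ↔ O.valuation (algebraMap (locAtCentre A'.toSubring (O.comap (algebraMap M K))) K r) < 1 :=
    fun r => by rw [halg]; exact hRm r
  have hxRm' : xR ∈ IsLocalRing.maximalIdeal _ := (hRm xR).mpr hxRm
  exact exists_localRing_monomial_of_embeddedResolution hEmb (R := locAtCentre A'.toSubring (O.comap (algebraMap M K)))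
    (K := M) (E := K) Subtype.val_injective hexc hdim O hRO' hRm' xR hxR0 hxRm'

end F32Call

end Summit.ResolutionOfSingularities.ResolutionOfSingularities.Cruxes.DescentPerfectToAll.CpSibling.TwistModel

namespace Summit.ResolutionOfSingularities.ResolutionOfSingularities.Cruxes.DescentPerfectToAll.CpSibling.PRankTwoAssembly

/-! ## §0 Currency (verbatim from `Census_lens5_pRankTwo.lean` rev 8 §1–§2) -/

/-- The common conclusion of `stub_cleanLU3*` (census §1, verbatim). [folklore] -/
def CleanLUConcl (p : ℕ) (k K : Type) [Field k] [Field K] [Algebra k K] (O : ValuationSubring K) (A : Subalgebra k K)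
    (g₀ : K) : Prop :=
    ∃ (A' : Subalgebra k K), A'.toSubring ≤ O.toSubring ∧ A ≤ A' ∧ A'.FG ∧
      ∃ (_ : IsRegularLocalRing (locAtCentre A'.toSubring O)) (c : Fin p → K),
        (∃ j : Fin p, (j : ℕ) ≠ 0 ∧ c j ≠ 0) ∧
        ((∃ (d m : ℕ) (hmd : m ≤ d) (t : Fin d → ↥(locAtCentre A'.toSubring O)) (a : Fin m → ℕ)
            (u : ↥(locAtCentre A'.toSubring O)), IsUnit u ∧
            Ideal.span (Set.range t) = IsLocalRing.maximalIdeal ↥(locAtCentre A'.toSubring O) ∧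
            ringKrullDim ↥(locAtCentre A'.toSubring O) = (d : WithBot ℕ∞) ∧ 0 < m ∧ (∀ i, ¬ p ∣ a i) ∧
            (∑ j : Fin p, c j ^ p * g₀ ^ (j : ℕ)) =
              (u : K) * ∏ i : Fin m, ((t (Fin.castLE hmd i) : ↥(locAtCentre A'.toSubring O)) : K) ^ (a i)) ∨
          (∃ u : ↥(locAtCentre A'.toSubring O), IsUnit u ∧ (∑ j : Fin p, c j ^ p * g₀ ^ (j : ℕ)) = (u : K) ∧
            ∀ c' : ↥(locAtCentre A'.toSubring O), u - c' ^ p ∉ IsLocalRing.maximalIdeal ↥(locAtCentre A'.toSubring O)) ∨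
          (∃ s c' : ↥(locAtCentre A'.toSubring O), (∑ j : Fin p, c j ^ p * g₀ ^ (j : ℕ)) = (s : K) ∧
            s - c' ^ p ∈ IsLocalRing.maximalIdeal ↥(locAtCentre A'.toSubring O) ∧
            s - c' ^ p ∉ IsLocalRing.maximalIdeal ↥(locAtCentre A'.toSubring O) ^ 2))

/-- **(P2) `[Γ : pΓ] = p²`** (census §2, verbatim). [folklore] -/
def PRankTwoAt {K : Type} [Field K] (p : ℕ) (O : ValuationSubring K) : Prop :=
    ∃ x y : K, x ≠ 0 ∧ y ≠ 0 ∧ ∀ a b : ℕ, a < p → b < p → (a ≠ 0 ∨ b ≠ 0) →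
      ∀ z : K, z ≠ 0 → O.valuation (x ^ a * y ^ b) ≠ O.valuation (z ^ p)

/-- **THEOREM T's slice** — `stub_cleanLU3DefectNonDiscrete` at `p` on {`PerfectField k`, `PRankTwoAt p O`} (census §2, verbatim).
OURS · CANDIDATE · counted 0. [folklore] -/
def CleanLU3DefectPRankTwoAt (p : ℕ) : Prop :=
    ∀ (k : Type) [Field k] [CharP k p] [PerfectField k] (K : Type) [Field K] [Algebra k K]
    (O : ValuationSubring K) (A : Subalgebra k K), A.toSubring ≤ O.toSubring → A.FG → IsFractionRing A K →
    ringKrullDim A ≤ 3 → IsRegularLocalRing (locAtCentre A.toSubring O) →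
    ringKrullDim (locAtCentre A.toSubring O) = 3 →
    (∀ (T : Subring K) (hT : T ≤ O.toSubring), A.toSubring ≤ T → (subringCentre T O hT).IsMaximal) →
    ∀ g₀ : K, (∀ c : K, c ^ p ≠ g₀) →
    (∀ f₀ : K, ∃ f₁ : K, O.valuation (g₀ - f₁ ^ p) < O.valuation (g₀ - f₀ ^ p)) →
    (∀ hk : ∀ c : k, algebraMap k K c ∈ O, transcendenceDefect k O hk ≠ 0) →
    ¬ (∃ π : K, π ≠ 0 ∧ (∀ x : K, O.valuation x < 1 → O.valuation x ≤ O.valuation π) ∧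
      (∀ x : K, x ≠ 0 → ∃ n : ℕ, O.valuation π ^ n ≤ O.valuation x)) →
    PRankTwoAt p O →
    CleanLUConcl p k K O A g₀

/-! ## §1 THE FOUR PORT OBLIGATIONS — ALL PROVED (PORT 1 in rev 3, PORT 4 in rev 4, PORT 2 in rev 5, PORT 3 in rev 6 + its lattice half 3-L in rev 7 in the
companion `Lens5_PRankTwoLattice.lean`; the placeholder `sorry` of `port_toricChart_lattice` is the only `sorry` of this file)

Conventions: `T := locAtCentre A₂.toSubring O` is the (re-modelled, `K`-side) twist-field model; «unit of `T`» is carried as `ε : K` with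
`ε ∈ T ∧ O.valuation ε = 1` (⟺ `IsUnit` in `T`, by domination `mem_maximalIdeal_locAtCentre_iff`); exponents are `Fin 3 → ℤ`;
`j < ρ` indexes the value-positive chart monomials, `ρ ≤ j` the value-zero ones (`ρ ∈ {1, 2}`). -/

section PortStubs

open AlgebraicGeometry CategoryTheory

/-! ### (rev 3) helpers for PORT 1 — (P2) bookkeeping and the p-degree (copied census lemmas carry their proofs) -/

/-- (P2) is symmetric under inverting `x` (census ✓ `pRankTwo_inv_left`, verbatim with proof). [folklore] -/
theorem pRankTwo_inv_left {K : Type} [Field K] {p : ℕ} (O : ValuationSubring K) {x y : K} (hx : x ≠ 0)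
    (hP : ∀ a b : ℕ, a < p → b < p → (a ≠ 0 ∨ b ≠ 0) → ∀ z : K, z ≠ 0 → O.valuation (x ^ a * y ^ b) ≠ O.valuation (z ^ p)) :
    ∀ a b : ℕ, a < p → b < p → (a ≠ 0 ∨ b ≠ 0) → ∀ z : K, z ≠ 0 →
      O.valuation (x⁻¹ ^ a * y ^ b) ≠ O.valuation (z ^ p) := by
  intro a b ha hb hab z hz h
  rcases Nat.eq_zero_or_pos a with rfl | hapos
  · simp only [pow_zero, one_mul] at h
    exact hP 0 b ha hb hab z hz (by simpa using h)
  · have hpa : p - a < p := Nat.sub_lt (lt_of_le_of_lt (Nat.zero_le a) ha) hapos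
    have hpa0 : p - a ≠ 0 := Nat.sub_ne_zero_of_lt ha
    apply hP (p - a) b hpa hb (Or.inl hpa0) (x * z) (mul_ne_zero hx hz)
    have hxp : x ^ (p - a) = x ^ p * x⁻¹ ^ a := by
      rw [inv_pow, ← div_eq_mul_inv, eq_div_iff (pow_ne_zero a hx), ← pow_add, Nat.sub_add_cancel (le_of_lt ha)]
    rw [hxp, mul_assoc, map_mul, h, ← map_mul, ← mul_pow]

/-- (P2) is symmetric in `x`, `y`. [folklore] -/
theorem pRankTwo_swap {K : Type} [Field K] {p : ℕ} (O : ValuationSubring K) {x y : K}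
    (hP : ∀ a b : ℕ, a < p → b < p → (a ≠ 0 ∨ b ≠ 0) → ∀ z : K, z ≠ 0 → O.valuation (x ^ a * y ^ b) ≠ O.valuation (z ^ p)) :
    ∀ a b : ℕ, a < p → b < p → (a ≠ 0 ∨ b ≠ 0) → ∀ z : K, z ≠ 0 →
      O.valuation (y ^ a * x ^ b) ≠ O.valuation (z ^ p) := by
  intro a b ha hb hab z hz
  rw [mul_comm]
  exact hP b a hb ha hab.symm z hz

/-- Under (P2), `v x ≠ 1` (take `(a, b) = (1, 0)`, `z = 1`). [folklore] -/
theorem valuation_ne_one_of_pRankTwo {K : Type} [Field K] {p : ℕ} (hp : p.Prime) (O : ValuationSubring K) {x y : K}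
    (hP : ∀ a b : ℕ, a < p → b < p → (a ≠ 0 ∨ b ≠ 0) → ∀ z : K, z ≠ 0 → O.valuation (x ^ a * y ^ b) ≠ O.valuation (z ^ p)) :
    O.valuation x ≠ 1 := by
  intro h1
  exact hP 1 0 hp.one_lt hp.pos (Or.inl one_ne_zero) 1 one_ne_zero
    (by rw [pow_one, pow_zero, mul_one, one_pow, map_one, h1])

/-- (P2) normalised: replacing `x` by `x` or `x⁻¹` one may assume `v x < 1` (i.e. `x ∈ 𝔪_O`). [folklore] -/
theorem exists_pRankTwo_lt_one_left {K : Type} [Field K] {p : ℕ} (hp : p.Prime) (O : ValuationSubring K) {x y : K}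
    (hx : x ≠ 0)
    (hP : ∀ a b : ℕ, a < p → b < p → (a ≠ 0 ∨ b ≠ 0) → ∀ z : K, z ≠ 0 → O.valuation (x ^ a * y ^ b) ≠ O.valuation (z ^ p)) :
    ∃ x' : K, x' ≠ 0 ∧ O.valuation x' < 1 ∧
      ∀ a b : ℕ, a < p → b < p → (a ≠ 0 ∨ b ≠ 0) → ∀ z : K, z ≠ 0 →
        O.valuation (x' ^ a * y ^ b) ≠ O.valuation (z ^ p) := by
  rcases O.mem_or_inv_mem x with h | h
  · exact ⟨x, hx, lt_of_le_of_ne ((O.valuation_le_one_iff x).mpr h) (valuation_ne_one_of_pRankTwo hp O hP), hP⟩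
  · have hP' := pRankTwo_inv_left O hx hP
    exact ⟨x⁻¹, inv_ne_zero hx, lt_of_le_of_ne ((O.valuation_le_one_iff x⁻¹).mpr h)
      (valuation_ne_one_of_pRankTwo hp O hP'), hP'⟩

/-- `dim A = 3` from the stub's `dim A ≤ 3` and `dim (locAtCentre A O) = 3` (a localisation does not raise the dimension;
copied from `Lens5_TwistModel.ringKrullDim_eq_three_of_locAtCentre`, with proof). [folklore] -/
theorem ringKrullDim_eq_three_of_locAtCentre {k K : Type} [Field k] [Field K] [Algebra k K] (O : ValuationSubring K)
    (A : Subalgebra k K) (hAO : A.toSubring ≤ O.toSubring)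
    (hle : ringKrullDim A ≤ 3) (h3 : ringKrullDim (locAtCentre A.toSubring O) = 3) : ringKrullDim A = 3 := by
  haveI := isLocalization_locAtCentre hAO
  refine le_antisymm hle ?_
  rw [← h3]
  exact Literature.RingTheory.KrullDimension.ringKrullDim_le_of_isLocalization
    (subringCentre A.toSubring O hAO).primeCompl (locAtCentre A.toSubring O)

/-- **`[K : K^p] = p³`** for the stub's data over a perfect `k` (census ✓ `pDegreeThreeOfPerfect`, proof adapted to the binders
`hdimA`/`hdim3`: tree `finrank_frobenius_eq_pow_of_trdeg_eq` (Matsumura Thm 26.5) with `trdeg_k K = trdeg_k A = dim A = 3`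
(`exists_ringKrullDim_eq_and_trdeg_eq`, Thm 5.6)). [cite: Matsumura1987, Thm. 26.5 and Thm. 5.6] -/
theorem finrank_frobenius_eq_of_stubData (p : ℕ) [Fact p.Prime] {k : Type} [Field k] [CharP k p] [PerfectField k]
    {K : Type} [Field K] [Algebra k K] [CharP K p] (O : ValuationSubring K) (A : Subalgebra k K)
    (hAO : A.toSubring ≤ O.toSubring) (hAfg : A.FG) [IsFractionRing A K] (hdimA : ringKrullDim A ≤ 3)
    (hdim3 : ringKrullDim (locAtCentre A.toSubring O) = 3) :
    Module.finrank (frobenius K p).fieldRange K = p ^ 3 := by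
  have hdim := ringKrullDim_eq_three_of_locAtCentre O A hAO hdimA hdim3
  haveI : Algebra.FiniteType k A := A.fg_iff_finiteType.mp hAfg
  haveI : Algebra.EssFiniteType A K := Algebra.EssFiniteType.of_isLocalization K (nonZeroDivisors A)
  haveI : Algebra.EssFiniteType k K := Algebra.EssFiniteType.comp k A K
  obtain ⟨s, hs, htr⟩ := Literature.RingTheory.KrullDimension.exists_ringKrullDim_eq_and_trdeg_eq k A
  have hs3 : s = 3 := by
    rw [hs] at hdim
    exact_mod_cast hdim
  haveI : FaithfulSMul k A := (faithfulSMul_iff_algebraMap_injective k A).mpr (algebraMap k A).injective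
  haveI : FaithfulSMul A K := (faithfulSMul_iff_algebraMap_injective A K).mpr (IsFractionRing.injective A K)
  haveI : Algebra.IsAlgebraic A K := IsLocalization.isAlgebraic K (nonZeroDivisors A)
  have htrK : Algebra.trdeg k K = (3 : ℕ) := by
    rw [← trdeg_add_eq k A (A := K), trdeg_eq_zero (R := A) (A := K), add_zero, htr, hs3]
  exact Literature.FieldTheory.Separability.finrank_frobenius_eq_pow_of_trdeg_eq p htrK

/-- **PORT 1 (§1 of the memo: graded data).  Size S — PROVED in rev 3 (g10), axioms {propext, Classical.choice, Quot.sound}.**  From `hdefect` the subfield `M = K^p(g₀)` has `p`-th-power values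
(✓ `Theorems/…Lens5ImmediateValuesMain.exists_subfield_immediate_values`, verbatim the first four conjuncts); `x, y` of (P2) normalised into
positive value (`O.mem_or_inv_mem` + census ✓ `pRankTwo_inv_left`; `v x ≠ 1` by (P2) with `(a,b) = (1,0)`, `z = 1`); generators `t` of `A`
(`hAfg`); `[K : M] = p²` (census ✓ `pDegreeThreeOfPerfect` — tree `finrank_frobenius_eq_pow_of_trdeg_eq` with `trdeg_k K = 3` from
`hdimA`/`hdim3`/`hAfg` — + ✓ `…Lens5ImmediateValuesDegree.finrank_over_adjoin_pthPowers_eq`; the two descriptions of `M` agree by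
`Subfield.ext` on the membership characterisation); coefficients `cf a ab ∈ M` by ✓ `exists_repr_of_linearIndependent_card_eq` +
✓ `…Lens5GradedBasis.monomials_linearIndependent`; each graded piece of `a ∈ t ⊆ A ⊆ O` lies in `O` by ✓ `valuation_term_le_sum`. -/
theorem port_gradedData (p : ℕ) [Fact p.Prime] {k : Type} [Field k] [CharP k p] [PerfectField k]
    {K : Type} [Field K] [Algebra k K] (O : ValuationSubring K) (A : Subalgebra k K)
    (hAO : A.toSubring ≤ O.toSubring) (hAfg : A.FG) [IsFractionRing A K] (hdimA : ringKrullDim A ≤ 3)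
    (hdim3 : ringKrullDim (locAtCentre A.toSubring O) = 3)
    (g₀ : K) (hg₀ : ∀ c : K, c ^ p ≠ g₀)
    (hdefect : ∀ f₀ : K, ∃ f₁ : K, O.valuation (g₀ - f₁ ^ p) < O.valuation (g₀ - f₀ ^ p))
    (hP2 : PRankTwoAt p O) :
    ∃ (M : Subfield K), (∀ x : K, x ∈ M ↔ ∃ c : Fin p → K, ∑ j, c j ^ p * g₀ ^ (j : ℕ) = x) ∧ g₀ ∈ M ∧
      (∀ x : K, x ^ p ∈ M) ∧ (∀ m : K, m ∈ M → m ≠ 0 → ∃ w : K, w ≠ 0 ∧ O.valuation m = O.valuation (w ^ p)) ∧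
      ∃ (x y : K), x ≠ 0 ∧ y ≠ 0 ∧ O.valuation x < 1 ∧ O.valuation y < 1 ∧
        (∀ a b : ℕ, a < p → b < p → (a ≠ 0 ∨ b ≠ 0) → ∀ z : K, z ≠ 0 →
          O.valuation (x ^ a * y ^ b) ≠ O.valuation (z ^ p)) ∧
        ∃ (t : Finset K), Algebra.adjoin k (t : Set K) = A ∧
          ∃ (cf : K → Fin p × Fin p → K), (∀ a ∈ t, ∀ ab, cf a ab ∈ M) ∧
            (∀ a ∈ t, ∑ ab : Fin p × Fin p, cf a ab * (x ^ (ab.1 : ℕ) * y ^ (ab.2 : ℕ)) = a) ∧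
            (∀ a ∈ t, ∀ ab, cf a ab * (x ^ (ab.1 : ℕ) * y ^ (ab.2 : ℕ)) ∈ O) := by
  classical
  have hp : p.Prime := Fact.out
  haveI : CharP K p := charP_of_injective_algebraMap (algebraMap k K).injective p
  -- `M = K^p(g₀)` with its `p`-th-power values (✓ ImmediateValues) and `[K : M] = p²` (✓ Degree + the p-degree above)
  obtain ⟨M, hM, hg₀M, hpM, hV⟩ := exists_subfield_immediate_values (p := p) O.valuation g₀ hdefect
  have hdeg := finrank_frobenius_eq_of_stubData p O A hAO hAfg hdimA hdim3
  obtain ⟨M', hM', hfin'⟩ := exists_subfield_pthPowers_adjoin_finrank (p := p) g₀ hg₀ hdeg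
  have hMM : M' = M := Subfield.ext fun x => (hM' x).trans (hM x).symm
  have hfin : Module.finrank M K = p ^ 2 := by subst hMM; exact hfin'
  -- (P2), normalised into the maximal ideal of `O`
  obtain ⟨x₀, y₀, hx₀, hy₀, hP₀⟩ := hP2
  obtain ⟨x, hx, hvx, hPx⟩ := exists_pRankTwo_lt_one_left hp O hx₀ hP₀
  obtain ⟨y, hy, hvy, hPy⟩ := exists_pRankTwo_lt_one_left hp O hy₀ (pRankTwo_swap O hPx)
  have hP := pRankTwo_swap O hPy
  -- generators of `A` and the graded representation over `M` (✓ GradedBasis)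
  obtain ⟨t, ht⟩ := hAfg
  have hli := monomials_linearIndependent hp O.valuation M hV hx hy hP
  have hcard : Fintype.card (Fin p × Fin p) = p ^ 2 := by
    simp [Fintype.card_prod, Fintype.card_fin, pow_two]
  have hrepr : ∀ a : K, ∃ c : Fin p × Fin p → M, ∑ ab, (c ab : K) * (x ^ (ab.1 : ℕ) * y ^ (ab.2 : ℕ)) = a := by
    intro a
    obtain ⟨c, hc⟩ := exists_repr_of_linearIndependent_card_eq M hfin (pow_pos hp.pos 2) _ hli hcard a
    refine ⟨c, ?_⟩
    simpa only [Subfield.smul_def, smul_eq_mul] using hc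
  choose c hc using hrepr
  refine ⟨M, hM, hg₀M, hpM, hV, x, y, hx, hy, hvx, hvy, hP, t, ht, fun a ab => (c a ab : K),
    fun a _ ab => (c a ab).2, fun a _ => hc a, ?_⟩
  intro a ha ab
  have haA : a ∈ A := by
    rw [← ht]
    exact Algebra.subset_adjoin (Finset.mem_coe.mpr ha)
  have haO : a ∈ O := show a ∈ O.toSubring from hAO haA
  have hva : O.valuation a ≤ 1 := (O.valuation_le_one_iff a).mpr haO
  have hterm := valuation_term_le_sum hp O.valuation M hV hx hy hP (fun ab => (c a ab : K)) (fun ab => (c a ab).2) ab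
  rw [hc a] at hterm
  exact (O.valuation_le_one_iff _).mp (hterm.trans hva)

/-! ### (rev 5) helper for PORT 2 — units of a subring of `O` have value `1` -/

/-- A unit of a subring `R₂ ⊆ O` of `K` has `v`-value `1`. [folklore] -/
theorem valuation_eq_one_of_isUnit_of_le {K : Type} [Field K] {R₂ : Subring K} (O : ValuationSubring K)
    (h : R₂ ≤ O.toSubring) {x : R₂} (hx : IsUnit x) : O.valuation (x : K) = 1 := by
  obtain ⟨y, hy⟩ := hx.exists_right_inv
  have hxO : O.valuation (x : K) ≤ 1 := (O.valuation_le_one_iff _).mpr (h x.2)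
  have hyO : O.valuation (y : K) ≤ 1 := (O.valuation_le_one_iff _).mpr (h y.2)
  have hxy : O.valuation (x : K) * O.valuation (y : K) = 1 := by
    rw [← map_mul, ← Subring.coe_mul, hy, Subring.coe_one, map_one]
  refine le_antisymm hxO ?_
  calc (1 : _) = O.valuation (x : K) * O.valuation (y : K) := hxy.symm
    _ ≤ O.valuation (x : K) * 1 := by gcongr
    _ = O.valuation (x : K) := mul_one _

/-- **Closed centre and dimension `3` for a model containing `p`-th powers of the generators.**  If the centre of `O` is closed on
every subring `T ⊆ O` containing `A = k[t]` (hzd), `dim A = 3`, and `A₂ ⊆ O` is a finitely generated `k`-subalgebra containing `a^p` for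
every `a ∈ t` (`p > 0`), then the centre of `O` on `A₂` is maximal, `dim A₂ = 3` and `dim (locAtCentre A₂ O) = 3`
(`A₂[t] ⊇ A` is integral over `A₂`: maximality and dimension descend; then ✓ `ringKrullDim_locAtCentre_eq_of_isMaximal`). [folklore] -/
theorem centre_closed_and_dim_three_of_pow_mem {k : Type} [Field k] {K : Type} [Field K] [Algebra k K] {p : ℕ} (hp : 0 < p)
    (O : ValuationSubring K) (A : Subalgebra k K) (hAO : A.toSubring ≤ O.toSubring) (hAfg : A.FG) [IsFractionRing A K]
    (hdimA : ringKrullDim A = 3) (t : Finset K) (ht : Algebra.adjoin k (t : Set K) = A)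
    (hzd : ∀ (T : Subring K) (hT : T ≤ O.toSubring), A.toSubring ≤ T → (subringCentre T O hT).IsMaximal)
    (A₂ : Subalgebra k K) (hA₂O : A₂.toSubring ≤ O.toSubring) (hA₂fg : A₂.FG) (hAp : ∀ a ∈ (t : Set K), a ^ p ∈ A₂) :
    (subringCentre A₂.toSubring O hA₂O).IsMaximal ∧ ringKrullDim A₂ = 3 ∧ ringKrullDim (locAtCentre A₂.toSubring O) = 3 := by
  classical
  have hk : ∀ c : k, algebraMap k K c ∈ O := fun c => hAO (A.algebraMap_mem c)
  have htA : ∀ a ∈ (t : Set K), a ∈ A := fun a ha => by rw [← ht]; exact Algebra.subset_adjoin ha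
  let C : Subalgebra k K := Algebra.adjoin k ((A₂ : Set K) ∪ ↑t)
  have hCfg : C.FG := fg_adjoin_subalgebra_union A₂ hA₂fg t
  have hA₂C : A₂ ≤ C := fun x hx => Algebra.subset_adjoin (Or.inl hx)
  have hAC : A ≤ C := by
    intro x hx
    rw [← ht] at hx
    exact Algebra.adjoin_mono Set.subset_union_right hx
  have hCO : C.toSubring ≤ O.toSubring := by
    intro x hx
    rw [Subalgebra.mem_toSubring] at hx
    change x ∈ O
    induction hx using Algebra.adjoin_induction with
    | mem x hx =>
        rcases hx with hx | hx
        · exact hA₂O hx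
        · exact hAO (htA x hx)
    | algebraMap r => exact hk r
    | add x y _ _ hx hy => exact O.add_mem _ _ hx hy
    | mul x y _ _ hx hy => exact O.mul_mem _ _ hx hy
  have hmaxC : (subringCentre C.toSubring O hCO).IsMaximal := hzd C.toSubring hCO (fun x hx => hAC hx)
  letI algAC : Algebra A₂ C := (Subalgebra.inclusion hA₂C).toRingHom.toAlgebra
  haveI hintAC : Algebra.IsIntegral A₂ C := by
    constructor
    intro x
    let gC : C →ₐ[A₂] K :=
      { toRingHom := C.val.toRingHom
        commutes' := fun b => rfl }
    have hgC : Function.Injective gC := Subtype.val_injective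
    rw [← isIntegral_algHom_iff gC hgC]
    change IsIntegral A₂ (x : K)
    have hCle : C ≤ (integralClosure A₂ K).restrictScalars k := by
      apply Algebra.adjoin_le
      rintro a (ha | ha)
      · change IsIntegral A₂ a
        exact isIntegral_algebraMap (R := A₂) (x := ⟨a, ha⟩)
      · change IsIntegral A₂ a
        apply IsIntegral.of_pow hp
        exact isIntegral_algebraMap (R := A₂) (x := ⟨a ^ p, hAp a ha⟩)
    exact hCle x.2
  have hmaxA₂ : (subringCentre A₂.toSubring O hA₂O).IsMaximal := by
    have h1 : ((subringCentre C.toSubring O hCO).comap (algebraMap A₂ C)).IsMaximal :=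
      Ideal.isMaximal_comap_of_isIntegral_of_isMaximal _
    have h2 : (subringCentre C.toSubring O hCO).comap (algebraMap A₂ C) = subringCentre A₂.toSubring O hA₂O := by
      ext a
      rw [Ideal.mem_comap, mem_subringCentre_iff, mem_subringCentre_iff]
      rfl
    rw [← h2]
    exact h1
  have hdimA₂ : ringKrullDim A₂ = 3 := by
    have h1 := Literature.RingTheory.KrullDimension.ringKrullDim_eq_of_isIntegral (R := A₂) (S := C)
      (Subalgebra.inclusion_injective hA₂C)
    rw [h1, Summit.ResolutionOfSingularities.ResolutionOfSingularities.Theorems.RadicialJung.CleanModels.ringKrullDim_eq_of_fg_of_le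
      hAfg hCfg hAC, hdimA]
  refine ⟨hmaxA₂, hdimA₂, ?_⟩
  rw [Summit.ResolutionOfSingularities.ResolutionOfSingularities.Theorems.RadicialJung.CleanModels.ringKrullDim_locAtCentre_eq_of_isMaximal
    A₂ hA₂fg O hA₂O hmaxA₂, hdimA₂]

set_option maxHeartbeats 800000 in
/-- **PORT 2 (§2 of the memo: the monomialising model of the twist field, `K`-side, `d = 3` pinned).  Size M.  PROVED (rev 5).**
Recipe: `S := t^p ∪ {g₁}` with `Algebra.adjoin k t = A` (`hAfg`) and `g₁ ∈ {g₀, g₀⁻¹} ∩ O` (✓ `TwistModel.mem_or_inv_mem_valuationSubring`);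
✓ `TwistModel.exists_twist_model` (F-02 = `hLU`; `dim A = 3` by ✓ `ringKrullDim_eq_three_of_locAtCentre`) gives the M-side regular model
`R = locAtCentre A'.toSubring (O ∩ k(S))` with every F-32 side condition; `k(S) = M` as subfields for perfect `k`
(✓ `adjoin_twist_toSubfield_eq_of_perfectField` + `subfield_closure_union_inv_eq` + the characterisation `hM`), so each `f ∈ F ⊆ M = Frac k[S]`
is `c_f / d_f`, `c_f, d_f ∈ k[S] ⊆ R`, non-zero; `xR := g · ∏_f c_f d_f` with any `0 ≠ g ∈ 𝔪_R` (`dim R = 3`); ✓ `monomialise_on_twist_model`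
(F-32 = `hEmb`, instances `letI := ((algebraMap ↥M K).comp R.subtype).toAlgebra`, `IsScalarTower.of_algebraMap_eq fun _ => rfl`) returns
`R'`, `uu`, `z : Fin d → R'` with `xR = u ∏ zᵢ^{αᵢ}`.  RE-MODEL: `A₂ :=` the image in `K` of `A' ⊔ k[uu]` (`Subalgebra.map`); by F-32's
domination and `τ/σ` clauses `range (algebraMap R' K) = locAtCentre A₂.toSubring O`, so regularity and `z` transport along the ring
isomorphism `R' ≃ locAtCentre A₂ O`; `dim (locAtCentre A₂ O) = 3` by the pattern of ✓ `locAtCentre_port_inputs` (centre maximal by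
✓ `centreIdeal_isMaximal_of_pow_generators` — `A₂[t] ⊇ A` is integral over `A₂` as `t^p ⊆ A₂` —, `dim A₂ = 3` by ✓ `ringKrullDim_eq_of_adjoin_le`),
hence `d = 3` (`ringKrullDim R' = d`).  Each factor `c_f`, `d_f` of `u ∏ zᵢ^{αᵢ}` is a unit times a monomial (tree ✓
`exists_eq_units_mul_prod_pow_of_dvd`, primes by `IsRsopPart.prime`), so `f = c_f/d_f` is a unit times a LAURENT monomial.
`∀ a ∈ A, a^p ∈ A₂`: ✓ `pow_mem_adjoin_image_pow`.  `locAtCentre A₂ O ⊆ M`: `A₂ ⊆ k(S) = M` and `M` is a field. -/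
theorem port_monomialModel (p : ℕ) [Fact p.Prime] {k : Type} [Field k] [CharP k p] [PerfectField k]
    {K : Type} [Field K] [Algebra k K] (hLU : LocalUniformization3 k)
    (hEmb : ∀ (Z : Scheme.{0}) [IsIntegral Z] [IsNoetherian Z], Scheme.IsRegular Z →
      Scheme.IsExcellent Z → ∀ (X : Set Z), IsClosed X → X ≠ Set.univ → topologicalKrullDim X ≤ 2 →
        ∃ (Z' : Scheme.{0}) (π : Z' ⟶ Z), IsProper π ∧ Function.Surjective π.base ∧
          (∃ U : Z.Opens, (U : Set Z) = Xᶜ ∧ IsIso (π ∣_ U)) ∧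
          IsStrictNormalCrossingsDivisor Z' (π.base ⁻¹' X))
    (O : ValuationSubring K) (A : Subalgebra k K)
    (hAO : A.toSubring ≤ O.toSubring) (hAfg : A.FG) [IsFractionRing A K] (hdimA : ringKrullDim A ≤ 3)
    (hdim3 : ringKrullDim (locAtCentre A.toSubring O) = 3)
    (hzd : ∀ (T : Subring K) (hT : T ≤ O.toSubring), A.toSubring ≤ T → (subringCentre T O hT).IsMaximal)
    (g₀ : K) (M : Subfield K) (hM : ∀ x : K, x ∈ M ↔ ∃ c : Fin p → K, ∑ j, c j ^ p * g₀ ^ (j : ℕ) = x)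
    (F : Finset K) (hFM : ∀ f ∈ F, f ∈ M) (hF0 : ∀ f ∈ F, f ≠ 0) :
    ∃ (A₂ : Subalgebra k K) (hA₂O : A₂.toSubring ≤ O.toSubring), A₂.FG ∧ (∀ a ∈ A, a ^ p ∈ A₂) ∧
      (∀ r : K, r ∈ locAtCentre A₂.toSubring O → r ∈ M) ∧
      ∃ (_ : IsRegularLocalRing (locAtCentre A₂.toSubring O)) (z : Fin 3 → locAtCentre A₂.toSubring O),
        Ideal.span (Set.range z) = IsLocalRing.maximalIdeal (locAtCentre A₂.toSubring O) ∧
        ringKrullDim (locAtCentre A₂.toSubring O) = 3 ∧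
        ∀ f ∈ F, ∃ (ε : K) (e : Fin 3 → ℤ), ε ∈ locAtCentre A₂.toSubring O ∧ O.valuation ε = 1 ∧
          f = ε * ∏ i, ((z i : K)) ^ (e i) := by
  /- (rev 5, res-B-lens-5 g10) PORT 2 PROVED — the docstring's recipe, with two remarks: (i) F-32 is invoked directly
     (✓ `exists_localRing_monomial_of_embeddedResolution`, `R ⊆ k(S) ⊆ K` with `IsScalarTower.of_algebraMap_eq fun _ => rfl`) on
     `xR = g · ∏_f c_f d_f`; every `c_f`, `d_f` then divides the monomial `u₂ ∏ z₂^α` in the re-modelled `R₂ = locAtCentre A₂ O`, so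
     ✓ `exists_eq_units_mul_prod_pow_of_dvd` factors it; (ii) the `d = 3` pinning (closed centre on `A₂ ⊇ t^p`, `dim A₂ = dim A = 3`,
     ✓ `ringKrullDim_locAtCentre_eq_of_isMaximal`) is the separate lemma ✓ `centre_closed_and_dim_three_of_pow_mem` — kept out of
     the main context on purpose (inlined, the kernel re-check of this block does not terminate in budget). -/
  classical
  haveI : CharP K p := charP_of_injective_algebraMap (algebraMap k K).injective p
  have hp : p.Prime := Fact.out
  have hAfg₀ := hAfg
  obtain ⟨t, ht⟩ := hAfg₀
  have hdimAeq : ringKrullDim A = 3 := ringKrullDim_eq_three_of_locAtCentre O A hAO hdimA hdim3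
  have hk : ∀ c : k, algebraMap k K c ∈ O := fun c => hAO (A.algebraMap_mem c)
  -- the `k`-subalgebra `O` (for `Algebra.adjoin_le` arguments)
  let Ok : Subalgebra k K := { O.toSubring with algebraMap_mem' := hk }
  have hOk : ∀ x : K, x ∈ Ok ↔ x ∈ O := fun _ => Iff.rfl
  obtain ⟨g₁, hg₁O, hg₁⟩ := TwistModel.mem_or_inv_mem_valuationSubring O g₀
  -- ## the twist field `k(S)`, `S = t^p ∪ {g₁}`, and its regular model (F-02 via ✓ `TwistModel.exists_twist_model`)
  set S : Set K := (fun x : K => x ^ p) '' (t : Set K) ∪ {g₁} with hSdef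
  obtain ⟨A', hA'O', hSA', hA'fg, hreg', hexc, hdim', hRO, hRm⟩ :=
    TwistModel.exists_twist_model p hLU O A hAO hAfg hdimAeq t ht hzd g₁ hg₁O S hSdef
  set R : Subring (IntermediateField.adjoin k S) :=
    locAtCentre A'.toSubring (O.comap (algebraMap (IntermediateField.adjoin k S) K)) with hRdef
  haveI : IsRegularLocalRing R := hreg'
  haveI : IsScalarTower R (IntermediateField.adjoin k S) K := IsScalarTower.of_algebraMap_eq (fun _ => rfl)
  have halgR : ∀ r : R, algebraMap R K r = ((r : IntermediateField.adjoin k S) : K) := fun _ => rfl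
  -- ## `k(S)` has underlying subfield `M = K^p(g₀)` (perfect `k`)
  have hM'sub : (IntermediateField.adjoin k S).toSubfield = Subfield.closure (Set.range (frobenius K p) ∪ {g₀}) := by
    rw [hSdef, TwistModel.adjoin_twist_toSubfield_eq_of_perfectField p A (t : Set K) ht g₁]
    rcases hg₁ with h | h
    · rw [h]
    · rw [h, TwistModel.subfield_closure_union_inv_eq]
  have hM'M : ∀ x : K, x ∈ IntermediateField.adjoin k S ↔ x ∈ M := by
    intro x
    rw [← IntermediateField.mem_toSubfield, hM'sub]
    constructor
    · intro hx
      refine (Subfield.closure_le (t := M)).mpr ?_ hx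
      rintro y (⟨c, rfl⟩ | hy)
      · refine (hM _).mpr ⟨fun j => if (j : ℕ) = 0 then c else 0, ?_⟩
        rw [Finset.sum_eq_single (⟨0, hp.pos⟩ : Fin p)]
        · simp [frobenius_def]
        · intro j _ hj
          have hj' : (j : ℕ) ≠ 0 := fun h => hj (Fin.ext h)
          simp [hj', hp.ne_zero]
        · intro h; exact absurd (Finset.mem_univ _) h
      · rw [Set.mem_singleton_iff.mp hy]
        refine (hM _).mpr ⟨fun j => if (j : ℕ) = 1 then 1 else 0, ?_⟩
        rw [Finset.sum_eq_single (⟨1, hp.one_lt⟩ : Fin p)]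
        · simp
        · intro j _ hj
          have hj' : (j : ℕ) ≠ 1 := fun h => hj (Fin.ext h)
          simp [hj', hp.ne_zero]
        · intro h; exact absurd (Finset.mem_univ _) h
    · intro hx
      obtain ⟨c, rfl⟩ := (hM x).mp hx
      have hg₀c : g₀ ∈ Subfield.closure (Set.range (frobenius K p) ∪ {g₀}) := Subfield.subset_closure (Or.inr rfl)
      refine sum_mem fun j _ => mul_mem ?_ (pow_mem hg₀c _)
      exact Subfield.subset_closure (Or.inl ⟨c j, frobenius_def _ _⟩)
  -- ## every `f ∈ F` is a quotient of two non-zero elements of `k[S]`, which lift to `R`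
  have hFfrac : ∀ f ∈ F, ∃ c d : K, c ∈ Algebra.adjoin k S ∧ d ∈ Algebra.adjoin k S ∧ c ≠ 0 ∧ d ≠ 0 ∧ f = c / d := by
    intro f hf
    have hfM' : f ∈ IntermediateField.adjoin k S := (hM'M f).mpr (hFM f hf)
    obtain ⟨c, hc, d, hd, hcd⟩ := IntermediateField.mem_adjoin_iff_div.mp hfM'
    have hd0 : d ≠ 0 := by
      rintro rfl
      rw [div_zero] at hcd
      exact hF0 f hf hcd
    have hc0 : c ≠ 0 := by
      rintro rfl
      rw [zero_div] at hcd
      exact hF0 f hf hcd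
    exact ⟨c, d, hc, hd, hc0, hd0, hcd⟩
  choose! cF dF hcF hdF hcF0 hdF0 hFeq using hFfrac
  have hpre : ∀ c : K, c ∈ Algebra.adjoin k S → ∃ r : R, algebraMap R K r = c := by
    intro c hc
    have hcM' : c ∈ IntermediateField.adjoin k S := IntermediateField.algebra_adjoin_le_adjoin k S hc
    have h1 : (⟨c, hcM'⟩ : IntermediateField.adjoin k S) ∈ A' :=
      hSA' ((TwistModel.mem_adjoin_preimage_iff S ⟨c, hcM'⟩).mpr hc)
    exact ⟨⟨⟨c, hcM'⟩, le_locAtCentre A'.toSubring _ h1⟩, rfl⟩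
  have hcpre : ∀ f ∈ F, ∃ r : R, algebraMap R K r = cF f := fun f hf => hpre _ (hcF f hf)
  have hdpre : ∀ f ∈ F, ∃ r : R, algebraMap R K r = dF f := fun f hf => hpre _ (hdF f hf)
  choose! rc hrc using hcpre
  choose! rd hrd using hdpre
  -- ## the element to monomialise: `xR = g · ∏_f c_f d_f`, `0 ≠ g ∈ 𝔪_R`
  have hmne : maximalIdeal R ≠ ⊥ := by
    intro h
    have hf : IsField R := (IsLocalRing.isField_iff_maximalIdeal_eq).mpr h
    have h0 := ringKrullDim_eq_zero_of_isField hf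
    rw [hdim'] at h0
    norm_num at h0
  obtain ⟨g, hgm, hg0⟩ := Submodule.exists_mem_ne_zero_of_ne_bot hmne
  set xR : R := g * ∏ f ∈ F, (rc f * rd f) with hxRdef
  have hxR0 : xR ≠ 0 := by
    refine mul_ne_zero hg0 (Finset.prod_ne_zero_iff.mpr fun f hf => mul_ne_zero ?_ ?_)
    · intro h
      exact hcF0 f hf (by rw [← hrc f hf, h, map_zero])
    · intro h
      exact hdF0 f hf (by rw [← hrd f hf, h, map_zero])
  have hxRm : xR ∈ maximalIdeal R := Ideal.mul_mem_right _ _ hgm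
  -- ## F-32 on the M-side model (✓ pattern of `TwistModel.monomialise_on_twist_model`)
  have hRO' : ∀ r : R, algebraMap R K r ∈ O := fun r => hRO r
  have hRm' : ∀ r : R, r ∈ maximalIdeal R ↔ O.valuation (algebraMap R K r) < 1 := fun r => hRm r
  obtain ⟨uu, huuM', huuO, R', _, _, _, hinj, hR'O, hR'm, hlow, hup, d, z, α, u, hu, hdimR', hspan, hfact⟩ :=
    exists_localRing_monomial_of_embeddedResolution hEmb (R := R) (K := IntermediateField.adjoin k S) (E := K)
      Subtype.val_injective hexc hdim' O
      hRO' hRm' xR hxR0 hxRm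
  -- ## RE-MODEL on the `K`-side: `T = R[uu]`, `B = A'` read in `K`, `A₂ = k[B ∪ uu]`, `locAtCentre T O = locAtCentre A₂ O`
  let T : Subring K := (Algebra.adjoin R (uu : Set K)).toSubring
  have hTO : T ≤ O.toSubring := fun w hw => huuO w hw
  have hTR : ∀ w ∈ T, w ∈ Set.range (algebraMap R' K) := fun w hw => hlow w hw
  have hRT : ∀ r : R, algebraMap R K r ∈ T := fun r => (Algebra.adjoin R (uu : Set K)).algebraMap_mem r
  have huuO' : ∀ w ∈ (uu : Set K), w ∈ O := fun w hw => huuO w (Algebra.subset_adjoin hw)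
  set φ : IntermediateField.adjoin k S →ₐ[k] K := IsScalarTower.toAlgHom k (IntermediateField.adjoin k S) K with hφdef
  have hφ : ∀ y : IntermediateField.adjoin k S, φ y = (y : K) := fun _ => rfl
  set B : Subalgebra k K := A'.map φ with hBdef
  have hBfg : B.FG := hA'fg.map φ
  have hBO : ∀ x ∈ (B : Set K), x ∈ O := by
    intro x hx
    obtain ⟨y, hy, rfl⟩ := Subalgebra.mem_map.mp hx
    exact ValuationSubring.mem_comap.mp (hA'O' hy)
  set A₂ : Subalgebra k K := Algebra.adjoin k ((B : Set K) ∪ ↑uu) with hA₂def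
  have hA₂fg : A₂.FG := fg_adjoin_subalgebra_union B hBfg uu
  have hBA₂ : B ≤ A₂ := fun x hx => Algebra.subset_adjoin (Or.inl hx)
  have huuA₂ : ∀ w ∈ (uu : Set K), w ∈ A₂ := fun w hw => Algebra.subset_adjoin (Or.inr hw)
  have hA₂Ok : A₂ ≤ Ok := Algebra.adjoin_le (Set.union_subset hBO huuO')
  have hA₂O : A₂.toSubring ≤ O.toSubring := fun x hx => hA₂Ok hx
  -- values in `O ∩ k(S)` are read in `K`
  have hval1 : ∀ y : IntermediateField.adjoin k S, y ∈ O.comap (algebraMap (IntermediateField.adjoin k S) K) →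
      ((O.comap (algebraMap (IntermediateField.adjoin k S) K)).valuation y = 1 ↔
        O.valuation (algebraMap (IntermediateField.adjoin k S) K y) = 1) := by
    intro y hy
    have hyO : algebraMap (IntermediateField.adjoin k S) K y ∈ O := ValuationSubring.mem_comap.mp hy
    have hlt := TwistModel.valuation_comap_lt_one_iff O (IntermediateField.adjoin k S) y hy
    have hle' : (O.comap (algebraMap (IntermediateField.adjoin k S) K)).valuation y ≤ 1 :=
      ((O.comap (algebraMap (IntermediateField.adjoin k S) K)).valuation_le_one_iff y).mpr hy
    have hle : O.valuation (algebraMap (IntermediateField.adjoin k S) K y) ≤ 1 := (O.valuation_le_one_iff _).mpr hyO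
    constructor
    · intro h1
      rcases hle.lt_or_eq with h | h
      · have h' := hlt.mpr h
        rw [h1] at h'
        exact absurd h' (lt_irrefl _)
      · exact h
    · intro h1
      rcases hle'.lt_or_eq with h | h
      · have h' := hlt.mp h
        rw [h1] at h'
        exact absurd h' (lt_irrefl _)
      · exact h
  have hrangeR : Set.range (algebraMap R K) = (locAtCentre B.toSubring O : Set K) := by
    ext x
    constructor
    · rintro ⟨r, rfl⟩
      obtain ⟨y, hy, w, hw, hw1, hr⟩ := (mem_locAtCentre_iff).mp r.2
      have hyB : (y : K) ∈ B := Subalgebra.mem_map.mpr ⟨y, hy, rfl⟩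
      have hwB : (w : K) ∈ B := Subalgebra.mem_map.mpr ⟨w, hw, rfl⟩
      have hw1' : O.valuation (w : K) = 1 := (hval1 w (hA'O' hw)).mp hw1
      refine (mem_locAtCentre_iff).mpr ⟨y, hyB, w, hwB, hw1', ?_⟩
      rw [halgR, hr]
      push_cast
      rfl
    · intro hx
      obtain ⟨y, hy, w, hw, hw1, rfl⟩ := (mem_locAtCentre_iff).mp hx
      obtain ⟨y', hy', rfl⟩ := Subalgebra.mem_map.mp hy
      obtain ⟨w', hw', rfl⟩ := Subalgebra.mem_map.mp hw
      have hw'1 : (O.comap (algebraMap (IntermediateField.adjoin k S) K)).valuation w' = 1 := (hval1 w' (hA'O' hw')).mpr hw1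
      refine ⟨⟨y' / w', (mem_locAtCentre_iff).mpr ⟨y', hy', w', hw', hw'1, rfl⟩⟩, ?_⟩
      rw [halgR]
      push_cast
      rfl
  have hT : T = Subring.closure ((locAtCentre B.toSubring O : Set K) ∪ ↑uu) := by
    change (Algebra.adjoin R (uu : Set K)).toSubring = _
    rw [Algebra.adjoin_eq_ring_closure, hrangeR]
  have hR₂eq : locAtCentre T O = locAtCentre A₂.toSubring O := by
    rw [hT, Summit.ResolutionOfSingularities.ResolutionOfSingularities.Theorems.PfaffLine.locAtCentre_closure_locAtCentre_union, Subalgebra.coe_toSubring, closure_subalgebra_union_eq]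
  -- regular data transported to `R₂ := locAtCentre A₂ O` along `R' ≅ range = R₂`
  set R₂ : Subring K := locAtCentre A₂.toSubring O with hR₂def
  have hrange0 : (algebraMap R' K).range = locAtCentre T O :=
    Summit.ResolutionOfSingularities.ResolutionOfSingularities.Theorems.RadicialJung.CleanModels.range_eq_locAtCentre
      (algebraMap R' K) O T hTR hR'm hup
  have hrange : (algebraMap R' K).range = R₂ := hrange0.trans hR₂eq
  obtain ⟨hreg₂, z₂, u₂, hz₂, hu₂K, hspan₂, hdim₂, hu₂⟩ :=
    Summit.ResolutionOfSingularities.ResolutionOfSingularities.Theorems.RadicialJung.CleanModels.regular_data_of_range_eq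
      (algebraMap R' K) hinj R₂ hrange z hspan hdimR' u hu
  haveI := hreg₂
  have hR₂O : R₂ ≤ O.toSubring := locAtCentre_le hA₂O
  have hTR₂ : T ≤ R₂ := le_of_le_of_eq (le_locAtCentre T O) hR₂eq
  -- ## `S ⊆ B`, hence `t^p ⊆ A₂` and `A^p ⊆ A₂`
  have hSB : ∀ s ∈ S, s ∈ B := by
    intro s hs
    have hsM' : s ∈ IntermediateField.adjoin k S := IntermediateField.subset_adjoin k S hs
    have h1 : (⟨s, hsM'⟩ : IntermediateField.adjoin k S) ∈ A' :=
      hSA' (Algebra.subset_adjoin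
        (show (⟨s, hsM'⟩ : IntermediateField.adjoin k S) ∈ (Subtype.val : IntermediateField.adjoin k S → K) ⁻¹' S from hs))
    exact Subalgebra.mem_map.mpr ⟨⟨s, hsM'⟩, h1, rfl⟩
  have hAp : ∀ a ∈ A, a ^ p ∈ A₂ := by
    intro a ha
    have ha' : a ∈ Algebra.adjoin k (t : Set K) := by rw [ht]; exact ha
    have h1 := TwistModel.pow_mem_adjoin_image_pow p (t : Set K) ha'
    refine (Algebra.adjoin_le ?_ : Algebra.adjoin k ((fun x : K => x ^ p) '' (t : Set K)) ≤ A₂) h1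
    intro s hs
    exact hBA₂ (hSB s (by rw [hSdef]; exact Or.inl hs))
  -- ## `d = 3`: ✓ `centre_closed_and_dim_three_of_pow_mem` (the centre of `O` on `A₂` is closed since `A₂[t] ⊇ A` is integral
  -- over `A₂`, and `dim A₂ = dim A = 3`), compared with `dim R₂ = d` from the regular data
  have htpA₂ : ∀ a ∈ (t : Set K), a ^ p ∈ A₂ := fun a ha => hAp a (by rw [← ht]; exact Algebra.subset_adjoin ha)
  obtain ⟨-, -, hdimR₂'⟩ :=
    centre_closed_and_dim_three_of_pow_mem hp.pos O A hAO hAfg hdimAeq t ht hzd A₂ hA₂O hA₂fg htpA₂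
  have hdimR₂ : ringKrullDim R₂ = 3 := hdimR₂'
  have hd3 : d = 3 := by
    have h := hdim₂.symm.trans hdimR₂
    exact_mod_cast h
  subst hd3
  -- ## `z₂` is a regular system of parameters; `xR = u₂ ∏ z₂^α` in `R₂`
  have hd' : (maximalIdeal R₂).spanFinrank = 3 := by
    have h := IsRegularLocalRing.spanFinrank_maximalIdeal (R := R₂)
    rw [hdim₂] at h
    exact_mod_cast h
  have hzr : IsRsopPart z₂ := isRsopPart_comp_of_rsop hd' z₂ hspan₂ id Function.injective_id
  have hz0 : ∀ i, (z₂ i : K) ≠ 0 := fun i h => hzr.ne_zero i (Subtype.ext h)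
  let ψ : R →+* R₂ := (algebraMap R K).codRestrict R₂ (fun r => hTR₂ (hRT r))
  have hψK : ∀ r : R, ((ψ r : R₂) : K) = algebraMap R K r := fun _ => rfl
  have hfact₂ : ψ xR = u₂ * ∏ i, z₂ i ^ α i := by
    apply Subtype.ext
    rw [hψK, hfact]
    push_cast
    simp only [hu₂K, hz₂]
  -- ## `locAtCentre A₂ O ⊆ M`
  let MR : Subalgebra R K :=
    { (IntermediateField.adjoin k S).toSubalgebra.toSubring with
      algebraMap_mem' := fun r : R => ((r : IntermediateField.adjoin k S)).2 }
  have huuMR : (uu : Set K) ⊆ (MR : Set K) := by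
    intro w hw
    obtain ⟨y, rfl⟩ := huuM' hw
    exact y.2
  have hTM' : ∀ x ∈ T, x ∈ IntermediateField.adjoin k S := fun x hx =>
    (Algebra.adjoin_le huuMR : Algebra.adjoin R (uu : Set K) ≤ MR) hx
  have hR₂M : ∀ r : K, r ∈ locAtCentre A₂.toSubring O → r ∈ M := by
    intro r hr
    have hr' : r ∈ locAtCentre T O := (le_of_eq hR₂eq.symm) hr
    obtain ⟨y, hy, w, hw, -, rfl⟩ := mem_locAtCentre_iff.mp hr'
    exact (hM'M _).mp (div_mem (hTM' y hy) (hTM' w hw))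
  -- ## assemble; per `f ∈ F`: `c_f`, `d_f` divide the monomial `u₂ ∏ z₂^α`, so `f = c_f / d_f` is a unit times a Laurent monomial
  refine ⟨A₂, hA₂O, hA₂fg, hAp, hR₂M, hreg₂, z₂, hspan₂, hdimR₂, ?_⟩
  intro f hf
  have hsplit_c : xR = rc f * (g * rd f * ∏ f' ∈ F.erase f, (rc f' * rd f')) := by
    rw [hxRdef, ← Finset.mul_prod_erase F (fun f' => rc f' * rd f') hf]
    ring
  have hsplit_d : xR = rd f * (g * rc f * ∏ f' ∈ F.erase f, (rc f' * rd f')) := by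
    rw [hxRdef, ← Finset.mul_prod_erase F (fun f' => rc f' * rd f') hf]
    ring
  have hdvd_c : ψ (rc f) ∣ ∏ i, z₂ i ^ α i :=
    (hu₂.dvd_mul_left).mp ⟨ψ (g * rd f * ∏ f' ∈ F.erase f, (rc f' * rd f')), by rw [← map_mul, ← hsplit_c, hfact₂]⟩
  have hdvd_d : ψ (rd f) ∣ ∏ i, z₂ i ^ α i :=
    (hu₂.dvd_mul_left).mp ⟨ψ (g * rc f * ∏ f' ∈ F.erase f, (rc f' * rd f')), by rw [← map_mul, ← hsplit_d, hfact₂]⟩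
  obtain ⟨c₁, β, hcβ⟩ := CossartPiltantMonomial.exists_eq_units_mul_prod_pow_of_dvd (fun i => hzr.prime i) α hdvd_c
  obtain ⟨c₂, γ, hdγ⟩ := CossartPiltantMonomial.exists_eq_units_mul_prod_pow_of_dvd (fun i => hzr.prime i) α hdvd_d
  have hcK : cF f = ((c₁ : R₂) : K) * ∏ i, (z₂ i : K) ^ β i := by
    have h := congrArg (fun w : R₂ => (w : K)) hcβ
    simp only [hψK, hrc f hf] at h
    rw [h]
    push_cast
    rfl
  have hdK : dF f = ((c₂ : R₂) : K) * ∏ i, (z₂ i : K) ^ γ i := by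
    have h := congrArg (fun w : R₂ => (w : K)) hdγ
    simp only [hψK, hrd f hf] at h
    rw [h]
    push_cast
    rfl
  let u' : R₂ := (c₁ * c₂⁻¹ : R₂ˣ)
  have hu' : IsUnit u' := Units.isUnit _
  let e : Fin 3 → ℤ := fun i => (β i : ℤ) - (γ i : ℤ)
  have hc₂0 : ((c₂ : R₂) : K) ≠ 0 := fun h => by
    have : ((c₂ : R₂) : K) * ((↑(c₂⁻¹ : R₂ˣ) : R₂) : K) = 1 := by
      rw [← Subring.coe_mul, ← Units.val_mul, mul_inv_cancel, Units.val_one, Subring.coe_one]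
    rw [h, zero_mul] at this
    exact zero_ne_one this
  have hu'K : (u' : K) = ((c₁ : R₂) : K) * (((c₂ : R₂) : K))⁻¹ := by
    have hinv : ((↑(c₂⁻¹ : R₂ˣ) : R₂) : K) = (((c₂ : R₂) : K))⁻¹ := by
      refine (eq_inv_of_mul_eq_one_right ?_)
      rw [← Subring.coe_mul, ← Units.val_mul, mul_inv_cancel, Units.val_one, Subring.coe_one]
    change (((c₁ * c₂⁻¹ : R₂ˣ) : R₂) : K) = _
    rw [Units.val_mul, Subring.coe_mul, hinv]
  have hprod : (∏ i, (z₂ i : K) ^ (e i)) = (∏ i, (z₂ i : K) ^ β i) / ∏ i, (z₂ i : K) ^ γ i := by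
    rw [← Finset.prod_div_distrib]
    refine Finset.prod_congr rfl fun i _ => ?_
    rw [zpow_sub₀ (hz0 i), zpow_natCast, zpow_natCast]
  refine ⟨(u' : K), e, u'.2, valuation_eq_one_of_isUnit_of_le O hR₂O hu', ?_⟩
  calc f = cF f / dF f := hFeq f hf
    _ = (u' : K) * ∏ i, (z₂ i : K) ^ (e i) := by
        rw [hcK, hdK, hu'K, hprod, mul_div_mul_comm, div_eq_mul_inv]

/-! ### (rev 6) Laurent-monomial algebra in a commutative group with zero (used in `K` and in the value group) -/

/-- `a ^ (Σ f) = ∏ a ^ f` for integer exponents, `a ≠ 0`. [folklore] -/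
theorem zpow_finsum {G₀ : Type} [CommGroupWithZero G₀] {ι : Type} [DecidableEq ι] {a : G₀} (ha : a ≠ 0)
    (s : Finset ι) (f : ι → ℤ) : a ^ (∑ i ∈ s, f i) = ∏ i ∈ s, a ^ f i := by
  induction s using Finset.induction_on with
  | empty => simp
  | insert i s hi ih => rw [Finset.sum_insert hi, Finset.prod_insert hi, zpow_add₀ ha, ih]

/-- `∏ zᵢ^{Cᵢ + Dᵢ} = ∏ zᵢ^{Cᵢ} · ∏ zᵢ^{Dᵢ}`. [folklore] -/
theorem prod_zpow_add {G₀ : Type} [CommGroupWithZero G₀] {ι : Type} [Fintype ι] {z : ι → G₀} (hz0 : ∀ i, z i ≠ 0)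
    (C D : ι → ℤ) : ∏ i, z i ^ (C i + D i) = (∏ i, z i ^ C i) * ∏ i, z i ^ D i := by
  rw [← Finset.prod_mul_distrib]
  exact Finset.prod_congr rfl fun i _ => zpow_add₀ (hz0 i) _ _

/-- `∏ zᵢ^{n·Cᵢ} = (∏ zᵢ^{Cᵢ})^n`. [folklore] -/
theorem prod_zpow_smul {G₀ : Type} [CommGroupWithZero G₀] {ι : Type} [Fintype ι] (z : ι → G₀)
    (n : ℤ) (C : ι → ℤ) : ∏ i, z i ^ (n * C i) = (∏ i, z i ^ C i) ^ n := by
  rw [← Finset.prod_zpow]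
  exact Finset.prod_congr rfl fun i _ => by rw [mul_comm, zpow_mul]

/-- `∏ᵢ zᵢ^{Σⱼ dⱼ cⱼᵢ} = ∏ⱼ (∏ᵢ zᵢ^{cⱼᵢ})^{dⱼ}`. [folklore] -/
theorem prod_zpow_lincomb {G₀ : Type} [CommGroupWithZero G₀] {ι κ : Type} [Fintype ι] [Fintype κ] [DecidableEq κ]
    {z : ι → G₀} (hz0 : ∀ i, z i ≠ 0) (d : κ → ℤ) (c : κ → ι → ℤ) :
    ∏ i, z i ^ (∑ j, d j * c j i) = ∏ j, (∏ i, z i ^ c j i) ^ d j := by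
  calc ∏ i, z i ^ (∑ j, d j * c j i) = ∏ i, ∏ j, (z i ^ c j i) ^ d j := by
        refine Finset.prod_congr rfl fun i _ => ?_
        rw [zpow_finsum (hz0 i)]
        exact Finset.prod_congr rfl fun j _ => by rw [mul_comm, zpow_mul]
    _ = ∏ j, ∏ i, (z i ^ c j i) ^ d j := Finset.prod_comm
    _ = ∏ j, (∏ i, z i ^ c j i) ^ d j := Finset.prod_congr rfl fun j _ => Finset.prod_zpow _ _ _

/-- `t ↦ t ^ p` is injective on a linearly ordered commutative group with zero (`p ≠ 0`) (census/PunchlineBits copy). [folklore] -/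
theorem pow_left_injective_of_ne_zero {Γ₀ : Type} [LinearOrderedCommGroupWithZero Γ₀] {p : ℕ} (hp : p ≠ 0)
    {a b : Γ₀} (h : a ^ p = b ^ p) : a = b := by
  rcases lt_trichotomy a b with hab | hab | hab
  · exact absurd h (ne_of_lt (pow_lt_pow_left₀ hab zero_le hp))
  · exact hab
  · exact absurd h.symm (ne_of_lt (pow_lt_pow_left₀ hab zero_le hp))

/-! ### (rev 6) PORT 3 split into three named pieces: 3-I (independence mod `p`, proved), 3-R (the multiplicative reading, proved),
3-L (the exponent-level toric chart = the ✓ lattice lemmas read through the value group; PROVED in rev 7 in `Lens5_PRankTwoLattice.lean`) -/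

/-- **PORT 3-I (§3 (IND) of the memo, integer-exponent form).**  Under (P2) for `(x, y)` (`hP`), the relations `x^p = α z^{eA}`,
`y^p = β z^{eB}` (`v α = v β = 1`) and `v(zᵢ) ∈ p·Γ` (`hzV`), the vectors `eA, eB` are independent modulo `p`: an integer relation
`p·C + a·eA + b·eB = 0` forces `p ∣ a` and `p ∣ b`.  PROVED (rev 6). [folklore] -/
theorem port_toricChart_ind (p : ℕ) [Fact p.Prime] {K : Type} [Field K] (O : ValuationSubring K) {x y : K}
    (hx : x ≠ 0) (hy : y ≠ 0)
    (hP : ∀ a b : ℕ, a < p → b < p → (a ≠ 0 ∨ b ≠ 0) → ∀ z : K, z ≠ 0 →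
      O.valuation (x ^ a * y ^ b) ≠ O.valuation (z ^ p))
    (z : Fin 3 → K) (hz0 : ∀ i, z i ≠ 0) (hzV : ∀ i, ∃ w : K, w ≠ 0 ∧ O.valuation (z i) = O.valuation (w ^ p))
    (α β : K) (hα : O.valuation α = 1) (hβ : O.valuation β = 1) (eA eB : Fin 3 → ℤ)
    (hxA : x ^ p = α * ∏ i, z i ^ eA i) (hyB : y ^ p = β * ∏ i, z i ^ eB i)
    (a b : ℤ) (C : Fin 3 → ℤ) (hrel : ∀ i, (p : ℤ) * C i + a * eA i + b * eB i = 0) :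
    (p : ℤ) ∣ a ∧ (p : ℤ) ∣ b := by
  classical
  have hp := (Fact.out : p.Prime)
  have hp0 : (p : ℤ) ≠ 0 := by exact_mod_cast hp.ne_zero
  have hpp : (0 : ℤ) < p := by exact_mod_cast hp.pos
  choose w hw0 hwv using hzV
  -- Euclidean division of `a`, `b` by `p`
  obtain ⟨a₀, ha₀⟩ : ∃ a₀ : ℕ, (a₀ : ℤ) = a % p := ⟨(a % p).toNat, Int.toNat_of_nonneg (Int.emod_nonneg a hp0)⟩
  obtain ⟨b₀, hb₀⟩ : ∃ b₀ : ℕ, (b₀ : ℤ) = b % p := ⟨(b % p).toNat, Int.toNat_of_nonneg (Int.emod_nonneg b hp0)⟩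
  have ha : a = p * (a / p) + a₀ := by rw [ha₀]; exact (Int.mul_ediv_add_emod a p).symm
  have hb : b = p * (b / p) + b₀ := by rw [hb₀]; exact (Int.mul_ediv_add_emod b p).symm
  have ha₀p : a₀ < p := by
    have h := Int.emod_lt_of_pos a hpp
    rw [← ha₀] at h
    exact_mod_cast h
  have hb₀p : b₀ < p := by
    have h := Int.emod_lt_of_pos b hpp
    rw [← hb₀] at h
    exact_mod_cast h
  by_contra hnot
  have hab : a₀ ≠ 0 ∨ b₀ ≠ 0 := by
    by_contra h
    push Not at h
    obtain ⟨h1, h2⟩ := h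
    apply hnot
    refine ⟨Int.dvd_of_emod_eq_zero ?_, Int.dvd_of_emod_eq_zero ?_⟩
    · rw [← ha₀, h1, Nat.cast_zero]
    · rw [← hb₀, h2, Nat.cast_zero]
  -- the witness `Z = (∏ wᵢ^{-Cᵢ}) · x^{-(a/p)} · y^{-(b/p)}`
  set a₁ : ℤ := a / p with ha₁
  set b₁ : ℤ := b / p with hb₁
  set Z : K := (∏ i, w i ^ (-C i)) * (x ^ (-a₁) * y ^ (-b₁)) with hZ
  have hZ0 : Z ≠ 0 :=
    mul_ne_zero (Finset.prod_ne_zero_iff.mpr fun i _ => zpow_ne_zero _ (hw0 i))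
      (mul_ne_zero (zpow_ne_zero _ hx) (zpow_ne_zero _ hy))
  refine hP a₀ b₀ ha₀p hb₀p hab Z hZ0 ?_
  -- the computation in the value group
  set V := O.valuation with hV
  have hVx : V x ≠ 0 := (Valuation.ne_zero_iff V).mpr hx
  have hVy : V y ≠ 0 := (Valuation.ne_zero_iff V).mpr hy
  have hVz : ∀ i, V (z i) ≠ 0 := fun i => (Valuation.ne_zero_iff V).mpr (hz0 i)
  have hVw : ∀ i, V (w i) ≠ 0 := fun i => (Valuation.ne_zero_iff V).mpr (hw0 i)
  -- `V x ^ p = ∏ V zᵢ ^ eAᵢ`, `V y ^ p = ∏ V zᵢ ^ eBᵢ`, `V zᵢ = V wᵢ ^ p`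
  have hXp : V x ^ p = ∏ i, V (z i) ^ eA i := by
    have h := congrArg V hxA
    rw [map_pow, map_mul, hα, one_mul, map_prod] at h
    rw [h]
    exact Finset.prod_congr rfl fun i _ => map_zpow₀ V _ _
  have hYp : V y ^ p = ∏ i, V (z i) ^ eB i := by
    have h := congrArg V hyB
    rw [map_pow, map_mul, hβ, one_mul, map_prod] at h
    rw [h]
    exact Finset.prod_congr rfl fun i _ => map_zpow₀ V _ _
  have hZW : ∀ i, V (z i) = V (w i) ^ p := fun i => by rw [hwv i, map_pow]
  -- `(V x ^ a · V y ^ b) ^ p = (∏ V zᵢ ^ (-Cᵢ)) ^ p`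
  have hN : (V x ^ a * V y ^ b) ^ p = (∏ i, V (z i) ^ (-C i)) ^ p := by
    have e1 : (V x ^ a * V y ^ b) ^ p = (V x ^ p) ^ a * (V y ^ p) ^ b := by
      rw [mul_pow, ← zpow_natCast (V x ^ a), ← zpow_natCast (V y ^ b), ← zpow_mul, ← zpow_mul,
        mul_comm a, mul_comm b, zpow_mul, zpow_mul, zpow_natCast, zpow_natCast]
    rw [e1, hXp, hYp, ← prod_zpow_smul, ← prod_zpow_smul, ← prod_zpow_add hVz, ← zpow_natCast, ← prod_zpow_smul]
    refine Finset.prod_congr rfl fun i _ => ?_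
    congr 1
    have h := hrel i
    linear_combination h
  have hN' : V x ^ a * V y ^ b = ∏ i, V (z i) ^ (-C i) := pow_left_injective_of_ne_zero hp.ne_zero hN
  -- `∏ V zᵢ ^ (-Cᵢ) = (∏ V wᵢ ^ (-Cᵢ)) ^ p`
  have hNW : ∏ i, V (z i) ^ (-C i) = (∏ i, V (w i) ^ (-C i)) ^ p := by
    rw [← Finset.prod_pow]
    refine Finset.prod_congr rfl fun i _ => ?_
    rw [hZW i, ← zpow_natCast, ← zpow_mul, ← zpow_natCast (V (w i) ^ (-C i)), ← zpow_mul, mul_comm]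
  -- atoms `T₁ = V x ^ a₁`, `T₂ = V y ^ b₁`
  have hT₁ : V x ^ a₁ ≠ 0 := zpow_ne_zero _ hVx
  have hT₂ : V y ^ b₁ ≠ 0 := zpow_ne_zero _ hVy
  have hxa : V x ^ a = (V x ^ a₁) ^ p * V x ^ a₀ := by
    rw [ha, zpow_add₀ hVx, mul_comm (p : ℤ), zpow_mul, zpow_natCast, zpow_natCast]
  have hyb : V y ^ b = (V y ^ b₁) ^ p * V y ^ b₀ := by
    rw [hb, zpow_add₀ hVy, mul_comm (p : ℤ), zpow_mul, zpow_natCast, zpow_natCast]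
  have hkey : (V x ^ a₁) ^ p * V x ^ a₀ * ((V y ^ b₁) ^ p * V y ^ b₀) = (∏ i, V (w i) ^ (-C i)) ^ p := by
    rw [← hxa, ← hyb, hN', hNW]
  -- conclude: `V (x^a₀ y^b₀) = V (Z ^ p)`
  have hVZ : V Z = (∏ i, V (w i) ^ (-C i)) * ((V x ^ a₁)⁻¹ * (V y ^ b₁)⁻¹) := by
    rw [hZ, map_mul, map_mul, map_prod, map_zpow₀, map_zpow₀, zpow_neg, zpow_neg]
    congr 1
    exact Finset.prod_congr rfl fun i _ => map_zpow₀ V _ _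
  show V (x ^ a₀ * y ^ b₀) = V (Z ^ p)
  rw [map_pow, map_mul, map_pow, map_pow, hVZ, mul_pow, mul_pow, ← hkey, inv_pow, inv_pow]
  field_simp

/-- **PORT 3-R (the multiplicative reading of a lattice identity).**  If the chart monomials are `u_j = z^{c_j} x^{a_j} y^{b_j}` and the
`p`-scaled exponent of `z^C x^{a₀} y^{b₀}` is the combination `Σ d_j ·` (exponent of `u_j`) — `p·C + a₀ eA + b₀ eB = Σ_j d_j (p c_j + a_j eA
+ b_j eB)` in `ℤ³` —, then `z^C x^{a₀} y^{b₀} = α^{ia} β^{ib} ∏ u_j^{d_j}`: the defects `Σ d_j a_j − a₀`, `Σ d_j b_j − b₀` are divisible by `p`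
by 3-I (`hind`), and `x^p z^{-eA} = α`, `y^p z^{-eB} = β`.  PROVED (rev 6). [folklore] -/
theorem port_toricChart_read (p : ℕ) [Fact p.Prime] {K : Type} [Field K] {x y : K} (hx : x ≠ 0) (hy : y ≠ 0)
    (z : Fin 3 → K) (hz0 : ∀ i, z i ≠ 0) (α β : K) (hα0 : α ≠ 0) (hβ0 : β ≠ 0) (eA eB : Fin 3 → ℤ)
    (hxA : x ^ p = α * ∏ i, z i ^ eA i) (hyB : y ^ p = β * ∏ i, z i ^ eB i)
    (hind : ∀ (a b : ℤ) (C : Fin 3 → ℤ), (∀ i, (p : ℤ) * C i + a * eA i + b * eB i = 0) → (p : ℤ) ∣ a ∧ (p : ℤ) ∣ b)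
    (c : Fin 3 → Fin 3 → ℤ) (a b : Fin 3 → ℕ) (u : Fin 3 → K)
    (hu : ∀ j, u j = (∏ i, z i ^ c j i) * (x ^ a j * y ^ b j))
    (C : Fin 3 → ℤ) (a₀ b₀ : ℕ) (d : Fin 3 → ℤ)
    (hℓ : ∀ i, (p : ℤ) * C i + (a₀ : ℤ) * eA i + (b₀ : ℤ) * eB i =
      ∑ j, d j * ((p : ℤ) * c j i + (a j : ℤ) * eA i + (b j : ℤ) * eB i)) :
    ∃ ia ib : ℤ, (∏ i, z i ^ C i) * (x ^ a₀ * y ^ b₀) = α ^ ia * β ^ ib * ∏ j, u j ^ d j := by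
  classical
  have hp := (Fact.out : p.Prime)
  have hp0 : (p : ℤ) ≠ 0 := by exact_mod_cast hp.ne_zero
  -- expand the right-hand side of `hℓ`
  have key : ∀ i, ∑ j, d j * ((p : ℤ) * c j i + (a j : ℤ) * eA i + (b j : ℤ) * eB i) =
      (p : ℤ) * (∑ j, d j * c j i) + (∑ j, d j * (a j : ℤ)) * eA i + (∑ j, d j * (b j : ℤ)) * eB i := by
    intro i
    rw [Finset.mul_sum, Finset.sum_mul, Finset.sum_mul, ← Finset.sum_add_distrib, ← Finset.sum_add_distrib]
    exact Finset.sum_congr rfl fun j _ => by ring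
  have hrel : ∀ i, (p : ℤ) * (∑ j, d j * c j i - C i) + (∑ j, d j * (a j : ℤ) - a₀) * eA i +
      (∑ j, d j * (b j : ℤ) - b₀) * eB i = 0 := by
    intro i
    have h := hℓ i
    rw [key] at h
    linear_combination -h
  obtain ⟨⟨a', ha'⟩, ⟨b', hb'⟩⟩ := hind _ _ _ hrel
  -- `Σ d_j c_j = C - a' eA - b' eB`
  have hC : ∀ i, ∑ j, d j * c j i = C i + ((-a') * eA i + (-b') * eB i) := by
    intro i
    have h := hrel i
    rw [ha', hb'] at h
    have h2 : (p : ℤ) * (∑ j, d j * c j i - C i) = (p : ℤ) * ((-a') * eA i + (-b') * eB i) := by linear_combination h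
    have h3 := mul_left_cancel₀ hp0 h2
    linear_combination h3
  have hSa : ∑ j, d j * (a j : ℤ) = (a₀ : ℤ) + (p : ℤ) * a' := by linear_combination ha'
  have hSb : ∑ j, d j * (b j : ℤ) = (b₀ : ℤ) + (p : ℤ) * b' := by linear_combination hb'
  -- nonzero atoms
  have hzA : (∏ i, z i ^ eA i) ≠ 0 := Finset.prod_ne_zero_iff.mpr fun i _ => zpow_ne_zero _ (hz0 i)
  have hzB : (∏ i, z i ^ eB i) ≠ 0 := Finset.prod_ne_zero_iff.mpr fun i _ => zpow_ne_zero _ (hz0 i)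
  -- `∏ u_j^{d_j}` expanded
  have hP1 : ∏ j, u j ^ d j =
      (∏ i, z i ^ (∑ j, d j * c j i)) * (x ^ (∑ j, d j * (a j : ℤ)) * y ^ (∑ j, d j * (b j : ℤ))) := by
    rw [prod_zpow_lincomb hz0, zpow_finsum hx, zpow_finsum hy, ← Finset.prod_mul_distrib, ← Finset.prod_mul_distrib]
    refine Finset.prod_congr rfl fun j _ => ?_
    rw [hu j, mul_zpow, mul_zpow, ← zpow_natCast x, ← zpow_natCast y, ← zpow_mul, ← zpow_mul, mul_comm (d j) (a j : ℤ),
      mul_comm (d j) (b j : ℤ)]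
  have hP2 : ∏ j, u j ^ d j = α ^ a' * β ^ b' * ((∏ i, z i ^ C i) * (x ^ a₀ * y ^ b₀)) := by
    rw [hP1]
    rw [show (fun i => z i ^ (∑ j, d j * c j i)) = fun i => z i ^ (C i + ((-a') * eA i + (-b') * eB i)) from
      funext fun i => by rw [hC i]]
    rw [prod_zpow_add hz0, prod_zpow_add hz0, prod_zpow_smul, prod_zpow_smul, hSa, hSb, zpow_add₀ hx, zpow_add₀ hy,
      zpow_natCast, zpow_natCast, zpow_mul, zpow_mul, zpow_natCast, zpow_natCast, hxA, hyB, mul_zpow, mul_zpow,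
      zpow_neg, zpow_neg]
    field_simp
  refine ⟨-a', -b', ?_⟩
  have h1 : α ^ (-a') * α ^ a' = 1 := by rw [zpow_neg]; exact inv_mul_cancel₀ (zpow_ne_zero _ hα0)
  have h2 : β ^ (-b') * β ^ b' = 1 := by rw [zpow_neg]; exact inv_mul_cancel₀ (zpow_ne_zero _ hβ0)
  rw [hP2]
  calc (∏ i, z i ^ C i) * (x ^ a₀ * y ^ b₀)
      = (α ^ (-a') * α ^ a') * (β ^ (-b') * β ^ b') * ((∏ i, z i ^ C i) * (x ^ a₀ * y ^ b₀)) := by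
        rw [h1, h2, one_mul, one_mul]
    _ = α ^ (-a') * β ^ (-b') * (α ^ a' * β ^ b' * ((∏ i, z i ^ C i) * (x ^ a₀ * y ^ b₀))) := by ring

/-- **PORT 3-L (the LATTICE half of PORT 3: the exponent-level toric chart) — PROVED (rev 7) in the companion workfile
`Cruxes/DescentPerfectToAll/Lens5_PRankTwoLattice.lean` as `CpSibling.PRankTwoLattice.port_toricChart_lattice`, SORRY-FREE, axioms
{propext, Classical.choice, Quot.sound}, with THIS statement byte-for-byte (binders and conclusion; only Mathlib + `Literature` constants occur);
the `sorry` below is a PLACEHOLDER kept because crux workfiles cannot import one another on the farm (`remote:stale:unbuilt`) and the inlined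
proof (+2 100 lines of ✓ kit carried with proofs) exceeds the workfile request limit.**  Same hypotheses as PORT 3; conclusion = the chart
EXPONENTS `(c_j, a_j, b_j)` (`0 ≤ a_j, b_j < p`) with the values of the chart monomials (`< 1` for `j < ρ`, `= 1` for `ρ ≤ j`) and, for
each `p·δᵢ` and each `e ∈ E`, integer coordinates `d` on the chart vectors IN THE `p`-SCALED EXPONENT LATTICE `L = pℤ³ + ℤ·eA + ℤ·eB`
(`θ(C,a,b) := p·C + a·eA + b·eB`), non-negative on the value-positive vectors, positive somewhere for `p·δᵢ`, zero there for value-one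
`e`.  No element of `K` is multiplied here — the reading `z^C x^{a₀} y^{b₀} = α^· β^· ∏ u_j^{d_j}` is PORT 3-R.
Recipe (memo §14 CONVENTIONS, all ✓ kit): `W := Additive (ValuationSubring.ValueGroup O)ˣ`; weights `ωᵢ := v(wᵢ)` (`hzV`), the weight
`φ₀ : (Fin 3 → ℤ) →+ W`, `φ₀ ℓ = −Σ ℓᵢ•ωᵢ` (so `0 < φ₀ (θ m) ⟺ v(z^C x^a y^b) < 1`, using `v x = Σ eAᵢ ωᵢ` from `hxA` + ✓
`pow_left_injective_of_ne_zero`); `L := ℤ-span {p·δᵢ, eA, eB}` with a basis `b : Basis (Fin 3) ℤ L` (`Submodule.basisOfPid` /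
`Module.finBasisOfFinrankEq`; `finrank L = 3` as `pℤ³ ≤ L ≤ ℤ³`), `φ := φ₀ ∘ L.subtype`; `hrel : ∃ ℓ ∈ L, ℓ ≠ 0, φ ℓ = 0` from
✓ `Lens5_RankOneArchimedean.exists_ne_zero_map_eq_zero_of_rank_le_two` + ✓ census `ratRank_le_two_of_stub O A hAfg
(ringKrullDim_eq_three_of_locAtCentre hdimA hdim3) htd hk`; `hne`: `φ (p·δ₀) ≠ 0` (`hzv`).  `F := {p·δᵢ} ∪ {θ e : e ∈ E, v < 1}`.
CLASS SPLIT `by_cases hB : ∀ O₁, O ≤ O₁ → O₁ = O ∨ O₁ = ⊤`: class (B): ✓ `archimedean_additive_valueGroup_units O hB` + ✓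
`toric_lemma_classB` (`Lens5_UnimodularRefinement.lean` rev 9 e40b13a8bffb :881, WITH the kernel clause); class (C): the two-level reading
(✓ `exists_two_level_reading` :1121, `ψ :=` units map of `ValuationSubring.mapOfLE O O₁`, (hW₁)/(hΔ) by ✓ `ker_pair_dependent_of_rank_le_two` /
`image_pair_dependent_of_rank_le_two`, `hne` from (P2) as in the docstring of PORT 3) + ✓ `toric_lemma_classC` (:930).  READ-OUT: `ρ = 2`:
chart vectors `m₁, m₂, e 2` — write each as `θ(c_j, a_j, b_j)` with `0 ≤ a_j, b_j < p` (reduce mod `p`, absorb into `c_j`; every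
`ℓ ∈ L` has such a form); `d` for `f ∈ F` = the lemma's coordinates (both positive on `m₁, m₂`), for value-one `e` = `(0, 0, e.repr f 2)`
by the kernel clause; `ρ = 1`: `e i₀` first, then the two weight-zero basis vectors; `d = e.repr` permuted, `d₀ > 0` for `f ∈ F`,
`d₀ = 0` for weight zero (`φ f = d₀ • φ(e i₀)`, `φ (e i₀) > 0`).  (The proof in the companion follows this recipe, except that the class (C)
`hne` comes for free: if `ψ ∘ φ = 0` the weights lie in `ker ψ`, are pairwise dependent, and the rank-one-image case applies.) -/
theorem port_toricChart_lattice (p : ℕ) [Fact p.Prime] {k : Type} [Field k] [CharP k p]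
    {K : Type} [Field K] [Algebra k K] (O : ValuationSubring K) (A : Subalgebra k K)
    (hAO : A.toSubring ≤ O.toSubring) (hAfg : A.FG) [IsFractionRing A K] (hdimA : ringKrullDim A ≤ 3)
    (hdim3 : ringKrullDim (locAtCentre A.toSubring O) = 3)
    (htd : ∀ hk : ∀ c : k, algebraMap k K c ∈ O, transcendenceDefect k O hk ≠ 0)
    {x y : K} (hx : x ≠ 0) (hy : y ≠ 0)
    (hP : ∀ a b : ℕ, a < p → b < p → (a ≠ 0 ∨ b ≠ 0) → ∀ z : K, z ≠ 0 →
      O.valuation (x ^ a * y ^ b) ≠ O.valuation (z ^ p))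
    (z : Fin 3 → K) (hz0 : ∀ i, z i ≠ 0) (hzv : ∀ i, O.valuation (z i) < 1)
    (hzV : ∀ i, ∃ w : K, w ≠ 0 ∧ O.valuation (z i) = O.valuation (w ^ p))
    (α β : K) (hα : O.valuation α = 1) (hβ : O.valuation β = 1) (eA eB : Fin 3 → ℤ)
    (hxA : x ^ p = α * ∏ i, z i ^ eA i) (hyB : y ^ p = β * ∏ i, z i ^ eB i)
    (E : Finset ((Fin 3 → ℤ) × (Fin p × Fin p)))
    (hE : ∀ e ∈ E, O.valuation ((∏ i, z i ^ e.1 i) * (x ^ (e.2.1 : ℕ) * y ^ (e.2.2 : ℕ))) ≤ 1) :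
    ∃ (ρ : ℕ), (ρ = 1 ∨ ρ = 2) ∧
      ∃ (c : Fin 3 → Fin 3 → ℤ) (a b : Fin 3 → ℕ), (∀ j, a j < p) ∧ (∀ j, b j < p) ∧
        (∀ j : Fin 3, (j : ℕ) < ρ → O.valuation ((∏ i, z i ^ c j i) * (x ^ a j * y ^ b j)) < 1) ∧
        (∀ j : Fin 3, ρ ≤ (j : ℕ) → O.valuation ((∏ i, z i ^ c j i) * (x ^ a j * y ^ b j)) = 1) ∧
        (∀ i : Fin 3, ∃ d : Fin 3 → ℤ, (∀ j : Fin 3, (j : ℕ) < ρ → 0 ≤ d j) ∧ (∃ j : Fin 3, (j : ℕ) < ρ ∧ 0 < d j) ∧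
          ∀ i' : Fin 3, (if i' = i then (p : ℤ) else 0) =
            ∑ j, d j * ((p : ℤ) * c j i' + (a j : ℤ) * eA i' + (b j : ℤ) * eB i')) ∧
        (∀ e ∈ E, ∃ d : Fin 3 → ℤ, (∀ j : Fin 3, (j : ℕ) < ρ → 0 ≤ d j) ∧
          (O.valuation ((∏ i, z i ^ e.1 i) * (x ^ (e.2.1 : ℕ) * y ^ (e.2.2 : ℕ))) = 1 → ∀ j : Fin 3, (j : ℕ) < ρ → d j = 0) ∧
          ∀ i' : Fin 3, (p : ℤ) * e.1 i' + ((e.2.1 : ℕ) : ℤ) * eA i' + ((e.2.2 : ℕ) : ℤ) * eB i' =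
            ∑ j, d j * ((p : ℤ) * c j i' + (a j : ℤ) * eA i' + (b j : ℤ) * eB i')) := by
  sorry

/-- **PORT 3 (§3 of the memo: the toric chart, read in `K`).  Size M (all (S) around the ✓ lattice lemmas).  PROVED (rev 6) from
PORT 3-I + 3-L + 3-R above (kernel-checked glue); the recipe below is the one the proof of 3-L `port_toricChart_lattice` (rev 7, companion file) follows.**
Recipe (memo §14 CONVENTIONS): `W := Additive (ValuationSubring.ValueGroup O)ˣ`; `hzV` gives `wᵢ ≠ 0` with `v zᵢ = v (wᵢ^p)`; the
`p`-scaled EXPONENT LATTICE `L := pℤ³ + ℤ·eA + ℤ·eB ≤ (Fin 3 → ℤ)` (free of rank 3: `Submodule.basisOfPid` between `pℤ³` and `ℤ³`), the weight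
`φ : L →+ W`, `φ ℓ := − Σᵢ ℓᵢ • Additive.ofMul (Units.mk0 (v wᵢ) _)` (so `0 < φ ℓ ⟺ v (μ ℓ) < 1`), and the MONOMIAL MAP `μ (pC + a·eA + b·eB) :=
z^C x^a y^b` on normalised representatives `0 ≤ a, b < p` — well defined by (IND) (`eA mod p`, `eB mod p` independent in `𝔽_p³`, from `hP` +
`hzV` + `hxA`/`hyB`: `v x = v (∏ wᵢ^{eAᵢ})` by `pow_left_injective` in the value group) and multiplicative UP TO FACTORS `α^i β^j`
(`x^{a+a'} = x^{a+a'-p} · α z^{eA}` when `a + a' ≥ p`).  `hrel`: ✓ `Lens5_RankOneArchimedean.exists_ne_zero_map_eq_zero_of_rank_le_two` with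
`Module.rank ℤ W ≤ 2` = ✓ `ratRank_le_two_of_stub O A hAfg (ringKrullDim_eq_three_of_locAtCentre …) htd hk` (`hk` from `hAO`); `hne`: any `zᵢ`
(`hzv`).  CLASS SPLIT `by_cases hB : ∀ O₁, O ≤ O₁ → O₁ = O ∨ O₁ = ⊤`: class (B) ✓ `archimedean_additive_valueGroup_units O hB` +
✓ `toric_lemma_classB` (rev 9, with kernel clause); class (C): `ψ :=` units map of `ValuationSubring.mapOfLE O O₁` (✓ `monotone_mapOfLE`),
(hW₁)/(hΔ) by ✓ `ker_pair_dependent_of_rank_le_two` / `image_pair_dependent_of_rank_le_two`; ✓ `exists_two_level_reading` → ✓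
`toric_lemma_classC` (rev 9).  Its `hne : ∃ ℓ, ψ (φ ℓ) ≠ 0` (some `v(zᵢ) ∉ Δ := ker ψ`) comes from (P2), NOT from «else `v₁` trivial on
`Frac T`» (memo §14; that only yields a non-monomial witness — the coarse centre on `T` may be `(z₁ − z₂)`-like): if every `v(zᵢ) ∈ Δ` then
`v(x), v(y) ∈ Δ` (`x^p = α z^{eA}`, `W/Δ ↪ W₁` torsion-free), so the `p²` classes of `a·v(x) + b·v(y)` (`0 ≤ a, b < p`) in `Γ/pΓ` — pairwise
distinct by (P2) — would lie in the image `Δ/pΔ` (`Δ` is saturated), which has `≤ p` elements because `Δ` has rational rank `≤ 1` ((hΔ) +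
Bezout: `s•x + t•y = 0`, `gcd(s,t) = 1` ⇒ `p ∤ s` or `p ∤ t` ⇒ the classes of `x, y` are dependent) — contradiction (memo rev 12 §15 (a)).
(Alternative, not needed: if `ψ ∘ φ = 0` then `φ(L) ⊆ Δ` is finitely generated of rational rank `≤ 1`, hence cyclic, `φ = φ₂ • γ₀`, and
✓ `toric_lemma_classB` applies to `φ₂ : L →+ ℤ`.)  `F :=` the `p·δᵢ` (`φ > 0` by `hzv`) and the value-POSITIVE piece exponents `p·e.1 + e.2.1·eA + e.2.2·eB`; value-ZERO
pieces lie in `ker φ`, which the kernel clause of rev 9 places in `ℤ·(chart vectors of value zero)`.  Read the chart: `u j := μ (m_j*)`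
(`ρ = 2`: `m₁, m₂, e 2`; `ρ = 1`: `e i₀` first, then the two kernel vectors), `c j`, `a j`, `b j` its normalised exponents; the identities
`zᵢ = α^· β^· ∏ u_j^{d}` / `μ(ℓ_e) = α^· β^· ∏ u_j^{d}` are `μ` applied to `p δᵢ = Σ d_j m_j*` / `ℓ_e = Σ d_j m_j*`. -/
theorem port_toricChart (p : ℕ) [Fact p.Prime] {k : Type} [Field k] [CharP k p]
    {K : Type} [Field K] [Algebra k K] (O : ValuationSubring K) (A : Subalgebra k K)
    (hAO : A.toSubring ≤ O.toSubring) (hAfg : A.FG) [IsFractionRing A K] (hdimA : ringKrullDim A ≤ 3)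
    (hdim3 : ringKrullDim (locAtCentre A.toSubring O) = 3)
    (htd : ∀ hk : ∀ c : k, algebraMap k K c ∈ O, transcendenceDefect k O hk ≠ 0)
    {x y : K} (hx : x ≠ 0) (hy : y ≠ 0)
    (hP : ∀ a b : ℕ, a < p → b < p → (a ≠ 0 ∨ b ≠ 0) → ∀ z : K, z ≠ 0 →
      O.valuation (x ^ a * y ^ b) ≠ O.valuation (z ^ p))
    (z : Fin 3 → K) (hz0 : ∀ i, z i ≠ 0) (hzv : ∀ i, O.valuation (z i) < 1)
    (hzV : ∀ i, ∃ w : K, w ≠ 0 ∧ O.valuation (z i) = O.valuation (w ^ p))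
    (α β : K) (hα : O.valuation α = 1) (hβ : O.valuation β = 1) (eA eB : Fin 3 → ℤ)
    (hxA : x ^ p = α * ∏ i, z i ^ eA i) (hyB : y ^ p = β * ∏ i, z i ^ eB i)
    (E : Finset ((Fin 3 → ℤ) × (Fin p × Fin p)))
    (hE : ∀ e ∈ E, O.valuation ((∏ i, z i ^ e.1 i) * (x ^ (e.2.1 : ℕ) * y ^ (e.2.2 : ℕ))) ≤ 1) :
    ∃ (ρ : ℕ), (ρ = 1 ∨ ρ = 2) ∧
      ∃ (c : Fin 3 → Fin 3 → ℤ) (a b : Fin 3 → ℕ) (u : Fin 3 → K), (∀ j, a j < p) ∧ (∀ j, b j < p) ∧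
        (∀ j, u j = (∏ i, z i ^ c j i) * (x ^ a j * y ^ b j)) ∧
        (∀ j : Fin 3, (j : ℕ) < ρ → O.valuation (u j) < 1) ∧
        (∀ j : Fin 3, ρ ≤ (j : ℕ) → O.valuation (u j) = 1) ∧
        (∀ i : Fin 3, ∃ (d : Fin 3 → ℤ) (ia ib : ℤ), (∀ j : Fin 3, (j : ℕ) < ρ → 0 ≤ d j) ∧ (∃ j : Fin 3, (j : ℕ) < ρ ∧ 0 < d j) ∧
          z i = α ^ ia * β ^ ib * ∏ j, u j ^ d j) ∧
        (∀ e ∈ E, ∃ (d : Fin 3 → ℤ) (ia ib : ℤ), (∀ j : Fin 3, (j : ℕ) < ρ → 0 ≤ d j) ∧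
          (O.valuation ((∏ i, z i ^ e.1 i) * (x ^ (e.2.1 : ℕ) * y ^ (e.2.2 : ℕ))) = 1 → ∀ j : Fin 3, (j : ℕ) < ρ → d j = 0) ∧
          (∏ i, z i ^ e.1 i) * (x ^ (e.2.1 : ℕ) * y ^ (e.2.2 : ℕ)) = α ^ ia * β ^ ib * ∏ j, u j ^ d j) := by
  classical
  have hα0 : α ≠ 0 := fun h => by rw [h, map_zero] at hα; exact zero_ne_one hα
  have hβ0 : β ≠ 0 := fun h => by rw [h, map_zero] at hβ; exact zero_ne_one hβ
  have hind := port_toricChart_ind p O hx hy hP z hz0 hzV α β hα hβ eA eB hxA hyB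
  obtain ⟨ρ, hρ, c, a, b, ha, hb, hpos, hzero, hzi, hEi⟩ :=
    port_toricChart_lattice p O A hAO hAfg hdimA hdim3 htd hx hy hP z hz0 hzv hzV α β hα hβ eA eB hxA hyB E hE
  refine ⟨ρ, hρ, c, a, b, fun j => (∏ i, z i ^ c j i) * (x ^ a j * y ^ b j), ha, hb, fun j => rfl, hpos, hzero, ?_, ?_⟩
  · intro i
    obtain ⟨d, hd0, hdpos, hℓ⟩ := hzi i
    have hℓ' : ∀ i' : Fin 3, (p : ℤ) * (if i' = i then (1 : ℤ) else 0) + ((0 : ℕ) : ℤ) * eA i' + ((0 : ℕ) : ℤ) * eB i' =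
        ∑ j, d j * ((p : ℤ) * c j i' + (a j : ℤ) * eA i' + (b j : ℤ) * eB i') := by
      intro i'
      rw [← hℓ i', Nat.cast_zero, zero_mul, zero_mul, add_zero, add_zero, mul_ite, mul_one, mul_zero]
    obtain ⟨ia, ib, hread⟩ := port_toricChart_read p hx hy z hz0 α β hα0 hβ0 eA eB hxA hyB hind c a b _ (fun j => rfl)
      (fun i' => if i' = i then (1 : ℤ) else 0) 0 0 d hℓ'
    refine ⟨d, ia, ib, hd0, hdpos, ?_⟩
    rw [← hread, pow_zero, pow_zero, mul_one, mul_one, Finset.prod_eq_single i, if_pos rfl, zpow_one]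
    · intro j _ hj
      rw [if_neg hj, zpow_zero]
    · intro h
      exact absurd (Finset.mem_univ i) h
  · intro e he
    obtain ⟨d, hd0, hd1, hℓ⟩ := hEi e he
    obtain ⟨ia, ib, hread⟩ := port_toricChart_read p hx hy z hz0 α β hα0 hβ0 eA eB hxA hyB hind c a b _ (fun j => rfl)
      e.1 (e.2.1 : ℕ) (e.2.2 : ℕ) d hℓ
    exact ⟨d, ia, ib, hd0, hd1, hread⟩

/-! ### (rev 4) helpers for PORT 4 — the REGULARITY CRITERION kit and the CHART-SURJECTION kit, verbatim with proofs

Copied from the crux workfiles `Cruxes/DescentPerfectToAll/Lens5_RegularityCriterion.lean` (rev 2, sha16 bb06c35af139…, crit ✓ TRIAGE-71/73) and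
`Cruxes/DescentPerfectToAll/Lens5_ChartSurjection.lean` (f733dfb32cc8…) — `Cruxes/` modules are not importable by a farm-checked file, so the
lemmas travel with their proofs (memo §15 convention).  Generic commutative algebra; Mathlib + `AffineDomainEquidim` only. -/

/-- `WithBot ℕ∞` bookkeeping: a dimension which is not `⊥` and is bounded by a natural number is a natural number. [folklore] -/
theorem exists_nat_eq_of_le_nat (x : WithBot ℕ∞) (hbot : x ≠ ⊥) (N : ℕ) (hle : x ≤ (N : WithBot ℕ∞)) : ∃ m : ℕ, x = m := by
  induction x using WithBot.recBotCoe with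
  | bot => exact absurd rfl hbot
  | coe y =>
    induction y using ENat.recTopCoe with
    | top =>
      exfalso
      have h : ((⊤ : ℕ∞) : WithBot ℕ∞) ≤ ((N : ℕ∞) : WithBot ℕ∞) := hle
      rw [WithBot.coe_le_coe] at h
      exact absurd h (not_le.mpr (ENat.coe_lt_top N))
    | coe m => exact ⟨m, rfl⟩

/-- A surjection from a local domain of finite Krull dimension `d` onto a ring of dimension `≥ d` is injective. [folklore] -/
theorem injective_of_surjective_of_ringKrullDim_le {P Q : Type} [CommRing P] [IsDomain P] [CommRing Q]
    (f : P →+* Q) (hf : Function.Surjective f) {d : ℕ} (hP : ringKrullDim P = d) (hQ : (d : WithBot ℕ∞) ≤ ringKrullDim Q) :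
    Function.Injective f := by
  rw [injective_iff_map_eq_zero]
  intro r hr
  by_contra hr0
  -- `Q` is a quotient of `P ⧸ (r)`
  let g : P ⧸ Ideal.span {r} →+* Q :=
    Ideal.Quotient.lift (Ideal.span {r}) f fun a ha => by
      obtain ⟨c, rfl⟩ := Ideal.mem_span_singleton'.mp ha
      rw [map_mul, hr, mul_zero]
  have hg : Function.Surjective g := by
    intro q
    obtain ⟨p, rfl⟩ := hf q
    exact ⟨Ideal.Quotient.mk _ p, by simp [g]⟩
  have h1 : ringKrullDim Q ≤ ringKrullDim (P ⧸ Ideal.span {r}) := ringKrullDim_le_of_surjective g hg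
  have h2 : ringKrullDim (P ⧸ Ideal.span {r}) + 1 ≤ ringKrullDim P :=
    ringKrullDim_quotient_succ_le_of_nonZeroDivisor (mem_nonZeroDivisors_of_ne_zero hr0)
  rw [hP] at h2
  have h3 : (d : WithBot ℕ∞) + 1 ≤ d := le_trans (add_le_add (hQ.trans h1) le_rfl) h2
  have h4 : ((d + 1 : ℕ) : WithBot ℕ∞) ≤ ((d : ℕ) : WithBot ℕ∞) := by push_cast; exact h3
  have h5 : d + 1 ≤ d := by exact_mod_cast h4
  omega

/-- In a local ring, an ideal contained in the maximal ideal is contained in the Jacobson radical. [folklore] -/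
theorem le_jacobson_of_le_maximalIdeal {S : Type} [CommRing S] [IsLocalRing S] (𝔞 : Ideal S) (h : 𝔞 ≤ maximalIdeal S) :
    𝔞 ≤ Ring.jacobson S := by
  rw [Ring.jacobson_eq_sInf_isMaximal]
  refine le_sInf fun I hI => ?_
  haveI : I.IsMaximal := hI
  rw [IsLocalRing.eq_maximalIdeal hI]
  exact h

/-- Krull: `dim (S ⧸ 𝔞) ≥ n − ρ` for an ideal `𝔞 ⊆ 𝔪_S` with `≤ ρ` generators in a Noetherian local ring of dimension `n`
(the first step of the criterion, isolated — rev 4 uses it to pin the dimension of the chart's local ring `P`). [folklore] -/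
theorem natCast_sub_le_ringKrullDim_quotient {S : Type} [CommRing S] [IsLocalRing S] [IsNoetherianRing S] {n ρ : ℕ}
    (hdim : ringKrullDim S = n) (𝔞 : Ideal S) (h𝔞m : 𝔞 ≤ maximalIdeal S) (hgen : 𝔞.spanFinrank ≤ ρ) :
    ((n - ρ : ℕ) : WithBot ℕ∞) ≤ ringKrullDim (S ⧸ 𝔞) := by
  classical
  have h𝔞top : 𝔞 ≠ ⊤ := fun h => (maximalIdeal.isMaximal S).ne_top (top_le_iff.mp (h ▸ h𝔞m))
  haveI : Nontrivial (S ⧸ 𝔞) := Ideal.Quotient.nontrivial_iff.mpr h𝔞top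
  have hKrull : ringKrullDim S ≤ ringKrullDim (S ⧸ 𝔞) + 𝔞.spanFinrank :=
    ringKrullDim_le_ringKrullDim_quotient_add_spanFinrank 𝔞 (le_jacobson_of_le_maximalIdeal 𝔞 h𝔞m)
  have hQle : ringKrullDim (S ⧸ 𝔞) ≤ (n : WithBot ℕ∞) := hdim ▸ ringKrullDim_le_of_surjective _ Ideal.Quotient.mk_surjective
  have hQbot : ringKrullDim (S ⧸ 𝔞) ≠ ⊥ := by
    have h0 : (0 : WithBot ℕ∞) ≤ ringKrullDim (S ⧸ 𝔞) := ringKrullDim_nonneg_of_nontrivial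
    intro h
    rw [h] at h0
    exact absurd h0 (by simp)
  obtain ⟨m, hm⟩ := exists_nat_eq_of_le_nat _ hQbot n hQle
  have hnm : n ≤ m + ρ := by
    rw [hdim, hm] at hKrull
    have h' : (n : WithBot ℕ∞) ≤ (m : WithBot ℕ∞) + (ρ : WithBot ℕ∞) :=
      hKrull.trans (add_le_add le_rfl (by exact_mod_cast hgen))
    have h'' : ((n : ℕ) : WithBot ℕ∞) ≤ ((m + ρ : ℕ) : WithBot ℕ∞) := by push_cast; exact h'
    exact_mod_cast h''
  rw [hm]; exact_mod_cast (by omega : n - ρ ≤ m)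

/-- The same for `𝔞 = (u₁, …, u_ρ)`, `uᵢ ∈ 𝔪_S`. [folklore] -/
theorem natCast_sub_le_ringKrullDim_quotient_span {S : Type} [CommRing S] [IsLocalRing S] [IsNoetherianRing S] {n ρ : ℕ}
    (hdim : ringKrullDim S = n) (u : Fin ρ → S) (hu : ∀ i, u i ∈ maximalIdeal S) :
    ((n - ρ : ℕ) : WithBot ℕ∞) ≤ ringKrullDim (S ⧸ Ideal.span (Set.range u)) := by
  classical
  refine natCast_sub_le_ringKrullDim_quotient hdim (Ideal.span (Set.range u)) ?_ ?_
  · rw [Ideal.span_le]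
    rintro _ ⟨i, rfl⟩
    exact hu i
  · have hr : Set.range u = ((Finset.univ.image u : Finset S) : Set S) := by ext; simp
    rw [hr]
    refine (Submodule.spanFinrank_span_le_ncard_of_finite (R := S) (Finset.finite_toSet _)).trans ?_
    rw [Set.ncard_coe_finset]
    exact Finset.card_image_le.trans (by simp)

/-- **THE REGULARITY CRITERION (§4′), abstract ideal** (kit `regular_of_regular_quotient'`, verbatim).  `S` Noetherian local of dimension
`n`; `𝔞 ⊆ 𝔪_S` generated by `≤ ρ` elements (`ρ ≤ n`); `P` a regular local domain of dimension `n − ρ` with a surjection `f : P ↠ S ⧸ 𝔞`.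
Then `S` is regular, `f` is injective, the maximal ideal of the quotient is `f(𝔪_P)` and is the image of `𝔪_S`, and the lift of a
regular parameter of `P` is a regular parameter of `S`. [folklore] -/
theorem regular_of_regular_quotient' {S : Type} [CommRing S] [IsLocalRing S] [IsNoetherianRing S] {n ρ : ℕ}
    (hdim : ringKrullDim S = n) (hρn : ρ ≤ n) (𝔞 : Ideal S) (h𝔞m : 𝔞 ≤ maximalIdeal S) (hgen : 𝔞.spanFinrank ≤ ρ)
    {P : Type} [CommRing P] [IsDomain P] [IsRegularLocalRing P] (hP : ringKrullDim P = (n - ρ : ℕ))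
    (f : P →+* S ⧸ 𝔞) (hf : Function.Surjective f) :
    IsRegularLocalRing S ∧ Function.Injective f ∧
      (maximalIdeal S).map (Ideal.Quotient.mk 𝔞) = (maximalIdeal P).map f ∧
      (∀ (ψ : S) (π : P), Ideal.Quotient.mk 𝔞 ψ = f π → π ∈ maximalIdeal P → ψ ∈ maximalIdeal S) ∧
      (∀ (ψ : S) (π : P), Ideal.Quotient.mk 𝔞 ψ = f π → π ∉ (maximalIdeal P) ^ 2 → ψ ∉ (maximalIdeal S) ^ 2) := by
  classical
  have h𝔞top : 𝔞 ≠ ⊤ := fun h => (maximalIdeal.isMaximal S).ne_top (top_le_iff.mp (h ▸ h𝔞m))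
  haveI : Nontrivial (S ⧸ 𝔞) := Ideal.Quotient.nontrivial_iff.mpr h𝔞top
  haveI : IsLocalRing (S ⧸ 𝔞) := IsLocalRing.of_surjective' (Ideal.Quotient.mk 𝔞) Ideal.Quotient.mk_surjective
  -- (1) `dim (S ⧸ 𝔞) ≥ n - ρ`
  have hQge : ((n - ρ : ℕ) : WithBot ℕ∞) ≤ ringKrullDim (S ⧸ 𝔞) := natCast_sub_le_ringKrullDim_quotient hdim 𝔞 h𝔞m hgen
  -- (2) `f` is injective, hence an isomorphism of local rings
  have hinj : Function.Injective f := injective_of_surjective_of_ringKrullDim_le f hf hP hQge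
  let e : P ≃+* S ⧸ 𝔞 := RingEquiv.ofBijective f ⟨hinj, hf⟩
  have he : ∀ p, e p = f p := fun _ => rfl
  -- units correspond
  have hunitP : ∀ p : P, IsUnit (f p) ↔ IsUnit p := fun p => by
    constructor
    · intro h
      have := h.map e.symm
      rwa [← he, RingEquiv.symm_apply_apply] at this
    · exact fun h => h.map f
  have hunitS : ∀ s : S, IsUnit (Ideal.Quotient.mk 𝔞 s) ↔ IsUnit s := fun s => by
    constructor
    · intro h
      by_contra hs
      obtain ⟨t, ht⟩ := h.exists_right_inv
      obtain ⟨t', rfl⟩ := Ideal.Quotient.mk_surjective t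
      rw [← map_mul, ← map_one (Ideal.Quotient.mk 𝔞), Ideal.Quotient.eq] at ht
      have h1 : s * t' - 1 ∈ maximalIdeal S := h𝔞m ht
      have h2 : s * t' ∈ maximalIdeal S := Ideal.mul_mem_right _ _ ((mem_maximalIdeal _).mpr (mem_nonunits_iff.mpr hs))
      have h3 : (1 : S) ∈ maximalIdeal S := by simpa using Ideal.sub_mem _ h2 h1
      exact (maximalIdeal.isMaximal S).ne_top (Ideal.eq_top_of_isUnit_mem _ h3 isUnit_one)
    · exact fun h => h.map _
  have hmmP : ∀ p : P, p ∈ maximalIdeal P ↔ f p ∈ maximalIdeal (S ⧸ 𝔞) := fun p => by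
    simp only [mem_maximalIdeal, mem_nonunits_iff, hunitP]
  have hmmS : ∀ s : S, s ∈ maximalIdeal S ↔ Ideal.Quotient.mk 𝔞 s ∈ maximalIdeal (S ⧸ 𝔞) := fun s => by
    simp only [mem_maximalIdeal, mem_nonunits_iff, hunitS]
  -- (3) the maximal ideal of the quotient is `f(𝔪_P)` and is the image of `𝔪_S`
  have hmQ : maximalIdeal (S ⧸ 𝔞) = (maximalIdeal P).map f := by
    apply le_antisymm
    · intro q hq
      obtain ⟨p, rfl⟩ := hf q
      exact Ideal.mem_map_of_mem f ((hmmP p).mpr hq)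
    · rw [Ideal.map_le_iff_le_comap]
      intro p hp
      rw [Ideal.mem_comap]
      exact (hmmP p).mp hp
  have hmS : (maximalIdeal S).map (Ideal.Quotient.mk 𝔞) = maximalIdeal (S ⧸ 𝔞) := by
    apply le_antisymm
    · rw [Ideal.map_le_iff_le_comap]
      intro s hs
      rw [Ideal.mem_comap]
      exact (hmmS s).mp hs
    · intro q hq
      obtain ⟨s, rfl⟩ := Ideal.Quotient.mk_surjective q
      exact Ideal.mem_map_of_mem _ ((hmmS s).mpr hq)
  -- (4) generators: `𝔪_S = (generators of 𝔞) + (lifts of the n - ρ generators of 𝔪_P)`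
  have hPfin : (maximalIdeal P).spanFinrank = n - ρ := by
    have h : ((maximalIdeal P).spanFinrank : WithBot ℕ∞) = ((n - ρ : ℕ) : WithBot ℕ∞) := by
      rw [← hP]; exact IsRegularLocalRing.spanFinrank_maximalIdeal
    exact_mod_cast h
  obtain ⟨G, hGcard, hGspan⟩ :=
    Submodule.FG.exists_span_finset_card_eq_spanFinrank (IsNoetherian.noetherian (maximalIdeal P))
  rw [hPfin] at hGcard
  obtain ⟨A, hAcard, hAspan⟩ := Submodule.FG.exists_span_finset_card_eq_spanFinrank (IsNoetherian.noetherian 𝔞)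
  -- lifts
  let ψ : P → S := fun p => (Ideal.Quotient.mk_surjective (f p)).choose
  have hψ : ∀ p, Ideal.Quotient.mk 𝔞 (ψ p) = f p := fun p => (Ideal.Quotient.mk_surjective (f p)).choose_spec
  let T : Finset S := A ∪ G.image ψ
  have hTcard : T.card ≤ n := by
    calc T.card ≤ A.card + (G.image ψ).card := Finset.card_union_le _ _
      _ ≤ 𝔞.spanFinrank + G.card := add_le_add hAcard.le Finset.card_image_le
      _ ≤ ρ + (n - ρ) := add_le_add hgen hGcard.le
      _ = n := by omega
  have h𝔞A : (𝔞 : Ideal S) = Ideal.span (A : Set S) := by rw [← hAspan]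
  have h𝔞T : 𝔞 ≤ Ideal.span (T : Set S) := by
    rw [h𝔞A]; apply Ideal.span_mono
    intro a ha
    exact Finset.mem_coe.mpr (Finset.mem_union_left _ (Finset.mem_coe.mp ha))
  have hTm : Ideal.span (T : Set S) = maximalIdeal S := by
    apply le_antisymm
    · rw [Ideal.span_le]
      intro s hs
      rcases Finset.mem_union.mp (Finset.mem_coe.mp hs) with hA | hG
      · exact h𝔞m (h𝔞A ▸ Ideal.subset_span (Finset.mem_coe.mpr hA))
      · obtain ⟨g, hg, rfl⟩ := Finset.mem_image.mp hG
        have hg' : g ∈ maximalIdeal P := by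
          have : g ∈ Submodule.span P (G : Set P) := Submodule.subset_span (Finset.mem_coe.mpr hg)
          rw [hGspan] at this; exact this
        have : f g ∈ maximalIdeal (S ⧸ 𝔞) := (hmmP g).mp hg'
        rw [← hψ g] at this
        exact (hmmS _).mpr this
    · have hmap : (maximalIdeal S).map (Ideal.Quotient.mk 𝔞) ≤ (Ideal.span (T : Set S)).map (Ideal.Quotient.mk 𝔞) := by
        rw [hmS, hmQ, Ideal.map_le_iff_le_comap]
        have hGle : (maximalIdeal P : Ideal P) = Ideal.span (G : Set P) := by
          rw [← hGspan]
        rw [hGle, Ideal.span_le]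
        intro g hg
        rw [SetLike.mem_coe, Ideal.mem_comap, ← hψ g]
        apply Ideal.mem_map_of_mem
        apply Ideal.subset_span
        exact Finset.mem_coe.mpr (Finset.mem_union_right _ (Finset.mem_image_of_mem ψ (Finset.mem_coe.mp hg)))
      have := Ideal.comap_mono (f := Ideal.Quotient.mk 𝔞) hmap
      rw [Ideal.comap_map_of_surjective _ Ideal.Quotient.mk_surjective,
        Ideal.comap_map_of_surjective _ Ideal.Quotient.mk_surjective] at this
      have hker : Ideal.comap (Ideal.Quotient.mk 𝔞) ⊥ = 𝔞 := by
        rw [← RingHom.ker_eq_comap_bot, Ideal.mk_ker]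
      rw [hker] at this
      calc maximalIdeal S ≤ maximalIdeal S ⊔ 𝔞 := le_sup_left
        _ ≤ Ideal.span (T : Set S) ⊔ 𝔞 := this
        _ = Ideal.span (T : Set S) := sup_eq_left.mpr h𝔞T
  -- (5) regularity
  have hreg : IsRegularLocalRing S := by
    apply IsRegularLocalRing.of_spanFinrank_maximalIdeal_le
    rw [hdim, ← hTm]
    exact_mod_cast (Submodule.spanFinrank_span_le_ncard_of_finite (R := S) (Finset.finite_toSet T)).trans
      (by rw [Set.ncard_coe_finset]; exact hTcard)
  refine ⟨hreg, hinj, by rw [hmS, hmQ], ?_, ?_⟩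
  · intro ψ' π hψ' hπ
    have : f π ∈ maximalIdeal (S ⧸ 𝔞) := (hmmP π).mp hπ
    rw [← hψ'] at this
    exact (hmmS _).mpr this
  · intro ψ' π hψ' hπ hψ'2
    apply hπ
    have h1 : Ideal.Quotient.mk 𝔞 ψ' ∈ ((maximalIdeal S) ^ 2).map (Ideal.Quotient.mk 𝔞) := Ideal.mem_map_of_mem _ hψ'2
    rw [Ideal.map_pow, hmS, hmQ, ← Ideal.map_pow, hψ'] at h1
    have h2 : π ∈ Ideal.comap f (((maximalIdeal P) ^ 2).map f) := by
      rw [Ideal.mem_comap]; exact h1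
    rw [Ideal.comap_map_of_surjective f hf] at h2
    have hker : Ideal.comap f ⊥ = ⊥ := by
      rw [← RingHom.ker_eq_comap_bot]; exact (RingHom.injective_iff_ker_eq_bot f).mp hinj
    rw [hker, sup_bot_eq] at h2
    exact h2

/-- **THE REGULARITY CRITERION (§4′)** for `𝔞 = (u₁,…,u_ρ)` (kit `regular_of_regular_quotient`, verbatim). [folklore] -/
theorem regular_of_regular_quotient {S : Type} [CommRing S] [IsLocalRing S] [IsNoetherianRing S] {n ρ : ℕ}
    (hdim : ringKrullDim S = n) (hρn : ρ ≤ n) (u : Fin ρ → S) (hu : ∀ i, u i ∈ maximalIdeal S)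
    {P : Type} [CommRing P] [IsDomain P] [IsRegularLocalRing P] (hP : ringKrullDim P = (n - ρ : ℕ))
    (f : P →+* S ⧸ Ideal.span (Set.range u)) (hf : Function.Surjective f) :
    IsRegularLocalRing S ∧ Function.Injective f ∧
      (maximalIdeal S).map (Ideal.Quotient.mk (Ideal.span (Set.range u))) = (maximalIdeal P).map f ∧
      (∀ (ψ : S) (π : P), Ideal.Quotient.mk (Ideal.span (Set.range u)) ψ = f π → π ∈ maximalIdeal P → ψ ∈ maximalIdeal S) ∧
      (∀ (ψ : S) (π : P), Ideal.Quotient.mk (Ideal.span (Set.range u)) ψ = f π → π ∉ (maximalIdeal P) ^ 2 →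
        ψ ∉ (maximalIdeal S) ^ 2) := by
  classical
  refine regular_of_regular_quotient' hdim hρn (Ideal.span (Set.range u)) ?_ ?_ hP f hf
  · rw [Ideal.span_le]
    rintro _ ⟨i, rfl⟩
    exact hu i
  · have hr : Set.range u = ((Finset.univ.image u : Finset S) : Set S) := by ext; simp
    rw [hr]
    refine (Submodule.spanFinrank_span_le_ncard_of_finite (R := S) (Finset.finite_toSet _)).trans ?_
    rw [Set.ncard_coe_finset]
    exact Finset.card_image_le.trans (by simp)

/-- In a Noetherian local ring of non-zero Krull dimension, every generating set of the maximal ideal contains an element outside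
`𝔪²` (kit `exists_mem_span_not_mem_sq`, verbatim). [folklore] -/
theorem exists_mem_span_not_mem_sq {P : Type} [CommRing P] [IsLocalRing P] [IsNoetherianRing P]
    (hdim : ringKrullDim P ≠ 0) (G : Set P) (hG : Ideal.span G = maximalIdeal P) :
    ∃ g ∈ G, g ∈ maximalIdeal P ∧ g ∉ (maximalIdeal P) ^ 2 := by
  by_contra h
  have h' : ∀ g ∈ G, g ∈ (maximalIdeal P) ^ 2 := fun g hg => by
    by_contra hg2
    exact h ⟨g, hg, hG ▸ Ideal.subset_span hg, hg2⟩
  have hle : maximalIdeal P ≤ (maximalIdeal P) ^ 2 := by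
    have : Ideal.span G ≤ (maximalIdeal P) ^ 2 := Ideal.span_le.mpr fun g hg => h' g hg
    rwa [hG] at this
  exact absurd hle (not_le_of_gt (IsLocalRing.maximalIdeal_sq_lt_of_ringKrullDim_ne_zero hdim))

/-- The same through a ring map (kit `exists_generator_map_not_mem_sq`, verbatim): if `𝔪_P = (span G₀).map ι`, some `q ∈ G₀` maps to a
regular parameter `ι q ∈ 𝔪_P ∖ 𝔪_P²`. [folklore] -/
theorem exists_generator_map_not_mem_sq {R P : Type} [CommRing R] [CommRing P] [IsLocalRing P] [IsNoetherianRing P]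
    (hdim : ringKrullDim P ≠ 0) (ι : R →+* P) (G₀ : Set R) (h𝔫 : (Ideal.span G₀).map ι = maximalIdeal P) :
    ∃ q ∈ G₀, ι q ∈ maximalIdeal P ∧ ι q ∉ (maximalIdeal P) ^ 2 := by
  have hG : Ideal.span (ι '' G₀) = maximalIdeal P := by rw [← Ideal.map_span, h𝔫]
  obtain ⟨g, ⟨q, hq, rfl⟩, h1, h2⟩ := exists_mem_span_not_mem_sq hdim (ι '' G₀) hG
  exact ⟨q, hq, h1, h2⟩

/-- **(c2) Surjectivity of the chart map from a normal form** (kit `lift_surjective_of_normal_form`, verbatim). [folklore] -/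
theorem lift_surjective_of_normal_form {S Q P : Type} [CommRing S] [CommRing Q] [CommRing P] [Algebra Q P]
    (𝔞 : Ideal S) (R₀ : Set S)
    (hloc : ∀ s : S, ∃ b c : S, b ∈ R₀ ∧ c ∈ R₀ ∧ IsUnit (Ideal.Quotient.mk 𝔞 c) ∧ s * c - b ∈ 𝔞)
    (F : Q →+* S ⧸ 𝔞) (hF : ∀ b ∈ R₀, Ideal.Quotient.mk 𝔞 b ∈ F.range)
    (𝔫 : Ideal Q) [𝔫.IsPrime] [IsLocalization.AtPrime P 𝔫]
    (hunit : ∀ y : 𝔫.primeCompl, IsUnit (F y)) (h𝔫 : ∀ q : Q, IsUnit (F q) → q ∉ 𝔫) :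
    Function.Surjective (IsLocalization.lift (S := P) hunit) := by
  intro t
  obtain ⟨s, rfl⟩ := Ideal.Quotient.mk_surjective t
  obtain ⟨b, c, hb, hc, hcu, hsc⟩ := hloc s
  obtain ⟨q₁, hq₁⟩ := hF b hb
  obtain ⟨q₂, hq₂⟩ := hF c hc
  have hq₂𝔫 : q₂ ∈ 𝔫.primeCompl := h𝔫 q₂ (hq₂ ▸ hcu)
  refine ⟨IsLocalization.mk' P q₁ ⟨q₂, hq₂𝔫⟩, ?_⟩
  rw [IsLocalization.lift_mk'_spec]
  change F q₁ = F q₂ * Ideal.Quotient.mk 𝔞 s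
  rw [hq₁, hq₂, ← map_mul, mul_comm]
  exact (Ideal.Quotient.eq.mpr hsc).symm

/-- The two side conditions of `lift_surjective_of_normal_form` for `𝔫 := F⁻¹(𝔪)` when the target is local (kit, verbatim). [folklore] -/
theorem primeCompl_comap_maximalIdeal {Q E : Type} [CommRing Q] [CommRing E] [IsLocalRing E] (F : Q →+* E) :
    (∀ y : ((maximalIdeal E).comap F).primeCompl, IsUnit (F y)) ∧ (∀ q : Q, IsUnit (F q) → q ∉ (maximalIdeal E).comap F) := by
  refine ⟨fun y => ?_, fun q hq h => ?_⟩
  · have hy : F y ∉ maximalIdeal E := fun h => y.2 (Ideal.mem_comap.mpr h)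
    exact (notMem_maximalIdeal.mp hy)
  · exact (notMem_maximalIdeal.mpr hq) (Ideal.mem_comap.mp h)

/-- **(rev 4) The chart's local ring `P = κ[U₁,…,U_m]_𝔫` at a PRIME `𝔫`, pinned by dimension.**  `P` is a regular local domain
(Mathlib: polynomial rings over a field are regular rings, localisations of regular rings at primes are regular local); and if `P`
surjects onto a ring of dimension `≥ m` then `dim P = m` (`dim P ≤ dim κ[U] = m`; `dim P ≥ dim` of its quotient).  This replaces the
maximality-of-`𝔫` argument of memo §13 (c1) (Zariski's lemma): `ht 𝔫 = m` is FORCED by the surjection. [folklore] -/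
theorem localization_mvPolynomial_regular_of_surjective (κ : Type) [Field κ] (m : ℕ) (𝔫 : Ideal (MvPolynomial (Fin m) κ))
    [𝔫.IsPrime] {E : Type} [CommRing E] (f : Localization.AtPrime 𝔫 →+* E) (hf : Function.Surjective f)
    (hE : (m : WithBot ℕ∞) ≤ ringKrullDim E) :
    IsRegularLocalRing (Localization.AtPrime 𝔫) ∧ IsDomain (Localization.AtPrime 𝔫) ∧
      ringKrullDim (Localization.AtPrime 𝔫) = m := by
  refine ⟨inferInstance, inferInstance, le_antisymm ?_ (hE.trans (ringKrullDim_le_of_surjective f hf))⟩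
  calc ringKrullDim (Localization.AtPrime 𝔫) ≤ ringKrullDim (MvPolynomial (Fin m) κ) :=
        Literature.RingTheory.KrullDimension.ringKrullDim_localization_atPrime_le 𝔫
    _ = m := by
        rw [MvPolynomial.ringKrullDim_of_isNoetherianRing, ringKrullDim_eq_zero_of_field]
        simp

/-! ### (rev 4) PORT 4 plumbing: normal forms `x · w ^ N ∈ R₀` (clearing the value-zero chart monomials) -/

/-- `NF R w x`: some power of `w` multiplies `x` into the subring `R` (port: `R = T[u]`, `w = ∏_{j ≥ ρ} u_j`). -/
def NF {K : Type} [Field K] (R : Subring K) (w x : K) : Prop := ∃ N : ℕ, x * w ^ N ∈ R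

namespace NF

variable {K : Type} [Field K] {R : Subring K} {w : K}

theorem of_mem {x : K} (hx : x ∈ R) : NF R w x := ⟨0, by simpa using hx⟩

theorem zero : NF R w 0 := of_mem R.zero_mem

theorem one : NF R w 1 := of_mem R.one_mem

theorem add {x y : K} (hw : w ∈ R) (hx : NF R w x) (hy : NF R w y) : NF R w (x + y) := by
  obtain ⟨a, ha⟩ := hx
  obtain ⟨b, hb⟩ := hy
  refine ⟨a + b, ?_⟩
  have h : (x + y) * w ^ (a + b) = x * w ^ a * w ^ b + y * w ^ b * w ^ a := by ring
  rw [h]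
  exact R.add_mem (R.mul_mem ha (R.pow_mem hw b)) (R.mul_mem hb (R.pow_mem hw a))

theorem mul {x y : K} (hx : NF R w x) (hy : NF R w y) : NF R w (x * y) := by
  obtain ⟨a, ha⟩ := hx
  obtain ⟨b, hb⟩ := hy
  refine ⟨a + b, ?_⟩
  have h : x * y * w ^ (a + b) = (x * w ^ a) * (y * w ^ b) := by ring
  rw [h]
  exact R.mul_mem ha hb

theorem pow {x : K} (hx : NF R w x) (n : ℕ) : NF R w (x ^ n) := by
  induction n with
  | zero => rw [pow_zero]; exact one
  | succ n ih => rw [pow_succ]; exact ih.mul hx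

theorem sum {ι : Type} (s : Finset ι) (f : ι → K) (hw : w ∈ R) (h : ∀ i ∈ s, NF R w (f i)) :
    NF R w (∑ i ∈ s, f i) :=
  Finset.sum_induction f (NF R w) (fun _ _ ha hb => ha.add hw hb) zero h

theorem prod {ι : Type} (s : Finset ι) (f : ι → K) (h : ∀ i ∈ s, NF R w (f i)) : NF R w (∏ i ∈ s, f i) :=
  Finset.prod_induction f (NF R w) (fun _ _ ha hb => ha.mul hb) one h

theorem zpow {x : K} (hx : NF R w x) (hxi : NF R w x⁻¹) (n : ℤ) : NF R w (x ^ n) := by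
  obtain ⟨m, rfl | rfl⟩ := Int.eq_nat_or_neg n
  · rw [zpow_natCast]; exact hx.pow m
  · rw [zpow_neg, zpow_natCast, ← inv_pow]; exact hxi.pow m

theorem zpow_of_nonneg {x : K} (hx : NF R w x) {n : ℤ} (hn : 0 ≤ n) : NF R w (x ^ n) := by
  obtain ⟨m, rfl⟩ := Int.eq_ofNat_of_zero_le hn
  rw [zpow_natCast]; exact hx.pow m

end NF

/-- Non-negative integer powers stay in a subring. [folklore] -/
theorem zpow_mem_of_nonneg {K : Type} [Field K] {B : Subring K} {a : K} (ha : a ∈ B) {n : ℤ} (hn : 0 ≤ n) : a ^ n ∈ B := by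
  obtain ⟨m, rfl⟩ := Int.eq_ofNat_of_zero_le hn
  rw [zpow_natCast]; exact pow_mem ha m

/-- Integer powers of an element whose inverse is also in the subring stay in the subring. [folklore] -/
theorem zpow_mem_of_inv_mem {K : Type} [Field K] {B : Subring K} {a : K} (ha : a ∈ B) (hai : a⁻¹ ∈ B) (n : ℤ) : a ^ n ∈ B := by
  obtain ⟨m, rfl | rfl⟩ := Int.eq_nat_or_neg n
  · rw [zpow_natCast]; exact pow_mem ha m
  · rw [zpow_neg, zpow_natCast, ← inv_pow]; exact pow_mem hai m

/-- **PORT 4 (§13 = §4′ of the memo: the chart algebra is regular and carries a regular parameter in `M`).  Size M–L.  PROVED (rev 4).**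
As realised below: (a) uses the ARC PACKAGE (`Theorems…CleanLU3ArcPackage`: `ringKrullDim_eq_of_fg_of_le`, `ringKrullDim_locAtCentre_eq_of_isMaximal`)
instead of the `TwistModel` pattern, and (c) does NOT need `𝔫` maximal — `𝔫 := F⁻¹ 𝔪` PRIME suffices, `P := κ_T[U]_𝔫` is a regular local domain
(`IsRegularRing` of a polynomial ring over a field, Mathlib) whose dimension is pinned to `3 - ρ` by the surjection `P ↠ S⧸𝔞` and Krull's
height theorem (`localization_mvPolynomial_regular_of_surjective`, `natCast_sub_le_ringKrullDim_quotient_span`).  Original recipe (rev 1): `A'' := Algebra.adjoin k (gens A₂ ∪ range u ∪ {(u j)⁻¹ | ρ ≤ j} ∪ t)` (`⊆ O`: `hA₂O`, `hupos`, `huzero`; `A ≤ A''`: `ht`; f.g.);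
`S := locAtCentre A''.toSubring O` (local Noetherian, dominated); `T := locAtCentre A₂.toSubring O ≤ S` (monotonicity of `locAtCentre`,
value-`1` elements of `A₂` are units of `S`).  (a) `dim S = 3`: centre of `O` on `A''` MAXIMAL (`hzd`, `A.toSubring ≤ A''.toSubring`),
`dim A'' = trdeg_k K = 3` — the pattern of ✓ `TwistModel.locAtCentre_port_inputs` (`ringKrullDim_localization_atPrime_eq_of_isMaximal`,
`exists_ringKrullDim_eq_and_trdeg_eq`, `locAtCentreEquiv`).  (b) `𝔞 := Ideal.span (range (u ∘ Fin.castLE _) : j < ρ)`; `𝔪_T · S ⊆ 𝔞` from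
`hz` + `hzu` (some `d j ≥ 1`, `j < ρ`; `u_{≥ρ}^{±1}`, `ε` units of `S`).  (c) `F : κ_T[U_{ρ}, …, U₂] → S ⧸ 𝔞` (`Ideal.Quotient.lift` of
`T → S → S⧸𝔞`, which kills `𝔪_T`, then `MvPolynomial.aeval ū`); `𝔫 := F⁻¹ 𝔪` is MAXIMAL by ✓ `ChartSurjection.ker_isMaximal_of_isAlgebraic`
+ `comap_maximalIdeal_eq_ker_residue` (`κ_S` algebraic over `k`: `A''⧸centre` is a field finitely generated over `k`); SURJECTIVITY of
the localised map `P := κ_T[U]_𝔫 → S⧸𝔞` by ✓ `lift_surjective_of_normal_form` + `primeCompl_comap_maximalIdeal` with `R₀ :=` polynomials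
in `u` with `T`-coefficients and the NORMAL FORM: `s = b/c`, `b, c ∈ A'' ⊆ B := T[u_{<ρ}, u_{≥ρ}^{±1}]` (generators: `gens A₂ ∈ T`,
`u`, `u_{≥ρ}⁻¹`, and `a ∈ t` by `htu`; `k ⊆ A₂ ⊆ T`), clearing the negative powers of the units `u_{≥ρ}`.  (d) `P` regular local domain
of dimension `3 − ρ`: ✓ `RegularityCriterion.mvPolynomial_localization_regular`.  (e) ✓ `regular_of_regular_quotient` (`n = 3`, `hρn` from
`hρ`): `S` REGULAR and lifts of regular parameters of `P` are regular parameters of `S`.  (f) ✓ `exists_generator_map_not_mem_sq`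
(`dim P = 3 − ρ ≠ 0` by `hρ`; `(span G₀).map ι = 𝔪_P` by `IsLocalization.AtPrime.map_eq_maximalIdeal`, `G₀ :=` polynomial generators of `𝔫`,
Hilbert basis) gives a polynomial `π ∈ 𝔫`, `ι π ∉ 𝔪_P²`; lift its coefficients along the residue map `T → κ_T` to `Π ∈ T[U]`,
`ψ := Π(u_{≥ρ}) ∈ S` with `ψ mod 𝔞 = F π` by construction, so `ψ ∈ 𝔪_S ∖ 𝔪_S²` by (e); and `(ψ : K) ∈ M` by `hA₂M` + `huM`.
(Hand proof: memo §13 (a)–(f), paper-verified by the critic, bus TRIAGE-71/73.) -/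
theorem port_regularParameter (p : ℕ) [Fact p.Prime] {k : Type} [Field k] [CharP k p]
    {K : Type} [Field K] [Algebra k K] (O : ValuationSubring K) (A : Subalgebra k K)
    (hAO : A.toSubring ≤ O.toSubring) (hAfg : A.FG) [IsFractionRing A K] (hdimA : ringKrullDim A ≤ 3)
    (hdim3 : ringKrullDim (locAtCentre A.toSubring O) = 3)
    (hzd : ∀ (T : Subring K) (hT : T ≤ O.toSubring), A.toSubring ≤ T → (subringCentre T O hT).IsMaximal)
    (M : Subfield K) (A₂ : Subalgebra k K) (hA₂O : A₂.toSubring ≤ O.toSubring) (hA₂fg : A₂.FG)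
    (hApA₂ : ∀ a ∈ A, a ^ p ∈ A₂) (hA₂M : ∀ r : K, r ∈ locAtCentre A₂.toSubring O → r ∈ M)
    (hreg₂ : IsRegularLocalRing (locAtCentre A₂.toSubring O)) (z : Fin 3 → locAtCentre A₂.toSubring O)
    (hz : Ideal.span (Set.range z) = IsLocalRing.maximalIdeal (locAtCentre A₂.toSubring O))
    (hdimT : ringKrullDim (locAtCentre A₂.toSubring O) = 3)
    (t : Finset K) (ht : Algebra.adjoin k (t : Set K) = A)
    (ρ : ℕ) (hρ : ρ = 1 ∨ ρ = 2) (u : Fin 3 → K) (hu0 : ∀ j, u j ≠ 0)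
    (hupos : ∀ j : Fin 3, (j : ℕ) < ρ → O.valuation (u j) < 1)
    (huzero : ∀ j : Fin 3, ρ ≤ (j : ℕ) → O.valuation (u j) = 1)
    (huM : ∀ j : Fin 3, ρ ≤ (j : ℕ) → u j ∈ M)
    (hzu : ∀ i : Fin 3, ∃ (ε : K) (d : Fin 3 → ℤ), ε ∈ locAtCentre A₂.toSubring O ∧ O.valuation ε = 1 ∧
      (∀ j : Fin 3, (j : ℕ) < ρ → 0 ≤ d j) ∧ (∃ j : Fin 3, (j : ℕ) < ρ ∧ 0 < d j) ∧ ((z i : K)) = ε * ∏ j, u j ^ d j)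
    (htu : ∀ a ∈ t, ∃ (ν : Fin p × Fin p → K) (d : Fin p × Fin p → Fin 3 → ℤ),
      (∀ l, ν l = 0 ∨ (ν l ∈ locAtCentre A₂.toSubring O ∧ O.valuation (ν l) = 1)) ∧
      (∀ l, ∀ j : Fin 3, (j : ℕ) < ρ → 0 ≤ d l j) ∧ a = ∑ l, ν l * ∏ j, u j ^ d l j) :
    ∃ (A'' : Subalgebra k K), A''.toSubring ≤ O.toSubring ∧ A ≤ A'' ∧ A''.FG ∧
      ∃ (_ : IsRegularLocalRing (locAtCentre A''.toSubring O)) (ψ : locAtCentre A''.toSubring O),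
        ψ ∈ IsLocalRing.maximalIdeal (locAtCentre A''.toSubring O) ∧
        ψ ∉ (IsLocalRing.maximalIdeal (locAtCentre A''.toSubring O)) ^ 2 ∧ (ψ : K) ∈ M := by
  classical
  /- (rev 4, res-B-lens-5 g10) PORT 4 PROVED — memo §13 (a)–(f) with ONE simplification: the maximality of `𝔫` (§13 (c1), Zariski) is
  not needed; `P := κ_T[U]_𝔫` at the PRIME `𝔫 = F⁻¹(𝔪)` is a regular local domain whose dimension is pinned to `3 - ρ` by the surjection
  `P ↠ S⧸𝔞` and Krull (`localization_mvPolynomial_regular_of_surjective`). -/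
  have hρ3 : ρ ≤ 3 := by rcases hρ with rfl | rfl <;> norm_num
  obtain ⟨gens₂, hgens₂⟩ := hA₂fg
  have hk : ∀ c : k, algebraMap k K c ∈ A₂ := fun c => A₂.algebraMap_mem c
  have hgensA₂ : ∀ g ∈ gens₂, g ∈ A₂ := fun g hg => by
    rw [← hgens₂]; exact Algebra.subset_adjoin (Finset.mem_coe.mpr hg)
  have htA : ∀ a ∈ t, a ∈ A := fun a ha => by
    rw [← ht]; exact Algebra.subset_adjoin (Finset.mem_coe.mpr ha)
  have huO : ∀ j, u j ∈ O := fun j => (O.valuation_le_one_iff _).mp (by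
    by_cases hj : (j : ℕ) < ρ
    · exact (hupos j hj).le
    · exact (huzero j (not_lt.mp hj)).le)
  have huinvO : ∀ j : Fin 3, ρ ≤ (j : ℕ) → (u j)⁻¹ ∈ O := fun j hj =>
    (O.valuation_le_one_iff _).mp (by rw [map_inv₀, huzero j hj, inv_one])
  -- §13 (a): the chart algebra `A'' = k[gens A₂, u, u_{≥ρ}⁻¹, t]` and its local ring `S = locAtCentre A'' O`
  set Z : Finset (Fin 3) := Finset.univ.filter (fun j => ρ ≤ (j : ℕ)) with hZdef
  have hZ : ∀ j : Fin 3, j ∈ Z ↔ ρ ≤ (j : ℕ) := fun j => by simp [hZdef]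
  set G : Finset K := gens₂ ∪ Finset.univ.image u ∪ Z.image (fun j => (u j)⁻¹) ∪ t with hGdef
  have hGgens : ∀ g ∈ gens₂, g ∈ G := fun g hg => by
    rw [hGdef]; exact Finset.mem_union_left _ (Finset.mem_union_left _ (Finset.mem_union_left _ hg))
  have hGu : ∀ j, u j ∈ G := fun j => by
    rw [hGdef]
    exact Finset.mem_union_left _ (Finset.mem_union_left _ (Finset.mem_union_right _
      (Finset.mem_image.mpr ⟨j, Finset.mem_univ _, rfl⟩)))
  have hGuinv : ∀ j : Fin 3, ρ ≤ (j : ℕ) → (u j)⁻¹ ∈ G := fun j hj => by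
    rw [hGdef]
    exact Finset.mem_union_left _ (Finset.mem_union_right _ (Finset.mem_image.mpr ⟨j, (hZ j).mpr hj, rfl⟩))
  have hGt : ∀ a ∈ t, a ∈ G := fun a ha => by rw [hGdef]; exact Finset.mem_union_right _ ha
  have hGcases : ∀ x ∈ G, x ∈ gens₂ ∨ (∃ j, x = u j) ∨ (∃ j : Fin 3, ρ ≤ (j : ℕ) ∧ x = (u j)⁻¹) ∨ x ∈ t := by
    intro x hx
    rw [hGdef] at hx
    rcases Finset.mem_union.mp hx with hx | hx
    · rcases Finset.mem_union.mp hx with hx | hx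
      · rcases Finset.mem_union.mp hx with hx | hx
        · exact Or.inl hx
        · obtain ⟨j, -, rfl⟩ := Finset.mem_image.mp hx
          exact Or.inr (Or.inl ⟨j, rfl⟩)
      · obtain ⟨j, hj, rfl⟩ := Finset.mem_image.mp hx
        exact Or.inr (Or.inr (Or.inl ⟨j, (hZ j).mp hj, rfl⟩))
    · exact Or.inr (Or.inr (Or.inr hx))
  set A'' : Subalgebra k K := Algebra.adjoin k (G : Set K) with hA''def
  have hGA'' : ∀ x ∈ G, x ∈ A'' := fun x hx => Algebra.subset_adjoin (Finset.mem_coe.mpr hx)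
  let Oₖ : Subalgebra k K :=
    { O.toSubring with algebraMap_mem' := fun c => hA₂O (A₂.algebraMap_mem c) }
  have hGO : (G : Set K) ⊆ (Oₖ : Set K) := by
    intro x hx
    change x ∈ O
    rcases hGcases x (Finset.mem_coe.mp hx) with hx | ⟨j, rfl⟩ | ⟨j, hj, rfl⟩ | hx
    · exact hA₂O (hgensA₂ x hx)
    · exact huO j
    · exact huinvO j hj
    · exact hAO (htA x hx)
  have hA''O : A''.toSubring ≤ O.toSubring := fun x hx => (Algebra.adjoin_le hGO : A'' ≤ Oₖ) hx
  have hAA'' : A ≤ A'' := by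
    rw [← ht]; exact Algebra.adjoin_le fun x hx => hGA'' x (hGt x (Finset.mem_coe.mp hx))
  have hA₂A'' : A₂ ≤ A'' := by
    rw [← hgens₂]; exact Algebra.adjoin_le fun x hx => hGA'' x (hGgens x (Finset.mem_coe.mp hx))
  have hA''fg : A''.FG := ⟨G, hA''def.symm⟩
  have huA'' : ∀ j, u j ∈ A'' := fun j => hGA'' _ (hGu j)
  have huS : ∀ j, u j ∈ locAtCentre A''.toSubring O := fun j => le_locAtCentre _ O (huA'' j)
  have hTS : locAtCentre A₂.toSubring O ≤ locAtCentre A''.toSubring O := locAtCentre_mono O (fun x hx => hA₂A'' hx)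
  haveI hSloc : IsLocalRing (locAtCentre A''.toSubring O) := isLocalRing_locAtCentre hA''O
  haveI : IsLocalization.AtPrime (locAtCentre A''.toSubring O) (subringCentre A''.toSubring O hA''O) :=
    isLocalization_locAtCentre hA''O
  letI : Algebra k A''.toSubring := inferInstanceAs (Algebra k A'')
  haveI : Algebra.FiniteType k A''.toSubring := (A''.fg_iff_finiteType.mp hA''fg : Algebra.FiniteType k A'')
  haveI hSnoeth : IsNoetherianRing (locAtCentre A''.toSubring O) :=
    IsLocalization.isNoetherianRing (subringCentre A''.toSubring O hA''O).primeCompl (locAtCentre A''.toSubring O)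
      (Algebra.FiniteType.isNoetherianRing k A''.toSubring)
  -- `dim S = 3`: the centre is closed (hzd) and `dim A'' = dim A = 3`
  have hdimAeq : ringKrullDim A = 3 := ringKrullDim_eq_three_of_locAtCentre O A hAO hdimA hdim3
  have hdimA'' : ringKrullDim A'' = 3 := by
    rw [Summit.ResolutionOfSingularities.ResolutionOfSingularities.Theorems.RadicialJung.CleanModels.ringKrullDim_eq_of_fg_of_le
      hAfg hA''fg hAA'', hdimAeq]
  have hmaxS : (subringCentre A''.toSubring O hA''O).IsMaximal := hzd A''.toSubring hA''O (fun x hx => hAA'' hx)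
  have hdimS : ringKrullDim (locAtCentre A''.toSubring O) = 3 := by
    rw [Summit.ResolutionOfSingularities.ResolutionOfSingularities.Theorems.RadicialJung.CleanModels.ringKrullDim_locAtCentre_eq_of_isMaximal
      A'' hA''fg O hA''O hmaxS, hdimA'']
  have hdimS3 : ringKrullDim (locAtCentre A''.toSubring O) = ((3 : ℕ) : WithBot ℕ∞) := by rw [hdimS]; norm_cast
  -- §13 (b): `𝔞 := (u_{<ρ})` contains `𝔪_T · S`
  set uS : Fin 3 → locAtCentre A''.toSubring O := fun j => ⟨u j, huS j⟩ with huSdef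
  set uρ : Fin ρ → locAtCentre A''.toSubring O := fun i => uS (Fin.castLE hρ3 i) with huρdef
  have huρ : ∀ i, uρ i ∈ maximalIdeal (locAtCentre A''.toSubring O) := fun i =>
    (mem_maximalIdeal_locAtCentre_iff hA''O _).mpr (hupos (Fin.castLE hρ3 i) (by simp))
  have huS𝔞 : ∀ j : Fin 3, (j : ℕ) < ρ → uS j ∈ Ideal.span (Set.range uρ) := fun j hj =>
    Ideal.subset_span ⟨⟨j, hj⟩, congrArg uS (Fin.ext rfl)⟩
  set ι : locAtCentre A₂.toSubring O →+* locAtCentre A''.toSubring O := Subring.inclusion hTS with hιdef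
  have hιval : ∀ a, ((ι a : locAtCentre A''.toSubring O) : K) = a := fun a => rfl
  have hzS : ∀ i : Fin 3, ι (z i) ∈ Ideal.span (Set.range uρ) := by
    intro i
    obtain ⟨ε, d, hεT, hεv, hdnn, ⟨j₀, hj₀, hdj₀⟩, hzi⟩ := hzu i
    set d' : Fin 3 → ℤ := Function.update d j₀ (d j₀ - 1) with hd'def
    have hd'j₀ : d' j₀ = d j₀ - 1 := by rw [hd'def, Function.update_self]
    have hd'ne : ∀ j, j ≠ j₀ → d' j = d j := fun j hj => by rw [hd'def, Function.update_of_ne hj]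
    have hd'nn : ∀ j : Fin 3, (j : ℕ) < ρ → 0 ≤ d' j := by
      intro j hj
      by_cases hjj : j = j₀
      · rw [hjj, hd'j₀]; omega
      · rw [hd'ne j hjj]; exact hdnn j hj
    have hw'mem : ε * ∏ j, u j ^ d' j ∈ locAtCentre A''.toSubring O := by
      refine mul_mem (hTS hεT) (prod_mem fun j _ => ?_)
      by_cases hj : (j : ℕ) < ρ
      · exact zpow_mem_of_nonneg (huS j) (hd'nn j hj)
      · exact zpow_mem_of_inv_mem (huS j) (inv_mem_locAtCentre (huS j) (huzero j (not_lt.mp hj))) (d' j)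
    have he : ∏ j ∈ Finset.univ.erase j₀, u j ^ d' j = ∏ j ∈ Finset.univ.erase j₀, u j ^ d j :=
      Finset.prod_congr rfl fun j hj => by rw [hd'ne j (Finset.ne_of_mem_erase hj)]
    have hsplit : ε * ∏ j, u j ^ d j = (ε * ∏ j, u j ^ d' j) * u j₀ := by
      rw [← Finset.mul_prod_erase Finset.univ (fun j => u j ^ d j) (Finset.mem_univ j₀),
        ← Finset.mul_prod_erase Finset.univ (fun j => u j ^ d' j) (Finset.mem_univ j₀)]
      show ε * (u j₀ ^ d j₀ * ∏ j ∈ Finset.univ.erase j₀, u j ^ d j) =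
        ε * (u j₀ ^ d' j₀ * ∏ j ∈ Finset.univ.erase j₀, u j ^ d' j) * u j₀
      rw [he, hd'j₀, zpow_sub_one₀ (hu0 j₀)]
      have h0 : (u j₀)⁻¹ * u j₀ = 1 := inv_mul_cancel₀ (hu0 j₀)
      calc ε * (u j₀ ^ d j₀ * ∏ j ∈ Finset.univ.erase j₀, u j ^ d j)
          = ε * (u j₀ ^ d j₀ * ((u j₀)⁻¹ * u j₀) * ∏ j ∈ Finset.univ.erase j₀, u j ^ d j) := by rw [h0, mul_one]
        _ = ε * (u j₀ ^ d j₀ * (u j₀)⁻¹ * ∏ j ∈ Finset.univ.erase j₀, u j ^ d j) * u j₀ := by ring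
    have hιz : ι (z i) = ⟨ε * ∏ j, u j ^ d' j, hw'mem⟩ * uS j₀ := by
      apply Subtype.ext
      show ((z i : K)) = (ε * ∏ j, u j ^ d' j) * u j₀
      rw [hzi, hsplit]
    rw [hιz]
    exact Ideal.mul_mem_left _ _ (huS𝔞 j₀ hj₀)
  -- §13 (c): `E := S ⧸ 𝔞` is local; `F₁ : κ_T → E` (`𝔪_T ↦ 0`), `F : κ_T[U_{≥ρ}] → E`, `𝔫 := F⁻¹ 𝔪_E`, `P := κ_T[U]_𝔫`
  have h𝔞m : Ideal.span (Set.range uρ) ≤ maximalIdeal (locAtCentre A''.toSubring O) := by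
    rw [Ideal.span_le]; rintro _ ⟨i, rfl⟩; exact huρ i
  have h𝔞top : Ideal.span (Set.range uρ) ≠ ⊤ := fun h =>
    (maximalIdeal.isMaximal (locAtCentre A''.toSubring O)).ne_top (top_le_iff.mp (h ▸ h𝔞m))
  haveI : Nontrivial (locAtCentre A''.toSubring O ⧸ Ideal.span (Set.range uρ)) :=
    Ideal.Quotient.nontrivial_iff.mpr h𝔞top
  haveI : IsLocalRing (locAtCentre A''.toSubring O ⧸ Ideal.span (Set.range uρ)) :=
    IsLocalRing.of_surjective' (Ideal.Quotient.mk _) Ideal.Quotient.mk_surjective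
  have hkill : ∀ a ∈ maximalIdeal (locAtCentre A₂.toSubring O),
      ((Ideal.Quotient.mk (Ideal.span (Set.range uρ))).comp ι) a = 0 := by
    have hmap : (maximalIdeal (locAtCentre A₂.toSubring O)).map ι ≤ Ideal.span (Set.range uρ) := by
      rw [← hz, Ideal.map_span, Ideal.span_le]
      rintro _ ⟨_, ⟨i, rfl⟩, rfl⟩
      exact hzS i
    intro a ha
    rw [RingHom.comp_apply, Ideal.Quotient.eq_zero_iff_mem]
    exact hmap (Ideal.mem_map_of_mem ι ha)
  set F₁ : ResidueField (locAtCentre A₂.toSubring O) →+* (locAtCentre A''.toSubring O ⧸ Ideal.span (Set.range uρ)) :=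
    Ideal.Quotient.lift (maximalIdeal (locAtCentre A₂.toSubring O))
      ((Ideal.Quotient.mk (Ideal.span (Set.range uρ))).comp ι) hkill with hF₁def
  have hF₁ : ∀ a, F₁ (residue _ a) = Ideal.Quotient.mk _ (ι a) := fun a => by
    rw [hF₁def]; exact Ideal.Quotient.lift_mk _ _ _
  set zI : Fin (3 - ρ) → Fin 3 := fun i => ⟨ρ + (i : ℕ), by have := i.2; omega⟩ with hzIdef
  have hzIval : ∀ i, ((zI i : Fin 3) : ℕ) = ρ + (i : ℕ) := fun i => rfl
  have hzIρ : ∀ i, ρ ≤ ((zI i : Fin 3) : ℕ) := fun i => by rw [hzIval]; omega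
  set F : MvPolynomial (Fin (3 - ρ)) (ResidueField (locAtCentre A₂.toSubring O)) →+*
      (locAtCentre A''.toSubring O ⧸ Ideal.span (Set.range uρ)) :=
    MvPolynomial.eval₂Hom F₁ (fun i => Ideal.Quotient.mk (Ideal.span (Set.range uρ)) (uS (zI i))) with hFdef
  have hFC : ∀ r, F (MvPolynomial.C r) = F₁ r := fun r => by rw [hFdef]; exact MvPolynomial.eval₂Hom_C _ _ r
  have hFX : ∀ i, F (MvPolynomial.X i) = Ideal.Quotient.mk (Ideal.span (Set.range uρ)) (uS (zI i)) := fun i => by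
    rw [hFdef]; exact MvPolynomial.eval₂Hom_X' _ _ i
  set 𝔫 : Ideal (MvPolynomial (Fin (3 - ρ)) (ResidueField (locAtCentre A₂.toSubring O))) :=
    (maximalIdeal (locAtCentre A''.toSubring O ⧸ Ideal.span (Set.range uρ))).comap F with h𝔫def
  haveI h𝔫prime : 𝔫.IsPrime := Ideal.IsPrime.comap F
  obtain ⟨hunit, h𝔫u⟩ := primeCompl_comap_maximalIdeal F
  -- the normal form on `A''`: `R₀ := T[u] ⊆ S`, `w := ∏_{j ≥ ρ} u_j`, every `x ∈ A''` has `x · w^N ∈ R₀`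
  set R₀ : Subring K := Subring.closure ((locAtCentre A₂.toSubring O : Set K) ∪ Set.range u) with hR₀def
  have hTR₀ : ∀ x ∈ locAtCentre A₂.toSubring O, x ∈ R₀ := fun x hx => by
    rw [hR₀def]; exact Subring.subset_closure (Or.inl hx)
  have huR₀ : ∀ j, u j ∈ R₀ := fun j => by rw [hR₀def]; exact Subring.subset_closure (Or.inr ⟨j, rfl⟩)
  have hR₀S : R₀ ≤ locAtCentre A''.toSubring O := by
    rw [hR₀def, Subring.closure_le]
    rintro x (hx | ⟨j, rfl⟩)
    · exact hTS hx
    · exact huS j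
  set w : K := ∏ j ∈ Z, u j with hwdef
  have hwv : O.valuation w = 1 := by
    rw [hwdef, map_prod]; exact Finset.prod_eq_one fun j hj => huzero j ((hZ j).mp hj)
  have hwR₀ : w ∈ R₀ := by rw [hwdef]; exact prod_mem fun j _ => huR₀ j
  have huinv : ∀ j ∈ Z, NF R₀ w (u j)⁻¹ := by
    intro j hj
    refine ⟨1, ?_⟩
    rw [pow_one, hwdef, ← Finset.mul_prod_erase Z u hj, inv_mul_cancel_left₀ (hu0 j)]
    exact prod_mem fun i _ => huR₀ i
  have hNF : ∀ x ∈ A'', NF R₀ w x := by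
    intro x hx
    rw [hA''def] at hx
    induction hx using Algebra.adjoin_induction with
    | mem x hx =>
      rcases hGcases x (Finset.mem_coe.mp hx) with hx | ⟨j, rfl⟩ | ⟨j, hj, rfl⟩ | hx
      · exact NF.of_mem (hTR₀ x (le_locAtCentre _ O (hgensA₂ x hx)))
      · exact NF.of_mem (huR₀ j)
      · exact huinv j ((hZ j).mpr hj)
      · obtain ⟨ν, d, hν, hd, rfl⟩ := htu x hx
        refine NF.sum _ _ hwR₀ fun l _ => NF.mul ?_ (NF.prod _ _ fun j _ => ?_)
        · rcases hν l with h0 | ⟨hνT, -⟩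
          · rw [h0]; exact NF.zero
          · exact NF.of_mem (hTR₀ _ hνT)
        · by_cases hj : (j : ℕ) < ρ
          · exact (NF.of_mem (huR₀ j)).zpow_of_nonneg (hd l j hj)
          · exact (NF.of_mem (huR₀ j)).zpow (huinv j ((hZ j).mpr (not_lt.mp hj))) (d l j)
    | algebraMap c => exact NF.of_mem (hTR₀ _ (le_locAtCentre _ O (hk c)))
    | add x y hx hy ihx ihy => exact ihx.add hwR₀ ihy
    | mul x y hx hy ihx ihy => exact ihx.mul ihy
  -- (c2) normal form of the fractions `s = y / x ∈ S` and the preimages under `F`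
  have hloc : ∀ s : locAtCentre A''.toSubring O, ∃ b c : locAtCentre A''.toSubring O,
      b ∈ {s : locAtCentre A''.toSubring O | (s : K) ∈ R₀} ∧ c ∈ {s : locAtCentre A''.toSubring O | (s : K) ∈ R₀} ∧
      IsUnit (Ideal.Quotient.mk (Ideal.span (Set.range uρ)) c) ∧ s * c - b ∈ Ideal.span (Set.range uρ) := by
    intro s
    obtain ⟨y, hy, x, hx, hxv, hs⟩ := (mem_locAtCentre_iff).mp s.2
    obtain ⟨N₁, hN₁⟩ := hNF y hy
    obtain ⟨N₂, hN₂⟩ := hNF x hx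
    have hb : y * w ^ N₁ * w ^ N₂ ∈ R₀ := R₀.mul_mem hN₁ (R₀.pow_mem hwR₀ N₂)
    have hc : x * w ^ N₂ * w ^ N₁ ∈ R₀ := R₀.mul_mem hN₂ (R₀.pow_mem hwR₀ N₁)
    refine ⟨⟨_, hR₀S hb⟩, ⟨_, hR₀S hc⟩, hb, hc, ?_, ?_⟩
    · refine IsUnit.map _ (notMem_maximalIdeal.mp fun hm => ?_)
      have hlt : O.valuation (x * w ^ N₂ * w ^ N₁) < 1 := (mem_maximalIdeal_locAtCentre_iff hA''O _).mp hm
      rw [map_mul, map_mul, map_pow, map_pow, hxv, hwv, one_pow, one_pow, mul_one, mul_one] at hlt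
      exact lt_irrefl _ hlt
    · have h0 : x ≠ 0 := ne_zero_of_valuation_eq_one hxv
      have hzero : s * ⟨_, hR₀S hc⟩ - ⟨_, hR₀S hb⟩ = (0 : locAtCentre A''.toSubring O) := by
        apply Subtype.ext
        show (s : K) * (x * w ^ N₂ * w ^ N₁) - y * w ^ N₁ * w ^ N₂ = 0
        rw [hs, sub_eq_zero]
        calc y / x * (x * w ^ N₂ * w ^ N₁) = (y / x * x) * (w ^ N₂ * w ^ N₁) := by ring
          _ = y * w ^ N₁ * w ^ N₂ := by rw [div_mul_cancel₀ y h0]; ring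
      rw [hzero]; exact Ideal.zero_mem _
  have hF : ∀ b ∈ {s : locAtCentre A''.toSubring O | (s : K) ∈ R₀},
      Ideal.Quotient.mk (Ideal.span (Set.range uρ)) b ∈ F.range := by
    have key : ∀ x ∈ R₀, ∃ hx : x ∈ locAtCentre A''.toSubring O,
        Ideal.Quotient.mk (Ideal.span (Set.range uρ)) ⟨x, hx⟩ ∈ F.range := by
      intro x hx
      rw [hR₀def] at hx
      induction hx using Subring.closure_induction with
      | mem x hx =>
        rcases hx with hx | ⟨j, rfl⟩
        · refine ⟨hTS hx, RingHom.mem_range.mpr ⟨MvPolynomial.C (residue _ ⟨x, hx⟩), ?_⟩⟩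
          rw [hFC, hF₁]
          rfl
        · by_cases hj : (j : ℕ) < ρ
          · refine ⟨huS j, RingHom.mem_range.mpr ⟨0, ?_⟩⟩
            rw [map_zero]
            exact (Ideal.Quotient.eq_zero_iff_mem.mpr (huS𝔞 j hj)).symm
          · have hj3 : (j : ℕ) - ρ < 3 - ρ := by have := j.2; omega
            refine ⟨huS j, RingHom.mem_range.mpr ⟨MvPolynomial.X ⟨(j : ℕ) - ρ, hj3⟩, ?_⟩⟩
            rw [hFX]
            have hjj : zI ⟨(j : ℕ) - ρ, hj3⟩ = j := Fin.ext (by rw [hzIval]; simp only; omega)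
            rw [hjj]
      | zero => exact ⟨Subring.zero_mem _, RingHom.mem_range.mpr ⟨0, by rw [map_zero]; exact (map_zero _).symm⟩⟩
      | one => exact ⟨Subring.one_mem _, RingHom.mem_range.mpr ⟨1, by rw [map_one]; exact (map_one _).symm⟩⟩
      | add x y hx hy ihx ihy =>
        obtain ⟨hxS, hx'⟩ := ihx
        obtain ⟨hyS, hy'⟩ := ihy
        obtain ⟨qx, hqx⟩ := RingHom.mem_range.mp hx'
        obtain ⟨qy, hqy⟩ := RingHom.mem_range.mp hy'
        exact ⟨add_mem hxS hyS, RingHom.mem_range.mpr ⟨qx + qy, by rw [map_add, hqx, hqy, ← map_add]; rfl⟩⟩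
      | neg x hx ih =>
        obtain ⟨hxS, hx'⟩ := ih
        obtain ⟨qx, hqx⟩ := RingHom.mem_range.mp hx'
        exact ⟨neg_mem hxS, RingHom.mem_range.mpr ⟨-qx, by rw [map_neg, hqx, ← map_neg]; rfl⟩⟩
      | mul x y hx hy ihx ihy =>
        obtain ⟨hxS, hx'⟩ := ihx
        obtain ⟨hyS, hy'⟩ := ihy
        obtain ⟨qx, hqx⟩ := RingHom.mem_range.mp hx'
        obtain ⟨qy, hqy⟩ := RingHom.mem_range.mp hy'
        exact ⟨mul_mem hxS hyS, RingHom.mem_range.mpr ⟨qx * qy, by rw [map_mul, hqx, hqy, ← map_mul]; rfl⟩⟩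
    intro b hb
    obtain ⟨hbS, h⟩ := key (b : K) hb
    exact h
  have hf : Function.Surjective (IsLocalization.lift (S := Localization.AtPrime 𝔫) hunit) :=
    lift_surjective_of_normal_form (P := Localization.AtPrime 𝔫) _ _ hloc F hF 𝔫 hunit h𝔫u
  -- §13 (d): `P` is a regular local domain of dimension `3 - ρ` (pinned by the surjection)
  have hEdim : ((3 - ρ : ℕ) : WithBot ℕ∞) ≤ ringKrullDim (locAtCentre A''.toSubring O ⧸ Ideal.span (Set.range uρ)) :=
    natCast_sub_le_ringKrullDim_quotient_span (n := 3) hdimS3 uρ huρ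
  obtain ⟨hPreg, hPdom, hdimP⟩ :=
    localization_mvPolynomial_regular_of_surjective (ResidueField (locAtCentre A₂.toSubring O)) (3 - ρ) 𝔫 _ hf hEdim
  -- §13 (e): the criterion — `S` is REGULAR and lifts of regular parameters of `P` are regular parameters of `S`
  obtain ⟨hregS, -, -, hlift1, hlift2⟩ :=
    regular_of_regular_quotient (n := 3) (ρ := ρ) hdimS3 hρ3 uρ huρ hdimP (IsLocalization.lift hunit) hf
  -- §13 (f): a generator `q ∈ 𝔫` mapping to a regular parameter of `P`, its lift `ψ ∈ T[u_{≥ρ}] ⊆ S`, and `ψ ∈ M`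
  have hdimP0 : ringKrullDim (Localization.AtPrime 𝔫) ≠ 0 := by
    rw [hdimP]
    have h : (3 - ρ : ℕ) ≠ 0 := by omega
    exact_mod_cast h
  obtain ⟨q, hq𝔫, hq1, hq2⟩ := exists_generator_map_not_mem_sq hdimP0 (algebraMap _ (Localization.AtPrime 𝔫))
    (𝔫 : Set (MvPolynomial (Fin (3 - ρ)) (ResidueField (locAtCentre A₂.toSubring O))))
    (by rw [Ideal.span_eq]; exact Localization.AtPrime.map_eq_maximalIdeal)
  have hres : ∀ e : Fin (3 - ρ) →₀ ℕ, ∃ c : locAtCentre A₂.toSubring O, residue _ c = q.coeff e := fun e =>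
    Ideal.Quotient.mk_surjective (q.coeff e)
  choose lam hlam using hres
  set ψ : locAtCentre A''.toSubring O := ∑ e ∈ q.support, ι (lam e) * ∏ i, uS (zI i) ^ (e i) with hψdef
  have hψF : Ideal.Quotient.mk (Ideal.span (Set.range uρ)) ψ = F q := by
    rw [hψdef, map_sum, hFdef, MvPolynomial.coe_eval₂Hom, MvPolynomial.eval₂_eq']
    refine Finset.sum_congr rfl fun e _ => ?_
    rw [map_mul, map_prod, ← hlam e, hF₁]
    simp only [map_pow]
  have hψπ : Ideal.Quotient.mk (Ideal.span (Set.range uρ)) ψ =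
      IsLocalization.lift (S := Localization.AtPrime 𝔫) hunit (algebraMap _ (Localization.AtPrime 𝔫) q) := by
    rw [IsLocalization.lift_eq]; exact hψF
  have hψM : ((ψ : locAtCentre A''.toSubring O) : K) ∈ M := by
    rw [hψdef]
    change (locAtCentre A''.toSubring O).subtype (∑ e ∈ q.support, ι (lam e) * ∏ i, uS (zI i) ^ (e i)) ∈ M
    rw [map_sum]
    refine sum_mem fun e _ => ?_
    rw [map_mul, map_prod]
    refine mul_mem (hA₂M _ (lam e).2) (prod_mem fun i _ => ?_)
    rw [map_pow]
    exact pow_mem (huM _ (hzIρ i)) _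
  exact ⟨A'', hA''O, hAA'', hA''fg, hregS, ψ, hlift1 ψ _ hψπ hq1, hlift2 ψ _ hψπ hq2, hψM⟩

end PortStubs

/-! ## §2 Kernel-checked helpers (no sorry) -/

section Helpers

variable {K : Type} [Field K]

/-- **(PB0)** (census `exponents_eq_zero_of_valuation_eq_one`, verbatim with proof).  Under (P2) for `x, y`: if `ν · (x^a y^b)`
(`a, b < p`) has value zero and `ν` has the value of a `p`-th power `z^p` (`z ≠ 0`), then `a = b = 0`. [folklore] -/
theorem exponents_eq_zero_of_valuation_eq_one {p : ℕ} (O : ValuationSubring K) {x y : K}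
    (hP : ∀ a b : ℕ, a < p → b < p → (a ≠ 0 ∨ b ≠ 0) → ∀ z : K, z ≠ 0 → O.valuation (x ^ a * y ^ b) ≠ O.valuation (z ^ p))
    {a b : ℕ} (ha : a < p) (hb : b < p) {ν z : K} (hz : z ≠ 0) (hν : O.valuation ν = O.valuation (z ^ p))
    (hval : O.valuation (ν * (x ^ a * y ^ b)) = 1) : a = 0 ∧ b = 0 := by
  by_contra hab
  have hab' : a ≠ 0 ∨ b ≠ 0 := by
    by_cases h : a = 0
    · exact Or.inr fun hb0 => hab ⟨h, hb0⟩
    · exact Or.inl h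
  rw [map_mul] at hval
  have hmono : O.valuation (x ^ a * y ^ b) = (O.valuation ν)⁻¹ := eq_inv_of_mul_eq_one_right hval
  have hzinv : z⁻¹ ≠ 0 := inv_ne_zero hz
  apply hP a b ha hb hab' z⁻¹ hzinv
  rw [hmono, hν, inv_pow, map_inv₀]

/-- Integer powers of a «unit of `T = locAtCentre B O`» (an element of value `1`) stay in `T`. [folklore] -/
theorem zpow_mem_locAtCentre {B : Subring K} {O : ValuationSubring K} {a : K}
    (ha : a ∈ locAtCentre B O) (hv : O.valuation a = 1) (n : ℤ) : a ^ n ∈ locAtCentre B O := by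
  obtain ⟨m, rfl | rfl⟩ := Int.eq_nat_or_neg n
  · rw [zpow_natCast]; exact pow_mem ha m
  · rw [zpow_neg, zpow_natCast, ← inv_pow]; exact pow_mem (inv_mem_locAtCentre ha hv) m

/-- A Laurent monomial in elements with `p`-th-power values has a `p`-th-power value. [folklore] -/
theorem exists_valuation_prod_zpow_eq (O : ValuationSubring K) {p : ℕ} (z : Fin 3 → K)
    (hzV : ∀ i, ∃ w : K, w ≠ 0 ∧ O.valuation (z i) = O.valuation (w ^ p)) (c : Fin 3 → ℤ) :
    ∃ W : K, W ≠ 0 ∧ O.valuation (∏ i, z i ^ c i) = O.valuation (W ^ p) := by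
  choose w hw0 hw using hzV
  refine ⟨∏ i, w i ^ c i, Finset.prod_ne_zero_iff.mpr fun i _ => zpow_ne_zero _ (hw0 i), ?_⟩
  rw [map_prod, ← Finset.prod_pow, map_prod]
  refine Finset.prod_congr rfl fun i _ => ?_
  rw [map_zpow₀, hw, map_pow, map_pow, map_zpow₀, ← zpow_natCast, ← zpow_mul,
    ← zpow_natCast (O.valuation (w i) ^ c i), ← zpow_mul, mul_comm]

end Helpers

/-! ## §3 The exit lemma (census §8, verbatim with proofs; no sorry) -/

section Exit

/-- An integrally-closed-in-`K` local subring `S` and `ψ ∈ 𝔪_S ∖ 𝔪_S²`: `ψ` is not a `p`-th power in `K` (`p ≥ 2`).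
(census `pow_ne_of_mem_maximalIdeal_of_not_mem_sq'`, verbatim). [folklore] -/
theorem pow_ne_of_mem_maximalIdeal_of_not_mem_sq' {K : Type} [Field K] (S : Subring K) [IsLocalRing S]
    (hic : ∀ w : K, IsIntegral S w → w ∈ S) {p : ℕ} (hp : 2 ≤ p) (ψ : S)
    (h1 : ψ ∈ IsLocalRing.maximalIdeal S) (h2 : ψ ∉ (IsLocalRing.maximalIdeal S) ^ 2) :
    ∀ w : K, w ^ p ≠ (ψ : K) := by
  intro w hw
  have hp0 : 0 < p := by omega
  have hint : IsIntegral S w := by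
    apply IsIntegral.of_pow hp0
    rw [hw]
    exact isIntegral_algebraMap (R := S) (x := ψ)
  have hwS : w ∈ S := hic w hint
  set y : S := ⟨w, hwS⟩ with hy
  have hyp : y ^ p = ψ := by
    apply Subtype.ext
    simp [hy, hw]
  have hym : y ∈ IsLocalRing.maximalIdeal S := by
    by_contra hcontra
    have hyu : IsUnit y := by
      simpa [IsLocalRing.mem_maximalIdeal, mem_nonunits_iff] using hcontra
    have hψu : IsUnit ψ := by rw [← hyp]; exact hyu.pow p
    exact (IsLocalRing.mem_maximalIdeal _ |>.mp h1) hψu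
  apply h2
  rw [← hyp]
  exact Ideal.pow_le_pow_right hp (Ideal.pow_mem_pow hym p)

/-- **EXIT LEMMA of THEOREM T** (census `cleanLUConcl_of_parameter`, verbatim).  A finitely generated `A'' ⊇ A` inside `O` with
`locAtCentre A''.toSubring O` regular, and a regular parameter `ψ ∈ 𝔪 ∖ 𝔪²` of it written `ψ = Σ_{j<p} c_j^p g₀^j`, give
`CleanLUConcl p k K O A g₀` in FORM (3) (`s := ψ`, `c′ := 0`); the representative is automatically non-trivial. [folklore] -/
theorem cleanLUConcl_of_parameter {p : ℕ} [Fact p.Prime] {k K : Type} [Field k] [Field K] [Algebra k K]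
    (O : ValuationSubring K) (A A'' : Subalgebra k K) [IsFractionRing A K]
    (hA''O : A''.toSubring ≤ O.toSubring) (hAA'' : A ≤ A'') (hA''fg : A''.FG)
    (hreg : IsRegularLocalRing (locAtCentre A''.toSubring O)) (g₀ : K)
    (ψ : locAtCentre A''.toSubring O) (hψ1 : ψ ∈ IsLocalRing.maximalIdeal (locAtCentre A''.toSubring O))
    (hψ2 : ψ ∉ (IsLocalRing.maximalIdeal (locAtCentre A''.toSubring O)) ^ 2)
    (c : Fin p → K) (hc : ∑ j : Fin p, c j ^ p * g₀ ^ (j : ℕ) = (ψ : K)) :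
    CleanLUConcl p k K O A g₀ := by
  have hpp : p.Prime := Fact.out
  haveI : NeZero p := ⟨hpp.ne_zero⟩
  haveI := hreg
  -- `Frac (locAtCentre A'' O) = K` (it contains `A`)
  haveI : IsFractionRing (locAtCentre A''.toSubring O) K := by
    refine IsFractionRing.of_field _ _ (fun z => ?_)
    obtain ⟨a, b, hb, rfl⟩ := IsFractionRing.div_surjective (A := A) z
    have haR : (a : K) ∈ locAtCentre A''.toSubring O := le_locAtCentre _ O (hAA'' a.2)
    have hbR : (b : K) ∈ locAtCentre A''.toSubring O := le_locAtCentre _ O (hAA'' b.2)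
    exact ⟨⟨a, haR⟩, ⟨b, hbR⟩, rfl⟩
  have hicIn := isIntegrallyClosedIn_of_isRegularLocalRing (locAtCentre A''.toSubring O)
  have hic : ∀ w : K, IsIntegral (locAtCentre A''.toSubring O) w → w ∈ locAtCentre A''.toSubring O := by
    intro w hw
    obtain ⟨y, hy⟩ := (IsIntegrallyClosedIn.isIntegral_iff (R := locAtCentre A''.toSubring O) (A := K)).mp hw
    rw [← hy]
    exact y.2
  -- non-triviality of the representative
  have hnt : ∃ j : Fin p, (j : ℕ) ≠ 0 ∧ c j ≠ 0 := by
    by_contra hall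
    push Not at hall
    have hsum : ∑ j : Fin p, c j ^ p * g₀ ^ (j : ℕ) = c 0 ^ p := by
      rw [Finset.sum_eq_single (0 : Fin p)]
      · simp
      · intro j _ hj
        have hj' : (j : ℕ) ≠ 0 := fun h => hj (Fin.ext (by simpa using h))
        rw [hall j hj', zero_pow hpp.ne_zero, zero_mul]
      · intro h; exact absurd (Finset.mem_univ _) h
    exact pow_ne_of_mem_maximalIdeal_of_not_mem_sq' (locAtCentre A''.toSubring O) hic hpp.two_le ψ hψ1 hψ2 (c 0)
      (by rw [← hsum, hc])
  refine ⟨A'', hA''O, hAA'', hA''fg, hreg, c, hnt, Or.inr (Or.inr ⟨ψ, 0, hc, ?_, ?_⟩)⟩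
  · simpa [zero_pow hpp.ne_zero] using hψ1
  · simpa [zero_pow hpp.ne_zero] using hψ2

end Exit

/-! ## §4 THE COMPOSITION (kernel-checked, no sorry): the four port obligations give THEOREM T's slice -/

section Composition

open AlgebraicGeometry CategoryTheory

/-- **THEOREM T's slice from the four port obligations** — modulo F-02 in its LU³ form (`hLU3 = CossartPiltant2019LU3.{0}`, e.g.
`fun k _ => hCP.lu3 k`) and F-32 (`hEmb`, the embedded-resolution input of CJS monomialisation, verbatim the binder of
✓ `TwistModel.monomialise_on_twist_model`).  SORRY-FREE; the only `sorry` it depends on in THIS file is the placeholder of PORT 3-L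
`port_toricChart_lattice`, PROVED (rev 7) with the identical statement in the companion `Lens5_PRankTwoLattice.lean` — all other ports are proved above.  Data flow = memo §5: §1 graded data → §2 monomialising model of `K^p(g₀)` (monomialising
`x^p`, `y^p` and every non-zero graded coefficient of the generators of `A`) → §3 toric chart (value-zero chart vectors land in `M` by (PB0))
→ §13 regular chart algebra with a regular parameter `ψ ∈ M = K^p(g₀)` → exit lemma, clean form (3).  The slice hypotheses `hreg`
(regularity of the input model) and `hnd` (`v` not discrete of rank one) are not used. [folklore] -/
theorem cleanLU3DefectPRankTwoAt_of_portStubs (p : ℕ) [Fact p.Prime]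
    (hLU3 : ∀ (k : Type) [Field k], LocalUniformization3 k)
    (hEmb : ∀ (Z : Scheme.{0}) [IsIntegral Z] [IsNoetherian Z], Scheme.IsRegular Z →
      Scheme.IsExcellent Z → ∀ (X : Set Z), IsClosed X → X ≠ Set.univ → topologicalKrullDim X ≤ 2 →
        ∃ (Z' : Scheme.{0}) (π : Z' ⟶ Z), IsProper π ∧ Function.Surjective π.base ∧
          (∃ U : Z.Opens, (U : Set Z) = Xᶜ ∧ IsIso (π ∣_ U)) ∧
          IsStrictNormalCrossingsDivisor Z' (π.base ⁻¹' X)) :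
    CleanLU3DefectPRankTwoAt p := by
  intro k _ _ _ K _ _ O A hAO hAfg hFrac hdimA hreg hdim3 hzd g₀ hg₀ hdefect htd hnd hP2
  classical
  haveI := hFrac
  -- §1 graded data
  obtain ⟨M, hM, hg₀M, hpM, hV, x, y, hx, hy, hvx, hvy, hP, t, ht, cf, hcfM, hsum, hcfO⟩ :=
    port_gradedData p O A hAO hAfg hdimA hdim3 g₀ hg₀ hdefect hP2
  -- the finite set to monomialise: `x^p`, `y^p` and the non-zero graded coefficients of the generators
  set F : Finset K := (insert (x ^ p) (insert (y ^ p)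
    ((t ×ˢ (Finset.univ : Finset (Fin p × Fin p))).image (fun q => cf q.1 q.2)))).filter (fun f => f ≠ 0) with hFdef
  have hFM : ∀ f ∈ F, f ∈ M := by
    intro f hf
    rw [hFdef, Finset.mem_filter, Finset.mem_insert, Finset.mem_insert, Finset.mem_image] at hf
    rcases hf with ⟨rfl | rfl | ⟨q, hq, rfl⟩, -⟩
    · exact hpM x
    · exact hpM y
    · exact hcfM q.1 (Finset.mem_product.mp hq).1 q.2
  have hF0 : ∀ f ∈ F, f ≠ 0 := fun f hf => (Finset.mem_filter.mp hf).2
  have hxpF : x ^ p ∈ F := Finset.mem_filter.mpr ⟨by simp, pow_ne_zero _ hx⟩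
  have hypF : y ^ p ∈ F := Finset.mem_filter.mpr ⟨by simp, pow_ne_zero _ hy⟩
  have hcfF : ∀ a ∈ t, ∀ ab, cf a ab ≠ 0 → cf a ab ∈ F := by
    intro a ha ab hne
    refine Finset.mem_filter.mpr ⟨Finset.mem_insert_of_mem (Finset.mem_insert_of_mem ?_), hne⟩
    exact Finset.mem_image.mpr ⟨(a, ab), Finset.mem_product.mpr ⟨ha, Finset.mem_univ _⟩, rfl⟩
  -- §2 the monomialising model of the twist field
  obtain ⟨A₂, hA₂O, hA₂fg, hApA₂, hA₂M, hreg₂, z, hz, hdimT, hmono⟩ :=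
    port_monomialModel p (hLU3 k) hEmb O A hAO hAfg hdimA hdim3 hzd g₀ M hM F hFM hF0
  haveI := hreg₂
  choose! ε ex hεT hεv hfeq using hmono
  have hrsop : IsRsopPart z := ⟨hreg₂, 0, Fin.elim0, by simpa using hdimT, by simpa using hz⟩
  have hz0 : ∀ i, (z i : K) ≠ 0 := fun i h => hrsop.ne_zero i (Subtype.ext h)
  have hzv : ∀ i, O.valuation (z i : K) < 1 := by
    intro i
    have hzi : z i ∈ maximalIdeal (locAtCentre A₂.toSubring O) := by
      rw [← hz]; exact Ideal.subset_span ⟨i, rfl⟩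
    exact (mem_maximalIdeal_locAtCentre_iff hA₂O (z i)).mp hzi
  have hzM : ∀ i, (z i : K) ∈ M := fun i => hA₂M _ (z i).2
  have hzV : ∀ i, ∃ w : K, w ≠ 0 ∧ O.valuation (z i : K) = O.valuation (w ^ p) :=
    fun i => hV _ (hzM i) (hz0 i)
  have hxA : x ^ p = ε (x ^ p) * ∏ i, (z i : K) ^ ex (x ^ p) i := hfeq _ hxpF
  have hyB : y ^ p = ε (y ^ p) * ∏ i, (z i : K) ^ ex (y ^ p) i := hfeq _ hypF
  -- exponent data of the non-zero graded pieces
  set pieces : Finset (K × (Fin p × Fin p)) := (t ×ˢ Finset.univ).filter (fun q => cf q.1 q.2 ≠ 0) with hpieces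
  set E : Finset ((Fin 3 → ℤ) × (Fin p × Fin p)) := pieces.image (fun q => (ex (cf q.1 q.2), q.2)) with hEdef
  have hE : ∀ e ∈ E, O.valuation ((∏ i, (z i : K) ^ e.1 i) * (x ^ (e.2.1 : ℕ) * y ^ (e.2.2 : ℕ))) ≤ 1 := by
    intro e he
    obtain ⟨q, hq, rfl⟩ := Finset.mem_image.mp he
    obtain ⟨hq1, hq2⟩ := Finset.mem_filter.mp hq
    have hat : q.1 ∈ t := (Finset.mem_product.mp hq1).1
    have hF' : cf q.1 q.2 ∈ F := hcfF q.1 hat q.2 hq2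
    have hval : O.valuation (cf q.1 q.2 * (x ^ (q.2.1 : ℕ) * y ^ (q.2.2 : ℕ))) ≤ 1 :=
      (O.valuation_le_one_iff _).mpr (hcfO q.1 hat q.2)
    rw [hfeq _ hF', mul_assoc, map_mul, hεv _ hF', one_mul] at hval
    simpa using hval
  -- §3 the toric chart
  obtain ⟨ρ, hρ, c, a, b, u, ha, hb, hu, hupos, huzero, hzu, hEu⟩ :=
    port_toricChart p O A hAO hAfg hdimA hdim3 htd hx hy hP (fun i => (z i : K)) hz0 hzv hzV (ε (x ^ p)) (ε (y ^ p))
      (hεv _ hxpF) (hεv _ hypF) (ex (x ^ p)) (ex (y ^ p)) hxA hyB E hE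
  -- (PB0): the value-zero chart monomials involve no `x`, `y`, hence lie in `M`
  have hab0 : ∀ j : Fin 3, ρ ≤ (j : ℕ) → a j = 0 ∧ b j = 0 := by
    intro j hj
    obtain ⟨W, hW0, hW⟩ := exists_valuation_prod_zpow_eq O (fun i => (z i : K)) hzV (c j)
    exact exponents_eq_zero_of_valuation_eq_one O hP (ha j) (hb j) hW0 hW (by rw [← hu j]; exact huzero j hj)
  have huM : ∀ j : Fin 3, ρ ≤ (j : ℕ) → u j ∈ M := by
    intro j hj
    obtain ⟨ha0, hb0⟩ := hab0 j hj
    rw [hu j, ha0, hb0, pow_zero, pow_zero, mul_one, mul_one]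
    exact prod_mem fun i _ => zpow_mem (hzM i) _
  have hu0 : ∀ j, u j ≠ 0 := by
    intro j
    rw [hu j]
    exact mul_ne_zero (Finset.prod_ne_zero_iff.mpr fun i _ => zpow_ne_zero _ (hz0 i))
      (mul_ne_zero (pow_ne_zero _ hx) (pow_ne_zero _ hy))
  -- the unit factors `α^i β^j` are units of `T`
  have hunit : ∀ ia ib : ℤ, ε (x ^ p) ^ ia * ε (y ^ p) ^ ib ∈ locAtCentre A₂.toSubring O ∧
      O.valuation (ε (x ^ p) ^ ia * ε (y ^ p) ^ ib) = 1 := fun ia ib =>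
    ⟨mul_mem (zpow_mem_locAtCentre (hεT _ hxpF) (hεv _ hxpF) ia) (zpow_mem_locAtCentre (hεT _ hypF) (hεv _ hypF) ib),
      by rw [map_mul, map_zpow₀, map_zpow₀, hεv _ hxpF, hεv _ hypF, one_zpow, one_zpow, one_mul]⟩
  have hzu' : ∀ i : Fin 3, ∃ (ε' : K) (d : Fin 3 → ℤ), ε' ∈ locAtCentre A₂.toSubring O ∧ O.valuation ε' = 1 ∧
      (∀ j : Fin 3, (j : ℕ) < ρ → 0 ≤ d j) ∧ (∃ j : Fin 3, (j : ℕ) < ρ ∧ 0 < d j) ∧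
      ((z i : K)) = ε' * ∏ j, u j ^ d j := by
    intro i
    obtain ⟨d, ia, ib, hd, hdpos, hzi⟩ := hzu i
    exact ⟨_, d, (hunit ia ib).1, (hunit ia ib).2, hd, hdpos, hzi⟩
  -- the generators of `A` as unit-weighted sums of chart monomials with `d_{<ρ} ≥ 0`
  choose! dE iaE ibE hdE hkerE hmonE using hEu
  have htu' : ∀ a₀ ∈ t, ∃ (ν : Fin p × Fin p → K) (d : Fin p × Fin p → Fin 3 → ℤ),
      (∀ l, ν l = 0 ∨ (ν l ∈ locAtCentre A₂.toSubring O ∧ O.valuation (ν l) = 1)) ∧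
      (∀ l, ∀ j : Fin 3, (j : ℕ) < ρ → 0 ≤ d l j) ∧ a₀ = ∑ l, ν l * ∏ j, u j ^ d l j := by
    intro a₀ ha₀
    have hmemE : ∀ ab, cf a₀ ab ≠ 0 → (ex (cf a₀ ab), ab) ∈ E := fun ab hne =>
      Finset.mem_image.mpr ⟨(a₀, ab), Finset.mem_filter.mpr ⟨Finset.mem_product.mpr ⟨ha₀, Finset.mem_univ _⟩, hne⟩, rfl⟩
    refine ⟨fun ab => if cf a₀ ab = 0 then 0 else
        ε (cf a₀ ab) * (ε (x ^ p) ^ iaE (ex (cf a₀ ab), ab) * ε (y ^ p) ^ ibE (ex (cf a₀ ab), ab)),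
      fun ab => if cf a₀ ab = 0 then 0 else dE (ex (cf a₀ ab), ab), ?_, ?_, ?_⟩
    · intro ab
      by_cases h0 : cf a₀ ab = 0
      · exact Or.inl (by simp [h0])
      · refine Or.inr ?_
        simp only [h0, if_false]
        have hF' := hcfF a₀ ha₀ ab h0
        exact ⟨mul_mem (hεT _ hF') (hunit _ _).1, by rw [map_mul, hεv _ hF', (hunit _ _).2, one_mul]⟩
    · intro ab j hj
      by_cases h0 : cf a₀ ab = 0
      · simp [h0]
      · simp only [h0, if_false]
        exact hdE _ (hmemE ab h0) j hj
    · conv_lhs => rw [← hsum a₀ ha₀]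
      refine Finset.sum_congr rfl fun ab _ => ?_
      by_cases h0 : cf a₀ ab = 0
      · simp [h0]
      · simp only [h0, if_false]
        have hF' := hcfF a₀ ha₀ ab h0
        have hmon := hmonE _ (hmemE ab h0)
        simp only at hmon
        calc cf a₀ ab * (x ^ (ab.1 : ℕ) * y ^ (ab.2 : ℕ))
            = (ε (cf a₀ ab) * ∏ i, (z i : K) ^ ex (cf a₀ ab) i) * (x ^ (ab.1 : ℕ) * y ^ (ab.2 : ℕ)) := by
              rw [← hfeq _ hF']
          _ = ε (cf a₀ ab) * ((∏ i, (z i : K) ^ ex (cf a₀ ab) i) * (x ^ (ab.1 : ℕ) * y ^ (ab.2 : ℕ))) := by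
              rw [mul_assoc]
          _ = ε (cf a₀ ab) * (ε (x ^ p) ^ iaE (ex (cf a₀ ab), ab) * ε (y ^ p) ^ ibE (ex (cf a₀ ab), ab)) *
                ∏ j, u j ^ dE (ex (cf a₀ ab), ab) j := by
              rw [hmon]; ring
  -- §13 the regular chart algebra and its regular parameter in `M`
  obtain ⟨A'', hA''O, hAA'', hA''fg, hreg'', ψ, hψ1, hψ2, hψM⟩ :=
    port_regularParameter p O A hAO hAfg hdimA hdim3 hzd M A₂ hA₂O hA₂fg hApA₂ hA₂M hreg₂ z hz hdimT t ht ρ hρ u hu0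
      hupos huzero huM hzu' htu'
  -- exit: clean form (3)
  obtain ⟨cM, hcM⟩ := (hM _).mp hψM
  exact cleanLUConcl_of_parameter O A A'' hA''O hAA'' hA''fg hreg'' g₀ ψ hψ1 hψ2 cM hcM

/-- The same, with F-02 consumed in its main-theorem form `CossartPiltant2019` (LU³ by ✓ `CossartPiltant2019.lu3`). [folklore] -/
theorem cleanLU3DefectPRankTwoAt_of_cossartPiltant2019 (p : ℕ) [Fact p.Prime]
    (hCP : CossartPiltant2019.{0})
    (hEmb : ∀ (Z : Scheme.{0}) [IsIntegral Z] [IsNoetherian Z], Scheme.IsRegular Z →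
      Scheme.IsExcellent Z → ∀ (X : Set Z), IsClosed X → X ≠ Set.univ → topologicalKrullDim X ≤ 2 →
        ∃ (Z' : Scheme.{0}) (π : Z' ⟶ Z), IsProper π ∧ Function.Surjective π.base ∧
          (∃ U : Z.Opens, (U : Set Z) = Xᶜ ∧ IsIso (π ∣_ U)) ∧
          IsStrictNormalCrossingsDivisor Z' (π.base ⁻¹' X)) :
    CleanLU3DefectPRankTwoAt p :=
  cleanLU3DefectPRankTwoAt_of_portStubs p (fun k _ => hCP.lu3 k) hEmb

end Composition

end Summit.ResolutionOfSingularities.ResolutionOfSingularities.Cruxes.DescentPerfectToAll.CpSibling.PRankTwoAssembly
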